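import Mathlib
import Literature.NumberTheory.Automorphic.HigherGreenFunction

/-!
# Higher Green functions: convergence, sign and `Γ₀(N)`-invariance (layer 0 of Gross–Zagier §II.2)

Proved companion file of `Literature/NumberTheory/Automorphic/HigherGreenFunction.lean`, which
vendors the Gross–Zagier algebraicity conjecture `GKZAlgebraicity` (Bruinier–Li–Yang 2025,
Conjecture 1.1, a theorem by their Theorem 1.4). The published proof (regularised theta lifts on
`GSpin(n,2)` Shimura varieties, Siegel–Weil, CM cycles and Shimura reciprocity, Li 2021,
Bruinier–Ehlen–Yang 2021) is far beyond Mathlib; this file proves the bottom analytic layer that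
any formalisation starts from — the statements implicit in (1.1)–(1.3) of the paper
(Gross–Zagier 1986, §II.2), which also show that the Lean `tsum`/Bochner-integral definitions of
`HigherGreenFunction.lean` carry their intended (non-junk) values:

* Heine's integrand `(t + √(t²-1) cosh u)^{-s}` is positive and continuous (`t > 0`), dominated by
  `(2/√(t²-1))^s e^{-su}` (`t > 1`), hence integrable on `(0, ∞)` for `t > 1`, `s ≥ 1`
  (`integrableOn_greenQ_integrand`): the Legendre function `Q_{s-1}(t) = greenQ s t` of (1.1) is a
  genuine convergent integral, `0 < Q_{s-1}(t) ≤ (2/√(t²-1))^s / s` (`greenQ_pos`, `greenQ_le`),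
  `Q_{s-1}(t) ≤ (4^s/s) t^{-s}` for `t ≥ 2` (`greenQ_le_of_two_le`), and `t ↦ Q_{s-1}(t)` is
  decreasing on `(1, ∞)` (`greenQ_antitoneOn`);
* `R_N^{(m)} R_N^{(n)} ⊆ R_N^{(mn)}` (`mul_mem_heckeMatrices`), in particular `R_N^{(m)}` is stable
  under `Γ₀(N) = R_N^{(1)}` on both sides;
* the principal higher Green function (1.3) is a finite sum (`principalHigherGreen_eq_sum`);
* **convergence** (`summable_inv_pow_coshDistArg`, `summable_greenQ_heckeMatrices`): for `m ≥ 1`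
  and an integer `s ≥ 2` the defining series `Σ_{γ ∈ R_N^{(m)}} Q_{s-1}(cosh d(z₁, γ z₂))` of
  `G_s^{Γ₀(N), m}(z₁, z₂)` ((1.1)–(1.2), "`Re(s) > 1`") is summable for all `z₁, z₂ ∈ ℍ`. The
  proof bounds `cosh d(z₁, γz₂)^{-s} ≤ (2y₁v)^s/((x₁-u)² + y₁²)^s` (`γz₂ = u + iv`), parametrises
  `R_N^{(m)}` injectively by the bottom row `(c, d)` and one top entry, sums the top entry by the
  lattice-sum bound `Σ_{e ∈ ℤ} ((e/q - β)² + A²)^{-s} ≤ (6|q|A + 3)/A^{2s}`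
  (`summable_tsum_inv_intDivSub_sq_add_sq_pow`), and the bottom rows by Mathlib's Eisenstein-series
  estimate `Σ_{(c,d) ≠ 0} ‖(c,d)‖^{-k} < ∞`, `k = 2s - 1 > 2`; the finitely many terms near the
  logarithmic singularity are then set aside using `Σ_γ cosh d(z₁, γz₂)^{-s} < ∞` itself;
* **sign** (`higherGreen_neg`): off the Hecke correspondence `T_m`, `G_s^{Γ₀(N), m}(z₁, z₂) < 0`
  (every term is positive and `R_N^{(m)} ∋ diag(1, m)`), so `higherGreen` is a genuine nonzero value;
* **`Γ₀(N)`-invariance** in each variable (`higherGreen_smul_left`, `higherGreen_smul_right`):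
  `G_s^{Γ₀(N), m}` descends to `X₀(N) × X₀(N)`, via the isometric action of `SL(2, ℝ)` on `ℍ` and
  the reindexings `δ ↦ γ⁻¹δ`, `δ ↦ δγ` of `R_N^{(m)}`; likewise `T_m` and `G_{r+1,f}`
  (`onHeckeCorrespondence_smul_left_iff`/`_right_iff`, `principalHigherGreen_smul_left`/`_right`);
* **symmetry** (`higherGreen_symm`, `onHeckeCorrespondence_comm`, `principalHigherGreen_symm`):
  `G_s^{Γ₀(N), m}(z₁, z₂) = G_s^{Γ₀(N), m}(z₂, z₁)` — the second line of (1.2), `T_m` acting on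
  either variable — by the involution `γ ↦ γ^{adj}` of `R_N^{(m)}`; this uses that elements of
  `GL(2, ℝ)` of positive determinant act by isometries (`dist_smul_smul_of_det_pos`, through
  `det(g)^{-1/2} g ∈ SL(2, ℝ)`) and that `γ^{adj} γ = m · 1` acts trivially;
* **(1.2), first line** (`higherGreen_eq_tsum_higherGreen_one`): for `m ≥ 1`, `s ≥ 2` and ANY
  system of representatives `(βᵢ)` of `Γ₀(N) \ R_N^{(m)}`,
  `G_s^{Γ₀(N), m}(z₁, z₂) = Σᵢ G_s^{Γ₀(N)}(z₁, βᵢ z₂)` — the printed definition of `G_s^{Γ₀(N), m}`,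
  recovered from the unfolded sum by the bijection `(i, γ) ↦ γβᵢ`, `ι × Γ₀(N) → R_N^{(m)}`, and
  fibrewise summation of the absolutely convergent double series; for a prime `p ∤ N` with the
  standard representatives `(1 j; 0 p)`, `(p 0; 0 1)` of the tree's `heckeRep`
  (Diamond–Shurman Prop. 5.2.1) this is the explicit `T_p`-formula `higherGreen_prime_eq_sum`
  (`heckeMatrices_eq_delta0`: `R_N^{(m)} = Δ₀ᴺ(m)` for `gcd(m, N) = 1`);
* **CM points** (`IsCMPointOfDisc.sl_smul`, `isCMPointOfDisc_sl_smul_iff`): the discriminant of a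
  CM point is `SL(2, ℤ)`-invariant (transport of the primitive positive definite form by `γ⁻¹`),
  so together with the invariances above the vendored `GKZAlgebraicity`, which quantifies over lifts
  `z₁, z₂ ∈ ℍ`, is a statement about CM points of `X₀(N) × X₀(N)` as in Conjecture 1.1;
* **normalisations** (`exists_isAlgebraic_rat_mul_log_norm`): `q · κ log|α| = κ log|α'|` with
  `α' = |α|^q ∈ ℚ̄ˣ` for rational `q` (`|α|` and its rational powers are algebraic), which is the
  robustness of the conclusion `∃ α ∈ ℚ̄ˣ, G = |d₁d₂|^{-r/2} log|α|` under the rational rescalings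
  discussed in the docstring of `GKZAlgebraicity`;
* **the classical `T_m`-formula** (`higherGreen_eq_sum_divisorsAntidiagonal`): for `gcd(m, N) = 1`,
  `G_s^{Γ₀(N), m}(z₁, z₂) = Σ_{ad = m} Σ_{b mod d} G_s^{Γ₀(N)}(z₁, (a z₂ + b)/d)` — (1.2) with the
  transversal `(a b; 0 d)` of `Γ₀(N) \ R_N^{(m)}` (row reduction inside `Γ₀(N)`,
  `exists_gamma0_mul_apply_eq_zero`; normal form `exists_gamma0_mul_eq_upper`; uniqueness
  `upper_normalForm_unique`); in particular the sum in (1.2) is finite;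
* **the logarithmic singularity** (`greenQ_le_log`, `log_le_greenQ`, `tendsto_greenQ_nhdsGT_one`):
  `4^{-s}(log 2 - ½ log(t²-1)) ≤ Q_{s-1}(t) ≤ 1 + log 2 - ½ log(t²-1)` for `1 < t ≤ 2`, so
  `Q_{s-1}(t) ≍ -log(t-1) → +∞` as `t → 1⁺` — the logarithmic singularity of `G_s^{Γ₀(N)}` along
  the diagonal asserted after (1.1) (splitting Heine's integral at `u₀ = log(2/√(t²-1))`);
* **vanishing at the cusp `∞`** (`exists_tsum_inv_pow_coshDistArg_one_le`,
  `tendsto_higherGreen_one_atImInfty`): `Σ_{γ ∈ R_N^{(1)}} cosh d(z₁, γw)^{-s} ≤ K (Im w)^{1-s}` for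
  `Im w ≥ max(1, Im z₁)` (the refined majorant keeping `v_γ²`: rows `c = 0` via the lattice-sum
  lemma with `B = √(y₁² + v²)`, rows `c ≠ 0` via the lattice-sum lemma in `d` with `B = |c| v`
  and `Σ_c |c|^{2-2s} < ∞`), hence `G_s^{Γ₀(N)}(z₁, w) → 0` as `Im w → ∞` (`s ≥ 2`) — "the function
  vanishes when one of the `z_i` approaches the cusps" (after (1.1)), at the cusp `∞`; and at
  EVERY cusp `σ∞`, `σ ∈ SL(2, ℤ)` (`tendsto_higherGreen_one_sl_smul_atImInfty`: the coset `Γ₀(N)σ`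
  is dominated by the full `SL(2, ℤ)`-sum, i.e. the case `N = 1`), and for `G_s^{Γ₀(N), m}`,
  `gcd(m, N) = 1`, at `∞` (`tendsto_higherGreen_atImInfty`, through the classical `T_m`-formula and
  `Im((aw+b)/d) = (a/d) Im w`);
* **continuity** (`continuousAt_greenQ`, `continuousOn_greenQ`, `continuousAt_higherGreen`,
  `continuousAt_principalHigherGreen`): `Q_{s-1}` is continuous on `(1, ∞)` (dominated convergence
  for Heine's integral), and `w ↦ G_s^{Γ₀(N), m}(z₁, w)`, `w ↦ G_{r+1,f}(z₁, w)` are continuous off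
  `T_m`, resp. `Z_f` — the series converges locally uniformly because each `γ` acts isometrically,
  so `cosh d(z₁, γw₀) ≤ e^{d(w,w₀)} cosh d(z₁, γw)` (`coshDistArg_le_exp_mul`) gives a summable
  majorant on the hyperbolic unit ball (Weierstrass `M`-test); by symmetry the same in the first
  variable (`continuousAt_higherGreen_left`, `tendsto_higherGreen_one_sl_smul_atImInfty_left`),
  and jointly in `(z₁, z₂)` (`continuousAt_higherGreen₂`, `continuousAt_principalHigherGreen₂`,
  via `|d(z, γw) - d(z₁, γw₀)| ≤ d(z, z₁) + d(w, w₀)`): `G_s^{Γ₀(N), m}` and `G_{r+1,f}` are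
  continuous functions on `(X₀(N) × X₀(N)) ∖ T_m`, resp. `∖ Z_f`;
* **changing the level** (`higherGreen_level_one_eq_tsum`):
  `G_s^{SL(2,ℤ)}(z₁, z₂) = Σᵢ G_s^{Γ₀(N)}(z₁, σᵢ z₂)` for any system of representatives `(σᵢ)` of
  `Γ₀(N) \ SL(2, ℤ)` (fibrewise summation of the absolutely convergent level-`1` series);
* **the hypothesis class** (`IsRatWeaklyHolomorphicForm.add`, `.smul`, `.periodic`): rational
  `M^{!,∞}_k(Γ₀(N))` is a `ℚ`-vector space and its members are `1`-periodic;
* **`T_m = Z(m, 0)`** (`onHeckeCorrespondence_iff_exists_incidence`): the incidence relation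
  `(X(z₁, z₂), x) = c z₁z₂ + d z₁ - a z₂ - b = 0` of the proof of Corollary 2.4 is equivalent to
  `x z₂ = z₁`; and the degenerate case of Conjecture 1.1 (`isRatWeaklyHolomorphicForm_zero`,
  `principalHigherGreen_eq_zero_of_coeff`, `gkz_conclusion_of_coeff_eq_zero`: no principal part,
  `α = 1`).

## References

* J. H. Bruinier, Y. Li, T. Yang, *Deformations of theta integrals and a conjecture of
  Gross–Zagier*, Forum Math. Sigma 13 (2025), arXiv:2204.10604, (1.1)–(1.3). [`BruinierLiYang2025`]
* B. Gross, D. Zagier, *Heegner points and derivatives of L-series*, Invent. Math. 84 (1986),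
  §II.2. [`GrossZagier1986`]
-/

noncomputable section

namespace Literature.NumberTheory.Automorphic

open UpperHalfPlane Complex CongruenceSubgroup Real Set Filter
open _root_.MeasureTheory
open scoped MatrixGroups ModularForm Manifold Real

open Literature.NumberTheory.EllipticCurves.ModularForms (intGL intGL_apply coe_intGL intGL_mul
  mapGL_eq_intGL)

/-! ## Heine's integral `Q_{s-1}(t) = ∫₀^∞ (t + √(t²-1) cosh u)^{-s} du` -/

/-- The base `t + √(t² - 1) cosh u` of Heine's integrand is positive for `t > 0`. [folklore] -/
theorem greenQ_base_pos {t : ℝ} (ht : 0 < t) (u : ℝ) : 0 < t + √(t ^ 2 - 1) * Real.cosh u := by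
  have h1 : 0 ≤ √(t ^ 2 - 1) * Real.cosh u := mul_nonneg (Real.sqrt_nonneg _) (Real.cosh_pos u).le
  linarith

/-- Heine's integrand `(t + √(t² - 1) cosh u)^{-s}` is positive for `t > 0`. [folklore] -/
theorem greenQ_integrand_pos {t : ℝ} (ht : 0 < t) (s : ℕ) (u : ℝ) :
    0 < ((t + √(t ^ 2 - 1) * Real.cosh u) ^ s)⁻¹ :=
  inv_pos.mpr (pow_pos (greenQ_base_pos ht u) s)

/-- Heine's integrand is continuous in `u` (for `t > 0`, where the base does not vanish).
[folklore] -/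
theorem continuous_greenQ_integrand {t : ℝ} (ht : 0 < t) (s : ℕ) :
    Continuous fun u : ℝ => ((t + √(t ^ 2 - 1) * Real.cosh u) ^ s)⁻¹ :=
  Continuous.inv₀ (by fun_prop) fun u => (pow_pos (greenQ_base_pos ht u) s).ne'

/-- `e^u / 2 ≤ cosh u`. [folklore] -/
theorem exp_div_two_le_cosh (u : ℝ) : Real.exp u / 2 ≤ Real.cosh u := by
  rw [Real.cosh_eq]
  linarith [Real.exp_pos (-u)]

/-- Exponential domination of Heine's integrand: for `t > 1`,
`(t + √(t² - 1) cosh u)^{-s} ≤ (2 / √(t² - 1))^s e^{-su}` (drop `t ≥ 0` and use `cosh u ≥ e^u/2`).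
[folklore] -/
theorem greenQ_integrand_le {t : ℝ} (ht : 1 < t) (s : ℕ) (u : ℝ) :
    ((t + √(t ^ 2 - 1) * Real.cosh u) ^ s)⁻¹ ≤
      (2 / √(t ^ 2 - 1)) ^ s * Real.exp (-(s : ℝ) * u) := by
  have hsq : 0 < √(t ^ 2 - 1) := Real.sqrt_pos.mpr (by nlinarith)
  have h0 : 0 < √(t ^ 2 - 1) * (Real.exp u / 2) := by positivity
  have h1 : √(t ^ 2 - 1) * (Real.exp u / 2) ≤ t + √(t ^ 2 - 1) * Real.cosh u := by
    have h2 : √(t ^ 2 - 1) * (Real.exp u / 2) ≤ √(t ^ 2 - 1) * Real.cosh u :=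
      mul_le_mul_of_nonneg_left (exp_div_two_le_cosh u) hsq.le
    linarith
  calc ((t + √(t ^ 2 - 1) * Real.cosh u) ^ s)⁻¹
      ≤ ((√(t ^ 2 - 1) * (Real.exp u / 2)) ^ s)⁻¹ :=
        inv_anti₀ (pow_pos h0 s) (pow_le_pow_left₀ h0.le h1 s)
    _ = (2 / √(t ^ 2 - 1)) ^ s * Real.exp (-(s : ℝ) * u) := by
        rw [neg_mul, Real.exp_neg, Real.exp_nat_mul, mul_pow, div_pow, div_pow]
        field_simp

/-- **Heine's integral converges**: for `t > 1` and `s ≥ 1` the integrand of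
`Q_{s-1}(t) = ∫₀^∞ (t + √(t² - 1) cosh u)^{-s} du` ((1.1) of Bruinier–Li–Yang 2025) is integrable on
`(0, ∞)`, so `greenQ s t` is a genuine convergent integral. [cite: BruinierLiYang2025, (1.1)] -/
theorem integrableOn_greenQ_integrand {t : ℝ} (ht : 1 < t) {s : ℕ} (hs : 1 ≤ s) :
    IntegrableOn (fun u : ℝ => ((t + √(t ^ 2 - 1) * Real.cosh u) ^ s)⁻¹) (Ioi 0) := by
  have hs' : -(s : ℝ) < 0 := by
    have : (1 : ℝ) ≤ s := by exact_mod_cast hs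
    linarith
  have hmaj : IntegrableOn (fun u : ℝ => (2 / √(t ^ 2 - 1)) ^ s * Real.exp (-(s : ℝ) * u))
      (Ioi 0) :=
    (integrableOn_exp_mul_Ioi hs' 0).const_mul _
  refine hmaj.mono' (continuous_greenQ_integrand (by linarith) s).aestronglyMeasurable
    (ae_of_all _ fun u => ?_)
  rw [Real.norm_of_nonneg (greenQ_integrand_pos (by linarith) s u).le]
  exact greenQ_integrand_le ht s u

/-- **`Q_{s-1}(t) > 0`** for `t > 1`, `s ≥ 1`: Heine's integral of a positive integrable function.
[folklore] -/
theorem greenQ_pos {t : ℝ} (ht : 1 < t) {s : ℕ} (hs : 1 ≤ s) : 0 < greenQ s t := by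
  rw [greenQ, setIntegral_pos_iff_support_of_nonneg_ae
    (ae_of_all _ fun u => (greenQ_integrand_pos (by linarith) s u).le)
    (integrableOn_greenQ_integrand ht hs)]
  have hsupp : (Function.support fun u : ℝ => ((t + √(t ^ 2 - 1) * Real.cosh u) ^ s)⁻¹) ∩ Ioi 0
      = Ioi 0 :=
    Set.inter_eq_right.mpr fun u _ => (greenQ_integrand_pos (by linarith) s u).ne'
  rw [hsupp, Real.volume_Ioi]
  simp

/-- **Upper bound** `Q_{s-1}(t) ≤ (2/√(t² - 1))^s / s` for `t > 1`, `s ≥ 1` (integrate the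
exponential majorant `greenQ_integrand_le`); with `t = cosh d` this reads
`Q_{s-1}(cosh d) ≤ 2^s / (s sinh^s d)`, the exponential decay `O(e^{-sd})` in the hyperbolic
distance behind the convergence of (1.1) for `Re(s) > 1`. [folklore] -/
theorem greenQ_le {t : ℝ} (ht : 1 < t) {s : ℕ} (hs : 1 ≤ s) :
    greenQ s t ≤ (2 / √(t ^ 2 - 1)) ^ s / s := by
  have hs0 : (0 : ℝ) < s := by exact_mod_cast hs
  have hs' : -(s : ℝ) < 0 := by linarith
  have hmaj : IntegrableOn (fun u : ℝ => (2 / √(t ^ 2 - 1)) ^ s * Real.exp (-(s : ℝ) * u))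
      (Ioi 0) :=
    (integrableOn_exp_mul_Ioi hs' 0).const_mul _
  calc greenQ s t
      ≤ ∫ u in Ioi (0 : ℝ), (2 / √(t ^ 2 - 1)) ^ s * Real.exp (-(s : ℝ) * u) :=
        setIntegral_mono_on (integrableOn_greenQ_integrand ht hs) hmaj measurableSet_Ioi
          fun u _ => greenQ_integrand_le ht s u
    _ = (2 / √(t ^ 2 - 1)) ^ s / s := by
        rw [integral_const_mul, integral_exp_mul_Ioi hs' 0]
        field_simp
        simp

/-- **`Q_{s-1}` is decreasing on `(1, ∞)`**: the integrand is pointwise decreasing in `t`.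
[folklore] -/
theorem greenQ_antitoneOn {s : ℕ} (hs : 1 ≤ s) : AntitoneOn (greenQ s) (Ioi 1) := by
  intro t₁ ht₁ t₂ ht₂ h
  rw [Set.mem_Ioi] at ht₁ ht₂
  refine setIntegral_mono_on (integrableOn_greenQ_integrand ht₂ hs)
    (integrableOn_greenQ_integrand ht₁ hs) measurableSet_Ioi fun u _ => ?_
  have h0 : 0 < t₁ + √(t₁ ^ 2 - 1) * Real.cosh u := greenQ_base_pos (by linarith) u
  have h1 : t₁ + √(t₁ ^ 2 - 1) * Real.cosh u ≤ t₂ + √(t₂ ^ 2 - 1) * Real.cosh u :=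
    add_le_add h (mul_le_mul_of_nonneg_right (Real.sqrt_le_sqrt (by nlinarith))
      (Real.cosh_pos u).le)
  exact inv_anti₀ (pow_pos h0 s) (pow_le_pow_left₀ h0.le h1 s)

/-! ## `R_N^{(m)} · R_N^{(n)} ⊆ R_N^{(mn)}` -/

/-- The graded multiplicativity `R_N^{(m)} R_N^{(n)} ⊆ R_N^{(mn)}` of the determinant-`m` parts of
the order `R_N = {(a b; Nc d)}` (Bruinier–Li–Yang 2025, (1.2)); with `m = 1` or `n = 1`
(`R_N^{(1)} = Γ₀(N)`, `coe_mem_heckeMatrices_one_iff`) this is the two-sided `Γ₀(N)`-stability of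
`R_N^{(m)}` that makes `G_s^{Γ₀(N), m}` a function on `X₀(N) × X₀(N)`. [folklore] -/
theorem mul_mem_heckeMatrices {N : ℕ} {m n : ℤ} {γ δ : Matrix (Fin 2) (Fin 2) ℤ}
    (hγ : γ ∈ heckeMatrices N m) (hδ : δ ∈ heckeMatrices N n) :
    γ * δ ∈ heckeMatrices N (m * n) := by
  rw [mem_heckeMatrices] at hγ hδ ⊢
  refine ⟨by rw [Matrix.det_mul, hγ.1, hδ.1], ?_⟩
  rw [Matrix.mul_apply, Fin.sum_univ_two]
  exact dvd_add (dvd_mul_of_dvd_left hγ.2 _) (dvd_mul_of_dvd_right hδ.2 _)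

/-- Left `Γ₀(N)`-stability of `R_N^{(m)}`. [folklore] -/
theorem gamma0_mul_mem_heckeMatrices {N : ℕ} {m : ℤ} {γ : SL(2, ℤ)} (hγ : γ ∈ Gamma0 N)
    {δ : Matrix (Fin 2) (Fin 2) ℤ} (hδ : δ ∈ heckeMatrices N m) :
    (γ : Matrix (Fin 2) (Fin 2) ℤ) * δ ∈ heckeMatrices N m := by
  simpa using mul_mem_heckeMatrices ((coe_mem_heckeMatrices_one_iff γ).mpr hγ) hδ

/-- Right `Γ₀(N)`-stability of `R_N^{(m)}`. [folklore] -/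
theorem mul_gamma0_mem_heckeMatrices {N : ℕ} {m : ℤ} {δ : Matrix (Fin 2) (Fin 2) ℤ}
    (hδ : δ ∈ heckeMatrices N m) {γ : SL(2, ℤ)} (hγ : γ ∈ Gamma0 N) :
    δ * (γ : Matrix (Fin 2) (Fin 2) ℤ) ∈ heckeMatrices N m := by
  simpa using mul_mem_heckeMatrices hδ ((coe_mem_heckeMatrices_one_iff γ).mpr hγ)

/-- The adjugate `(d -b; -c a)` of an element of `R_N^{(m)}` lies in `R_N^{(m)}` (this is the
symmetry `T_m = T_m^t` of the Hecke correspondence). [folklore] -/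
theorem adjugate_mem_heckeMatrices {N : ℕ} {m : ℤ} {γ : Matrix (Fin 2) (Fin 2) ℤ}
    (hγ : γ ∈ heckeMatrices N m) : γ.adjugate ∈ heckeMatrices N m := by
  rw [mem_heckeMatrices] at hγ ⊢
  refine ⟨by rw [Matrix.det_adjugate, hγ.1]; simp, ?_⟩
  rw [Matrix.adjugate_fin_two]
  simpa using hγ.2

/-! ## The principal higher Green function is a finite sum -/

/-- (1.3) of Bruinier–Li–Yang 2025 is a **finite** sum: if `c(m) = 0` for `m < -M` (finite
principal part, as in `IsRatWeaklyHolomorphicForm.finite_principalPart`) then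
`G_{r+1,f}(z₁, z₂) = Σ_{m=1}^{M} c(-m) m^r G^{Γ₀(N), m}_{r+1}(z₁, z₂)`.
[cite: BruinierLiYang2025, (1.3)] -/
theorem principalHigherGreen_eq_sum {N r M : ℕ} {c : ℤ → ℚ}
    (hc : ∀ m : ℤ, m < -(M : ℤ) → c m = 0) (z₁ z₂ : ℍ) :
    principalHigherGreen N r c z₁ z₂ =
      ∑ m ∈ Finset.Icc 1 M,
        (c (-(m : ℤ)) : ℝ) * (m : ℝ) ^ r * higherGreen N (r + 1) (m : ℤ) z₁ z₂ := by
  unfold principalHigherGreen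
  rw [← Equiv.pnatEquivNat.symm.tsum_eq]
  simp only [Equiv.pnatEquivNat_symm_apply, Nat.succPNat_coe, Nat.succ_eq_add_one]
  -- `Σ_{k < K} G(k+1) = Σ_{1 ≤ m ≤ K} G(m)`
  have key : ∀ (G : ℕ → ℝ) (K : ℕ),
      ∑ k ∈ Finset.range K, G (k + 1) = ∑ m ∈ Finset.Icc 1 K, G m := by
    intro G K
    induction K with
    | zero => simp
    | succ K ih => rw [Finset.sum_range_succ, ih, Finset.sum_Icc_succ_top (by omega)]
  rw [tsum_eq_sum (s := Finset.range M)]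
  · exact key (fun m => (c (-(m : ℤ)) : ℝ) * (m : ℝ) ^ r * higherGreen N (r + 1) (m : ℤ) z₁ z₂) M
  · intro n hn
    rw [Finset.mem_range, not_lt] at hn
    have h0 : c (-((n + 1 : ℕ) : ℤ)) = 0 := hc _ (by push_cast; omega)
    rw [h0, Rat.cast_zero, zero_mul, zero_mul]

/-! ## Lattice sums `Σ_{e ∈ ℤ} 1/((e/q - β)² + A²)^s` -/


/-- `Σ_{n<M} 1/(n² + B²) ≤ (3B + 1)/B²` for `B > 0`: the `⌊B⌋ + 1` terms with `n ≤ B` are each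
`≤ 1/B²`, and `Σ_{n > ⌊B⌋} 1/n² ≤ 2/(⌊B⌋ + 1) ≤ 2/B` (`sum_Ioo_inv_sq_le`). [folklore] -/
theorem sum_range_inv_natSq_add_sq_le {B : ℝ} (hB : 0 < B) (M : ℕ) :
    ∑ n ∈ Finset.range M, ((n : ℝ) ^ 2 + B ^ 2)⁻¹ ≤ (3 * B + 1) / B ^ 2 := by
  classical
  set N := ⌊B⌋₊ with hN
  rw [← Finset.sum_filter_add_sum_filter_not (Finset.range M) (fun n => n ≤ N)]
  have h1 : ∑ n ∈ (Finset.range M).filter (fun n => n ≤ N), ((n : ℝ) ^ 2 + B ^ 2)⁻¹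
      ≤ (B + 1) / B ^ 2 := by
    calc ∑ n ∈ (Finset.range M).filter (fun n => n ≤ N), ((n : ℝ) ^ 2 + B ^ 2)⁻¹
        ≤ ∑ n ∈ (Finset.range M).filter (fun n => n ≤ N), (B ^ 2)⁻¹ :=
          Finset.sum_le_sum fun n _ => inv_anti₀ (by positivity) (by nlinarith [sq_nonneg (n : ℝ)])
      _ = ((Finset.range M).filter (fun n => n ≤ N)).card * (B ^ 2)⁻¹ := by
          rw [Finset.sum_const, nsmul_eq_mul]
      _ ≤ (N + 1 : ℝ) * (B ^ 2)⁻¹ := by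
          gcongr
          have hsub : (Finset.range M).filter (fun n => n ≤ N) ⊆ Finset.range (N + 1) := by
            intro n hn
            simp only [Finset.mem_filter, Finset.mem_range] at hn ⊢
            omega
          exact_mod_cast (Finset.card_le_card hsub).trans (Finset.card_range (N + 1)).le
      _ ≤ (B + 1) * (B ^ 2)⁻¹ := by
          gcongr
          exact Nat.floor_le hB.le
      _ = (B + 1) / B ^ 2 := by rw [div_eq_mul_inv]
  have h2 : ∑ n ∈ (Finset.range M).filter (fun n => ¬n ≤ N), ((n : ℝ) ^ 2 + B ^ 2)⁻¹ ≤ 2 / B := by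
    have hset : (Finset.range M).filter (fun n => ¬n ≤ N) = Finset.Ioo N M := by
      ext n
      simp only [Finset.mem_filter, Finset.mem_range, Finset.mem_Ioo, not_le]
      omega
    rw [hset]
    calc ∑ n ∈ Finset.Ioo N M, ((n : ℝ) ^ 2 + B ^ 2)⁻¹
        ≤ ∑ n ∈ Finset.Ioo N M, ((n : ℝ) ^ 2)⁻¹ := Finset.sum_le_sum fun n hn => by
          have hn1 : (1 : ℝ) ≤ n := by
            have h := (Finset.mem_Ioo.mp hn).1
            exact_mod_cast (show 1 ≤ n by omega)
          exact inv_anti₀ (by positivity) (by nlinarith)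
      _ ≤ 2 / (N + 1 : ℝ) := sum_Ioo_inv_sq_le N M
      _ ≤ 2 / B := by
          gcongr
          exact (Nat.lt_floor_add_one B).le
  calc _ ≤ (B + 1) / B ^ 2 + 2 / B := add_le_add h1 h2
    _ = (3 * B + 1) / B ^ 2 := by
        field_simp
        ring

/-- `Σ_{n<M} 1/(n² + B²)^s ≤ (3B + 1)/B^{2s}` for `B > 0`, `s ≥ 1`. [folklore] -/
theorem sum_range_inv_natSq_add_sq_pow_le {B : ℝ} (hB : 0 < B) {s : ℕ} (hs : 1 ≤ s) (M : ℕ) :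
    ∑ n ∈ Finset.range M, (((n : ℝ) ^ 2 + B ^ 2) ^ s)⁻¹ ≤ (3 * B + 1) / B ^ (2 * s) := by
  have key : ∀ n : ℕ, (((n : ℝ) ^ 2 + B ^ 2) ^ s)⁻¹ ≤
      ((B ^ 2) ^ (s - 1))⁻¹ * ((n : ℝ) ^ 2 + B ^ 2)⁻¹ := by
    intro n
    rw [← mul_inv]
    apply inv_anti₀ (by positivity)
    calc (B ^ 2) ^ (s - 1) * ((n : ℝ) ^ 2 + B ^ 2)
        ≤ ((n : ℝ) ^ 2 + B ^ 2) ^ (s - 1) * ((n : ℝ) ^ 2 + B ^ 2) := by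
          gcongr
          nlinarith [sq_nonneg (n : ℝ)]
      _ = ((n : ℝ) ^ 2 + B ^ 2) ^ s := by rw [← pow_succ, Nat.sub_add_cancel hs]
  calc ∑ n ∈ Finset.range M, (((n : ℝ) ^ 2 + B ^ 2) ^ s)⁻¹
      ≤ ∑ n ∈ Finset.range M, ((B ^ 2) ^ (s - 1))⁻¹ * ((n : ℝ) ^ 2 + B ^ 2)⁻¹ :=
        Finset.sum_le_sum fun n _ => key n
    _ = ((B ^ 2) ^ (s - 1))⁻¹ * ∑ n ∈ Finset.range M, ((n : ℝ) ^ 2 + B ^ 2)⁻¹ := by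
        rw [Finset.mul_sum]
    _ ≤ ((B ^ 2) ^ (s - 1))⁻¹ * ((3 * B + 1) / B ^ 2) := by
        gcongr
        exact sum_range_inv_natSq_add_sq_le hB M
    _ = (3 * B + 1) / B ^ (2 * s) := by
        rw [← pow_mul, show 2 * s = 2 * (s - 1) + 2 by omega, pow_add]
        field_simp

/-- The family `n ↦ 1/(n² + B²)^s` (`n ∈ ℕ`) is summable for `B > 0`, `s ≥ 1`. [folklore] -/
theorem summable_inv_natSq_add_sq_pow {B : ℝ} (hB : 0 < B) {s : ℕ} (hs : 1 ≤ s) :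
    Summable fun n : ℕ => (((n : ℝ) ^ 2 + B ^ 2) ^ s)⁻¹ :=
  summable_of_sum_range_le (fun n => by positivity) (sum_range_inv_natSq_add_sq_pow_le hB hs)

/-- `Σ_{n ∈ ℕ} 1/(n² + B²)^s ≤ (3B + 1)/B^{2s}` for `B > 0`, `s ≥ 1`. [folklore] -/
theorem tsum_inv_natSq_add_sq_pow_le {B : ℝ} (hB : 0 < B) {s : ℕ} (hs : 1 ≤ s) :
    ∑' n : ℕ, (((n : ℝ) ^ 2 + B ^ 2) ^ s)⁻¹ ≤ (3 * B + 1) / B ^ (2 * s) :=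
  Real.tsum_le_of_sum_range_le (fun n => by positivity) (sum_range_inv_natSq_add_sq_pow_le hB hs)

/-- Shifted unit lattice, shift in `[0, 1)`: `Σ_{e ∈ ℤ} 1/((e - θ)² + B²)^s ≤ (6B + 3)/B^{2s}`
together with summability. [folklore] -/
theorem summable_tsum_inv_intSub_sq_add_sq_pow_of_lt_one {B : ℝ} (hB : 0 < B) {θ : ℝ}
    (hθ₀ : 0 ≤ θ) (hθ₁ : θ < 1) {s : ℕ} (hs : 1 ≤ s) :
    Summable (fun e : ℤ => ((((e : ℝ) - θ) ^ 2 + B ^ 2) ^ s)⁻¹) ∧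
      ∑' e : ℤ, ((((e : ℝ) - θ) ^ 2 + B ^ 2) ^ s)⁻¹ ≤ (6 * B + 3) / B ^ (2 * s) := by
  set g : ℕ → ℝ := fun n => (((n : ℝ) ^ 2 + B ^ 2) ^ s)⁻¹ with hg_def
  have hg : Summable g := summable_inv_natSq_add_sq_pow hB hs
  have hgU : ∑' n, g n ≤ (3 * B + 1) / B ^ (2 * s) := tsum_inv_natSq_add_sq_pow_le hB hs
  have hg0 : ∀ n, 0 ≤ g n := fun n => by positivity
  set f : ℤ → ℝ := fun e => ((((e : ℝ) - θ) ^ 2 + B ^ 2) ^ s)⁻¹ with hf_def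
  have hf0 : ∀ e, 0 ≤ f e := fun e => by positivity
  -- nonnegative part: `f n ≤ g (n - 1)`
  have hg' : Summable fun n : ℕ => g (n - 1) :=
    (summable_nat_add_iff 1).mp (by simpa only [Nat.add_sub_cancel] using hg)
  have h1 : ∀ n : ℕ, f n ≤ g (n - 1) := by
    intro n
    simp only [hf_def, hg_def, Int.cast_natCast]
    apply inv_anti₀ (by positivity)
    apply pow_le_pow_left₀ (by positivity)
    rcases Nat.eq_zero_or_pos n with rfl | hn
    · simp only [Nat.zero_sub, CharP.cast_eq_zero, zero_sub]
      nlinarith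
    · have hcast : ((n - 1 : ℕ) : ℝ) = n - 1 := by
        rw [Nat.cast_sub hn, Nat.cast_one]
      rw [hcast]
      have h1n : (1 : ℝ) ≤ n := by exact_mod_cast hn
      nlinarith
  have hs1 : Summable fun n : ℕ => f n :=
    Summable.of_nonneg_of_le (fun n => hf0 n) h1 hg'
  -- negative part: `f (-(n+1)) ≤ g n`
  have h2 : ∀ n : ℕ, f (-(n + 1)) ≤ g n := by
    intro n
    simp only [hf_def, hg_def]
    push_cast
    apply inv_anti₀ (by positivity)
    apply pow_le_pow_left₀ (by positivity)
    nlinarith [mul_nonneg (by linarith : (0 : ℝ) ≤ 1 + θ) (by positivity : (0 : ℝ) ≤ 2 * n + 1 + θ)]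
  have hs2 : Summable fun n : ℕ => f (-(n + 1)) :=
    Summable.of_nonneg_of_le (fun n => hf0 _) h2 hg
  refine ⟨Summable.of_nat_of_neg_add_one hs1 hs2, ?_⟩
  rw [tsum_of_nat_of_neg_add_one hs1 hs2]
  have e1 : ∑' n : ℕ, f n ≤ g 0 + ∑' n, g n := by
    calc ∑' n : ℕ, f n ≤ ∑' n : ℕ, g (n - 1) := hs1.tsum_le_tsum h1 hg'
      _ = g 0 + ∑' n, g n := by
          rw [hg'.tsum_eq_zero_add]
          simp only [Nat.zero_sub, Nat.add_sub_cancel]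
  have e2 : ∑' n : ℕ, f (-(n + 1)) ≤ ∑' n, g n := hs2.tsum_le_tsum h2 hg
  have e3 : g 0 = (B ^ (2 * s))⁻¹ := by
    simp only [hg_def, Nat.cast_zero, ne_eq, OfNat.ofNat_ne_zero, not_false_eq_true, zero_pow,
      zero_add, pow_mul]
  calc ∑' n : ℕ, f n + ∑' n : ℕ, f (-(n + 1))
      ≤ (g 0 + ∑' n, g n) + ∑' n, g n := add_le_add e1 e2
    _ ≤ ((B ^ (2 * s))⁻¹ + (3 * B + 1) / B ^ (2 * s)) + (3 * B + 1) / B ^ (2 * s) := by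
        rw [e3]; gcongr
    _ = (6 * B + 3) / B ^ (2 * s) := by
        field_simp
        ring

/-- Shifted unit lattice, arbitrary shift: `Σ_{e ∈ ℤ} 1/((e - c)² + B²)^s ≤ (6B + 3)/B^{2s}`
together with summability (reduce to the shift `fract c ∈ [0,1)` by `e ↦ e + ⌊c⌋`). [folklore] -/
theorem summable_tsum_inv_intSub_sq_add_sq_pow {B : ℝ} (hB : 0 < B) (c : ℝ) {s : ℕ}
    (hs : 1 ≤ s) :
    Summable (fun e : ℤ => ((((e : ℝ) - c) ^ 2 + B ^ 2) ^ s)⁻¹) ∧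
      ∑' e : ℤ, ((((e : ℝ) - c) ^ 2 + B ^ 2) ^ s)⁻¹ ≤ (6 * B + 3) / B ^ (2 * s) := by
  obtain ⟨hS, hT⟩ := summable_tsum_inv_intSub_sq_add_sq_pow_of_lt_one hB (Int.fract_nonneg c)
    (Int.fract_lt_one c) hs
  set F : ℤ → ℝ := fun e => ((((e : ℝ) - Int.fract c) ^ 2 + B ^ 2) ^ s)⁻¹ with hF
  have hfun : (fun e : ℤ => ((((e : ℝ) - c) ^ 2 + B ^ 2) ^ s)⁻¹) =
      fun e : ℤ => F (Equiv.subRight ⌊c⌋ e) := by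
    ext e
    simp only [hF, Equiv.subRight_apply, Int.cast_sub, Int.fract]
    ring_nf
  refine ⟨?_, ?_⟩
  · rw [hfun]
    exact (Equiv.summable_iff (Equiv.subRight ⌊c⌋)).mpr hS
  · rw [hfun, Equiv.tsum_eq]
    exact hT

/-- **Scaled shifted lattice sum**: for real `q ≠ 0`, `A > 0`, `s ≥ 1` and any `β`,
`Σ_{e ∈ ℤ} 1/((e/q - β)² + A²)^s ≤ (6|q|A + 3)/A^{2s}` — linear growth in the inverse spacing
`|q|` — together with summability. [folklore] -/
theorem summable_tsum_inv_intDivSub_sq_add_sq_pow {q : ℝ} (hq : q ≠ 0) (β : ℝ) {A : ℝ}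
    (hA : 0 < A) {s : ℕ} (hs : 1 ≤ s) :
    Summable (fun e : ℤ => ((((e : ℝ) / q - β) ^ 2 + A ^ 2) ^ s)⁻¹) ∧
      ∑' e : ℤ, ((((e : ℝ) / q - β) ^ 2 + A ^ 2) ^ s)⁻¹ ≤ (6 * |q| * A + 3) / A ^ (2 * s) := by
  have hqA : 0 < |q| * A := mul_pos (abs_pos.mpr hq) hA
  obtain ⟨hS, hT⟩ := summable_tsum_inv_intSub_sq_add_sq_pow hqA (q * β) hs
  have hfun : ∀ e : ℤ, ((((e : ℝ) / q - β) ^ 2 + A ^ 2) ^ s)⁻¹ =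
      (q ^ 2) ^ s * ((((e : ℝ) - q * β) ^ 2 + (|q| * A) ^ 2) ^ s)⁻¹ := by
    intro e
    have hid : ((e : ℝ) / q - β) ^ 2 + A ^ 2 = (((e : ℝ) - q * β) ^ 2 + (|q| * A) ^ 2) / q ^ 2 := by
      rw [mul_pow, sq_abs]
      field_simp
    rw [hid, div_pow, inv_div, ← div_eq_mul_inv]
  simp_rw [hfun]
  refine ⟨hS.mul_left _, ?_⟩
  rw [tsum_mul_left]
  calc (q ^ 2) ^ s * ∑' e : ℤ, ((((e : ℝ) - q * β) ^ 2 + (|q| * A) ^ 2) ^ s)⁻¹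
      ≤ (q ^ 2) ^ s * ((6 * (|q| * A) + 3) / (|q| * A) ^ (2 * s)) := by gcongr
    _ = (6 * |q| * A + 3) / A ^ (2 * s) := by
        rw [← sq_abs q, ← pow_mul, mul_pow]
        field_simp


/-! ## Möbius algebra for `R_N^{(m)}` acting on `ℍ` through `intGL` -/

section MoebiusIntGL

variable {N : ℕ} {m : ℤ} {γ : Matrix (Fin 2) (Fin 2) ℤ}

/-- An element of `R_N^{(m)}`, `m ≠ 0`, has nonzero determinant. [folklore] -/
theorem det_ne_zero_of_mem_heckeMatrices (hm : m ≠ 0) (hγ : γ ∈ heckeMatrices N m) :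
    γ.det ≠ 0 := by
  rw [(mem_heckeMatrices.mp hγ).1]
  exact hm

/-- The determinant of `intGL γ` is the cast of `det γ`. [folklore] -/
theorem val_det_intGL (hγ : γ.det ≠ 0) : ((intGL γ).det : ℝ) = (γ.det : ℝ) := by
  rw [Matrix.GeneralLinearGroup.val_det_apply, coe_intGL hγ, ← RingHom.mapMatrix_apply,
    ← RingHom.map_det, eq_intCast]

/-- `denom (intGL γ) z = c z + d`. [folklore] -/
theorem denom_intGL (hγ : γ.det ≠ 0) (z : ℍ) :
    denom (intGL γ) z = (γ 1 0 : ℂ) * z + (γ 1 1 : ℂ) := by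
  simp [denom, intGL_apply hγ]

/-- `num (intGL γ) z = a z + b`. [folklore] -/
theorem num_intGL (hγ : γ.det ≠ 0) (z : ℍ) :
    num (intGL γ) z = (γ 0 0 : ℂ) * z + (γ 0 1 : ℂ) := by
  simp [num, intGL_apply hγ]

/-- `c z + d ≠ 0` for the bottom row of an integer matrix of nonzero determinant. [folklore] -/
theorem linear_ne_zero_of_det_ne_zero (hγ : γ.det ≠ 0) (z : ℍ) :
    (γ 1 0 : ℂ) * z + (γ 1 1 : ℂ) ≠ 0 := by
  rw [← denom_intGL hγ]
  exact denom_ne_zero _ z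

/-- For `γ = (a b; c d) ∈ R_N^{(m)}`, `m > 0`: `γ z = (a z + b)/(c z + d)`. [folklore] -/
theorem coe_intGL_smul (hm : 0 < m) (hγ : γ ∈ heckeMatrices N m) (z : ℍ) :
    ((intGL γ • z : ℍ) : ℂ) = ((γ 0 0 : ℂ) * z + γ 0 1) / ((γ 1 0 : ℂ) * z + γ 1 1) := by
  have hdet := det_ne_zero_of_mem_heckeMatrices hm.ne' hγ
  have hpos : 0 < ((intGL γ).det : ℝ) := by
    rw [val_det_intGL hdet, (mem_heckeMatrices.mp hγ).1]
    exact_mod_cast hm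
  rw [coe_smul_of_det_pos hpos, num_intGL hdet, denom_intGL hdet]

/-- For `γ = (a b; c d) ∈ R_N^{(m)}`, `m > 0`: `Im(γ z) = m Im(z) / |c z + d|²`. [folklore] -/
theorem im_intGL_smul (hm : 0 < m) (hγ : γ ∈ heckeMatrices N m) (z : ℍ) :
    (intGL γ • z).im = (m : ℝ) * z.im / Complex.normSq ((γ 1 0 : ℂ) * z + γ 1 1) := by
  have hdet := det_ne_zero_of_mem_heckeMatrices hm.ne' hγ
  rw [UpperHalfPlane.im_smul_eq_div_normSq (intGL γ) z, denom_intGL hdet, val_det_intGL hdet,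
    (mem_heckeMatrices.mp hγ).1, abs_of_pos (by exact_mod_cast hm : (0 : ℝ) < m)]

/-- The Möbius identity `(a z + b)/(c z + d) = a/c - (ad - bc)/(c (c z + d))` for `c ≠ 0`.
[folklore] -/
theorem moebius_eq_of_ne_zero {a b c d w : ℂ} (hc : c ≠ 0) (hden : c * w + d ≠ 0) :
    (a * w + b) / (c * w + d) = a / c - (a * d - b * c) / (c * (c * w + d)) := by
  have h2 : c * (c * w + d) ≠ 0 := mul_ne_zero hc hden
  rw [div_sub_div _ _ hc h2, div_eq_div_iff hden (mul_ne_zero hc h2)]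
  ring

/-- For `γ = (a b; c d) ∈ R_N^{(m)}`, `m > 0`, `c ≠ 0`:
`Re(γ z) = a/c - Re(m / (c (c z + d)))`. [folklore] -/
theorem re_intGL_smul_of_ne_zero (hm : 0 < m) (hγ : γ ∈ heckeMatrices N m) (hc : γ 1 0 ≠ 0)
    (z : ℍ) :
    (intGL γ • z).re =
      (γ 0 0 : ℝ) / (γ 1 0 : ℝ) - ((m : ℂ) / ((γ 1 0 : ℂ) * ((γ 1 0 : ℂ) * z + γ 1 1))).re := by
  have hdet := det_ne_zero_of_mem_heckeMatrices hm.ne' hγ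
  have hden := linear_ne_zero_of_det_ne_zero hdet z
  have hdet' : (γ 0 0 : ℂ) * γ 1 1 - γ 0 1 * γ 1 0 = m := by
    have h := (mem_heckeMatrices.mp hγ).1
    rw [Matrix.det_fin_two] at h
    exact_mod_cast h
  rw [← UpperHalfPlane.coe_re, coe_intGL_smul hm hγ,
    moebius_eq_of_ne_zero (by exact_mod_cast hc) hden, hdet', Complex.sub_re]
  congr 1
  have h2 : (γ 0 0 : ℂ) / (γ 1 0 : ℂ) = (((γ 0 0 : ℝ) / (γ 1 0 : ℝ) : ℝ) : ℂ) := by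
    push_cast
    rfl
  rw [h2, Complex.ofReal_re]

/-- For `γ = (a b; 0 d) ∈ R_N^{(m)}`, `m > 0`: `d ≠ 0` and `a d = m`. [folklore] -/
theorem mul_eq_of_mem_heckeMatrices_of_eq_zero (hγ : γ ∈ heckeMatrices N m) (hc : γ 1 0 = 0) :
    γ 0 0 * γ 1 1 = m := by
  have h := (mem_heckeMatrices.mp hγ).1
  rw [Matrix.det_fin_two, hc, mul_zero, sub_zero] at h
  exact h

/-- For `γ = (a b; 0 d) ∈ R_N^{(m)}`, `m > 0`: `Re(γ z) = m Re(z)/d² + b/d`. [folklore] -/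
theorem re_intGL_smul_of_eq_zero (hm : 0 < m) (hγ : γ ∈ heckeMatrices N m) (hc : γ 1 0 = 0)
    (z : ℍ) :
    (intGL γ • z).re = (m : ℝ) * z.re / (γ 1 1 : ℝ) ^ 2 + (γ 0 1 : ℝ) / (γ 1 1 : ℝ) := by
  have had := mul_eq_of_mem_heckeMatrices_of_eq_zero hγ hc
  have hd : (γ 1 1 : ℝ) ≠ 0 := by
    have : γ 1 1 ≠ 0 := by
      rintro h
      rw [h, mul_zero] at had
      exact hm.ne' had.symm
    exact_mod_cast this
  have hw : ((intGL γ • z : ℍ) : ℂ) = ((γ 0 0 : ℂ) * z + γ 0 1) / (γ 1 1 : ℂ) := by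
    rw [coe_intGL_smul hm hγ, hc]
    simp
  have hre : (intGL γ • z).re = ((γ 0 0 : ℝ) * z.re + γ 0 1) / (γ 1 1 : ℝ) := by
    rw [← UpperHalfPlane.coe_re, hw, Complex.div_intCast_re]
    simp
  have ha : (γ 0 0 : ℝ) = m / (γ 1 1 : ℝ) := by
    rw [eq_div_iff hd]
    exact_mod_cast had
  rw [hre, ha]
  field_simp

end MoebiusIntGL

/-! ## The elementary bound `t^{-s} ≤ (2 y₁ v)^s / ((x₁ - u)² + y₁²)^s` -/

/-- With `t = 1 + |z₁ - w|²/(2 y₁ v) = ((x₁-u)² + y₁² + v²)/(2 y₁ v)` (`w = u + iv`):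
`t^{-s} ≤ (2 y₁ v)^s ((x₁ - u)² + y₁²)^{-s}`. [folklore] -/
theorem inv_pow_coshDistArg_le (z₁ w : ℍ) (s : ℕ) :
    ((1 + dist (z₁ : ℂ) (w : ℂ) ^ 2 / (2 * z₁.im * w.im)) ^ s)⁻¹ ≤
      (2 * z₁.im * w.im) ^ s * (((z₁.re - w.re) ^ 2 + z₁.im ^ 2) ^ s)⁻¹ := by
  have hy := z₁.im_pos
  have hv := w.im_pos
  have hdist : dist (z₁ : ℂ) (w : ℂ) ^ 2 = (z₁.re - w.re) ^ 2 + (z₁.im - w.im) ^ 2 := by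
    rw [Complex.dist_eq, Complex.sq_norm, Complex.normSq_apply, Complex.sub_re, Complex.sub_im,
      UpperHalfPlane.coe_re, UpperHalfPlane.coe_re, UpperHalfPlane.coe_im, UpperHalfPlane.coe_im]
    ring
  have ht : 1 + dist (z₁ : ℂ) (w : ℂ) ^ 2 / (2 * z₁.im * w.im) =
      ((z₁.re - w.re) ^ 2 + z₁.im ^ 2 + w.im ^ 2) / (2 * z₁.im * w.im) := by
    rw [hdist]
    field_simp
    ring
  rw [ht, div_pow, inv_div, div_eq_mul_inv]
  exact mul_le_mul_of_nonneg_left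
    (inv_anti₀ (by positivity) (pow_le_pow_left₀ (by positivity) (by nlinarith) s))
    (by positivity)

/-- `t = 1 + |z₁ - w|²/(2 y₁ v) ≥ 1 > 0`. [folklore] -/
theorem one_le_coshDistArg (z₁ w : ℍ) :
    1 ≤ 1 + dist (z₁ : ℂ) (w : ℂ) ^ 2 / (2 * z₁.im * w.im) := by
  have hy := z₁.im_pos
  have hv := w.im_pos
  have : 0 ≤ dist (z₁ : ℂ) (w : ℂ) ^ 2 / (2 * z₁.im * w.im) := by positivity
  linarith

/-! ## Injectivity of `γ ↦ (bottom row, a or b)` on `R_N^{(m)}` -/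

/-- Two elements of `R_N^{(m)}` (`m ≠ 0`) with the same bottom row `(c, d)` and the same `a`
(if `c ≠ 0`) resp. the same `b` (if `c = 0`) are equal: the determinant condition recovers the
remaining entry. [folklore] -/
theorem eq_of_mem_heckeMatrices_of_row_eq {N : ℕ} {m : ℤ} (hm : m ≠ 0)
    {γ γ' : Matrix (Fin 2) (Fin 2) ℤ} (hγ : γ ∈ heckeMatrices N m) (hγ' : γ' ∈ heckeMatrices N m)
    (hc : γ 1 0 = γ' 1 0) (hd : γ 1 1 = γ' 1 1)
    (htop : (if γ 1 0 = 0 then γ 0 1 else γ 0 0) = if γ' 1 0 = 0 then γ' 0 1 else γ' 0 0) :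
    γ = γ' := by
  have hdet := (mem_heckeMatrices.mp hγ).1
  have hdet' := (mem_heckeMatrices.mp hγ').1
  rw [Matrix.det_fin_two] at hdet hdet'
  rw [← hc] at htop
  by_cases h0 : γ 1 0 = 0
  · rw [if_pos h0, if_pos h0] at htop
    have had : γ 0 0 * γ 1 1 = m := by rw [h0, mul_zero, sub_zero] at hdet; exact hdet
    have had' : γ' 0 0 * γ 1 1 = m := by
      rw [← hc, h0, mul_zero, sub_zero, ← hd] at hdet'; exact hdet'
    have hdne : γ 1 1 ≠ 0 := by
      rintro hz
      rw [hz, mul_zero] at had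
      exact hm had.symm
    have ha : γ 0 0 = γ' 0 0 := mul_right_cancel₀ hdne (had.trans had'.symm)
    ext i j
    fin_cases i <;> fin_cases j
    · exact ha
    · exact htop
    · exact hc
    · exact hd
  · rw [if_neg h0, if_neg h0] at htop
    have hb : γ 0 1 * γ 1 0 = γ' 0 1 * γ 1 0 := by
      rw [← htop, ← hc, ← hd] at hdet'
      linarith
    have hb' : γ 0 1 = γ' 0 1 := mul_right_cancel₀ h0 hb
    ext i j
    fin_cases i <;> fin_cases j
    · exact htop
    · exact hb'
    · exact hc
    · exact hd

/-! ## Convergence of `Σ_{γ ∈ R_N^{(m)}} cosh d(z₁, γ z₂)^{-s}` for `s ≥ 2` -/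

/-- **Convergence of the Poincaré-type series behind (1.1)–(1.2).** For `m ≥ 1`, `s ≥ 2` and any
`z₁, z₂ ∈ ℍ`, the family `γ ↦ t_γ^{-s}`, `t_γ = 1 + |z₁ - γz₂|²/(2 Im z₁ Im γz₂) = cosh d(z₁, γ z₂)`,
is summable over `γ ∈ R_N^{(m)}`. Proof: `t_γ^{-s} ≤ (2y₁v)^s/((x₁-u)² + y₁²)^s` with
`γ z₂ = u + iv`, `v = m y₂/|c z₂ + d|²`, and for fixed bottom row `(c, d)` the real parts `u` run
through `a/c - Re(m/(c(cz₂+d)))` (`c ≠ 0`, indexed injectively by `a`) or `m x₂/d² + b/d`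
(`c = 0`, indexed by `b`); the lattice-sum bound `Σ_e ((e/q-β)² + y₁²)^{-s} ≤ (6|q|y₁+3)/y₁^{2s}`
and `v ≤ m y₂ /(r(z₂)² ‖(c,d)‖²)` reduce summability to `Σ_{(c,d) ≠ 0} ‖(c,d)‖^{1-2s} < ∞`
(Mathlib's Eisenstein-series bound, `2s - 1 > 2`). This is the absolute convergence of (1.1)/(1.2)
of Bruinier–Li–Yang 2025 for integral `s > 1` (Gross–Zagier 1986, §II.2), in the form needed for
Lean's unconditional `tsum`. [cite: BruinierLiYang2025, (1.1)–(1.2)] -/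
theorem summable_inv_pow_coshDistArg {N : ℕ} {m : ℤ} (hm : 0 < m) {s : ℕ} (hs : 2 ≤ s)
    (z₁ z₂ : ℍ) :
    Summable fun γ : heckeMatrices N m =>
      ((1 + dist (z₁ : ℂ) ((intGL (γ : Matrix (Fin 2) (Fin 2) ℤ) • z₂ : ℍ) : ℂ) ^ 2 /
        (2 * z₁.im * (intGL (γ : Matrix (Fin 2) (Fin 2) ℤ) • z₂).im)) ^ s)⁻¹ := by
  have hy : 0 < z₁.im := z₁.im_pos
  have hs1 : 1 ≤ s := by omega
  -- data attached to a bottom row `x = (c, d)`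
  let V : (Fin 2 → ℤ) → ℝ := fun x => (m : ℝ) * z₂.im / Complex.normSq ((x 0 : ℂ) * z₂ + x 1)
  let q : (Fin 2 → ℤ) → ℤ := fun x => if x 0 = 0 then x 1 else x 0
  let β : (Fin 2 → ℤ) → ℝ := fun x =>
    if x 0 = 0 then z₁.re - (m : ℝ) * z₂.re / (x 1 : ℝ) ^ 2
    else z₁.re + ((m : ℂ) / ((x 0 : ℂ) * ((x 0 : ℂ) * z₂ + x 1))).re
  let f : (Fin 2 → ℤ) → ℤ → ℝ := fun x e =>
    ((((e : ℝ) / (q x : ℝ) - β x) ^ 2 + z₁.im ^ 2) ^ s)⁻¹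
  let G : (Fin 2 → ℤ) × ℤ → ℝ := fun p =>
    if p.1 = 0 then 0 else (2 * z₁.im * V p.1) ^ s * f p.1 p.2
  let key : heckeMatrices N m → (Fin 2 → ℤ) × ℤ := fun γ =>
    (![(γ : Matrix (Fin 2) (Fin 2) ℤ) 1 0, (γ : Matrix (Fin 2) (Fin 2) ℤ) 1 1],
      if (γ : Matrix (Fin 2) (Fin 2) ℤ) 1 0 = 0 then (γ : Matrix (Fin 2) (Fin 2) ℤ) 0 1
      else (γ : Matrix (Fin 2) (Fin 2) ℤ) 0 0)
  -- `key` is injective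
  have hkey : Function.Injective key := by
    intro γ γ' h
    apply Subtype.ext
    simp only [key, Prod.mk.injEq] at h
    obtain ⟨hrow, htop⟩ := h
    have hc := congrFun hrow 0
    have hd := congrFun hrow 1
    simp only [Matrix.cons_val_zero, Matrix.cons_val_one] at hc hd
    exact eq_of_mem_heckeMatrices_of_row_eq hm.ne' γ.2 γ'.2 hc hd htop
  -- elementary facts about rows
  have hm' : (0 : ℝ) ≤ m := by exact_mod_cast hm.le
  have hV0 : ∀ x, 0 ≤ V x := fun x =>
    div_nonneg (mul_nonneg hm' z₂.im_pos.le) (Complex.normSq_nonneg _)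
  have hG0 : ∀ p, 0 ≤ G p := by
    intro p
    simp only [G]
    split_ifs
    · exact le_rfl
    · have := hV0 p.1
      positivity
  have hq : ∀ x : Fin 2 → ℤ, x ≠ 0 → q x ≠ 0 := by
    intro x hx h
    simp only [q] at h
    split_ifs at h with h0
    · exact hx (by ext i; fin_cases i <;> simp [h0, h])
    · exact h0 h
  have hnorm1 : ∀ x : Fin 2 → ℤ, x ≠ 0 → 1 ≤ ‖x‖ := by
    intro x hx
    rw [EisensteinSeries.norm_eq_max_natAbs]
    have : x 0 ≠ 0 ∨ x 1 ≠ 0 := by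
      by_contra h
      simp only [not_or, not_not] at h
      exact hx (by ext i; fin_cases i <;> simp [h.1, h.2])
    have hmax : 1 ≤ max (x 0).natAbs (x 1).natAbs := by
      rcases this with h | h
      · exact le_max_of_le_left (Int.natAbs_pos.mpr h)
      · exact le_max_of_le_right (Int.natAbs_pos.mpr h)
    exact_mod_cast hmax
  have hqle : ∀ x : Fin 2 → ℤ, |(q x : ℝ)| ≤ ‖x‖ := by
    intro x
    rw [EisensteinSeries.norm_eq_max_natAbs, ← Int.cast_abs, Int.abs_eq_natAbs, Int.cast_natCast]
    simp only [q]
    split_ifs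
    · exact_mod_cast le_max_right _ _
    · exact_mod_cast le_max_left _ _
  have hVle : ∀ x : Fin 2 → ℤ, x ≠ 0 →
      V x ≤ ((m : ℝ) * z₂.im / EisensteinSeries.r z₂ ^ 2) / ‖x‖ ^ 2 := by
    intro x hx
    have hr := EisensteinSeries.r_mul_max_le z₂ hx
    have hr0 : 0 < EisensteinSeries.r z₂ * ‖x‖ := mul_pos (EisensteinSeries.r_pos z₂) (by
      have := hnorm1 x hx; linarith)
    have hns : (EisensteinSeries.r z₂ * ‖x‖) ^ 2 ≤ Complex.normSq ((x 0 : ℂ) * z₂ + x 1) := by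
      rw [Complex.normSq_eq_norm_sq]
      exact pow_le_pow_left₀ hr0.le hr 2
    simp only [V]
    rw [div_div, ← mul_pow]
    exact div_le_div_of_nonneg_left (by positivity) (by positivity) hns
  -- inner sums
  have hinner : ∀ x : Fin 2 → ℤ, x ≠ 0 →
      Summable (f x) ∧ ∑' e, f x e ≤ (6 * |(q x : ℝ)| * z₁.im + 3) / z₁.im ^ (2 * s) := by
    intro x hx
    have hqx : (q x : ℝ) ≠ 0 := by exact_mod_cast hq x hx
    exact summable_tsum_inv_intDivSub_sq_add_sq_pow hqx (β x) hy hs1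
  -- the constant
  set C : ℝ := 2 * z₁.im * ((m : ℝ) * z₂.im / EisensteinSeries.r z₂ ^ 2) with hC
  set K : ℝ := C ^ s * (6 * z₁.im + 3) / z₁.im ^ (2 * s) with hK
  have hC0 : 0 ≤ C := by positivity
  -- row sums of `G`
  have hrow : ∀ x : Fin 2 → ℤ, ∑' e, G (x, e) ≤ K * (‖x‖ ^ (2 * s - 1))⁻¹ := by
    intro x
    by_cases hx : x = 0
    · simp only [G, hx, if_true, tsum_zero, norm_zero]
      rw [zero_pow (by omega), inv_zero, mul_zero]
    · simp only [G, hx, if_false]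
      rw [tsum_mul_left]
      obtain ⟨-, hT⟩ := hinner x hx
      have h1 : 1 ≤ ‖x‖ := hnorm1 x hx
      have hx0 : 0 < ‖x‖ := by linarith
      have e1 : 2 * z₁.im * V x ≤ C / ‖x‖ ^ 2 := by
        rw [hC, mul_div_assoc]
        exact mul_le_mul_of_nonneg_left (hVle x hx) (by positivity)
      have e2 : (6 * |(q x : ℝ)| * z₁.im + 3) / z₁.im ^ (2 * s) ≤
          (6 * z₁.im + 3) * ‖x‖ / z₁.im ^ (2 * s) := by
        apply div_le_div_of_nonneg_right _ (by positivity)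
        nlinarith [hqle x, abs_nonneg (q x : ℝ)]
      calc (2 * z₁.im * V x) ^ s * ∑' e, f x e
          ≤ (C / ‖x‖ ^ 2) ^ s * ((6 * z₁.im + 3) * ‖x‖ / z₁.im ^ (2 * s)) := by
            have : 0 ≤ ∑' e, f x e := tsum_nonneg fun e => by positivity
            have h2 : 0 ≤ 2 * z₁.im * V x := by have := hV0 x; positivity
            gcongr
            exact hT.trans e2
        _ = K * (‖x‖ ^ (2 * s - 1))⁻¹ := by
            rw [hK, div_pow]
            have hpow : ‖x‖ ^ (2 * s) = ‖x‖ ^ (2 * s - 1) * ‖x‖ := by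
              rw [← pow_succ, Nat.sub_add_cancel (by omega)]
            rw [← pow_mul, hpow]
            field_simp
  -- summability of `G`
  have hKsum : Summable fun x : Fin 2 → ℤ => K * (‖x‖ ^ (2 * s - 1))⁻¹ := by
    have h := EisensteinSeries.summable_one_div_norm_rpow (k := ((2 * s - 1 : ℕ) : ℝ))
      (by exact_mod_cast (show 2 < 2 * s - 1 by omega))
    refine (h.congr fun x => ?_).mul_left K
    rw [Real.rpow_neg (norm_nonneg _), Real.rpow_natCast]
  have hGsum : Summable G := by
    refine (summable_prod_of_nonneg fun p => hG0 p).mpr ⟨fun x => ?_, ?_⟩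
    · by_cases hx : x = 0
      · simp only [G, hx, if_true]
        exact summable_zero
      · simp only [G, hx, if_false]
        exact (hinner x hx).1.mul_left _
    · exact Summable.of_nonneg_of_le (fun x => tsum_nonneg fun e => hG0 (x, e)) hrow hKsum
  -- pointwise comparison `t_γ^{-s} ≤ G (key γ)`
  have hle : ∀ γ : heckeMatrices N m,
      ((1 + dist (z₁ : ℂ) ((intGL (γ : Matrix (Fin 2) (Fin 2) ℤ) • z₂ : ℍ) : ℂ) ^ 2 /
        (2 * z₁.im * (intGL (γ : Matrix (Fin 2) (Fin 2) ℤ) • z₂).im)) ^ s)⁻¹ ≤ (G ∘ key) γ := by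
    rintro ⟨M, hM⟩
    set w : ℍ := intGL M • z₂ with hw
    set x : Fin 2 → ℤ := ![M 1 0, M 1 1] with hx_def
    have hx0 : x 0 = M 1 0 := by simp [hx_def]
    have hx1 : x 1 = M 1 1 := by simp [hx_def]
    have hdet := det_ne_zero_of_mem_heckeMatrices hm.ne' hM
    have hx : x ≠ 0 := by
      intro h
      have h0 : M 1 0 = 0 := by rw [← hx0, h]; rfl
      have h1 : M 1 1 = 0 := by rw [← hx1, h]; rfl
      apply hdet
      rw [Matrix.det_fin_two, h0, h1, mul_zero, mul_zero, sub_zero]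
    have hv : w.im = V x := by
      simp only [V, hw, hx0, hx1]
      exact im_intGL_smul hm hM z₂
    -- the real part
    have hu : (z₁.re - w.re) ^ 2 =
        (((if M 1 0 = 0 then M 0 1 else M 0 0 : ℤ) : ℝ) / (q x : ℝ) - β x) ^ 2 := by
      simp only [q, β, hx0, hx1]
      by_cases hc : M 1 0 = 0
      · simp only [hc, if_true]
        rw [hw, re_intGL_smul_of_eq_zero hm hM hc z₂]
        ring
      · simp only [hc, if_false]
        rw [hw, re_intGL_smul_of_ne_zero hm hM hc z₂]
        ring
    calc ((1 + dist (z₁ : ℂ) (w : ℂ) ^ 2 / (2 * z₁.im * w.im)) ^ s)⁻¹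
        ≤ (2 * z₁.im * w.im) ^ s * (((z₁.re - w.re) ^ 2 + z₁.im ^ 2) ^ s)⁻¹ :=
          inv_pow_coshDistArg_le z₁ w s
      _ = G (key ⟨M, hM⟩) := by
          simp only [G, key, f]
          rw [if_neg hx, hv, hu]
  have h0 : ∀ γ : heckeMatrices N m,
      0 ≤ ((1 + dist (z₁ : ℂ) ((intGL (γ : Matrix (Fin 2) (Fin 2) ℤ) • z₂ : ℍ) : ℂ) ^ 2 /
        (2 * z₁.im * (intGL (γ : Matrix (Fin 2) (Fin 2) ℤ) • z₂).im)) ^ s)⁻¹ := by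
    intro γ
    have := one_le_coshDistArg z₁ (intGL (γ : Matrix (Fin 2) (Fin 2) ℤ) • z₂)
    positivity
  exact Summable.of_nonneg_of_le h0 hle (hGsum.comp_injective hkey)

/-! ## Summability of the defining series of `G_s^{Γ₀(N), m}` and its sign -/

/-- `Q_{s-1}(t) ≥ 0` for `t > 0` (whether or not Heine's integral converges). [folklore] -/
theorem greenQ_nonneg {t : ℝ} (ht : 0 < t) (s : ℕ) : 0 ≤ greenQ s t :=
  setIntegral_nonneg measurableSet_Ioi fun u _ =>
    (inv_pos.mpr (pow_pos (by
      have h1 : 0 ≤ √(t ^ 2 - 1) * Real.cosh u :=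
        mul_nonneg (Real.sqrt_nonneg _) (Real.cosh_pos u).le
      linarith) s)).le

/-- Away from the singularity, `Q_{s-1}(t) ≤ (4^s/s) t^{-s}` for `t ≥ 2`, `s ≥ 1`
(from `greenQ_le` and `√(t² - 1) ≥ t/2`). [folklore] -/
theorem greenQ_le_of_two_le {t : ℝ} (ht : 2 ≤ t) {s : ℕ} (hs : 1 ≤ s) :
    greenQ s t ≤ 4 ^ s / s * (t ^ s)⁻¹ := by
  have h1 : 1 < t := by linarith
  have hsq : t / 2 ≤ √(t ^ 2 - 1) := by
    calc t / 2 = √((t / 2) ^ 2) := (Real.sqrt_sq (by linarith)).symm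
      _ ≤ √(t ^ 2 - 1) := Real.sqrt_le_sqrt (by nlinarith)
  have h4 : 2 / (t / 2) = 4 / t := by
    field_simp
    ring
  calc greenQ s t ≤ (2 / √(t ^ 2 - 1)) ^ s / s := greenQ_le h1 hs
    _ ≤ (2 / (t / 2)) ^ s / s := by gcongr
    _ = 4 ^ s / s * (t ^ s)⁻¹ := by
        rw [h4, div_pow]
        field_simp

/-- **The defining series of `G_s^{Γ₀(N), m}(z₁, z₂)` converges** (as an unconditional sum) for
`m ≥ 1`, `s ≥ 2` and all `z₁, z₂ ∈ ℍ`: the family `γ ↦ Q_{s-1}(cosh d(z₁, γ z₂))`, `γ ∈ R_N^{(m)}`,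
is summable (Bruinier–Li–Yang 2025, (1.1)–(1.2): "`Re(s) > 1`"; Gross–Zagier 1986, §II.2). The
finitely many `γ` with `cosh d(z₁, γz₂) ≤ 2` (finite because `Σ_γ cosh d(z₁, γz₂)^{-s} < ∞`,
`summable_inv_pow_coshDistArg`) are set aside; for the others
`Q_{s-1}(t) ≤ (4^s/s) t^{-s}` (`greenQ_le_of_two_le`). On `T_m` itself the finitely many terms
with `γ z₂ = z₁` carry Lean's junk value `Q_{s-1}(1) = 0` and do not affect summability.
[cite: BruinierLiYang2025, (1.1)–(1.2)] -/
theorem summable_greenQ_heckeMatrices {N : ℕ} {m : ℤ} (hm : 0 < m) {s : ℕ} (hs : 2 ≤ s)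
    (z₁ z₂ : ℍ) :
    Summable fun γ : heckeMatrices N m =>
      greenQ s (1 + dist (z₁ : ℂ) ((intGL (γ : Matrix (Fin 2) (Fin 2) ℤ) • z₂ : ℍ) : ℂ) ^ 2 /
        (2 * z₁.im * (intGL (γ : Matrix (Fin 2) (Fin 2) ℤ) • z₂).im)) := by
  set T : heckeMatrices N m → ℝ := fun γ =>
    1 + dist (z₁ : ℂ) ((intGL (γ : Matrix (Fin 2) (Fin 2) ℤ) • z₂ : ℍ) : ℂ) ^ 2 /
      (2 * z₁.im * (intGL (γ : Matrix (Fin 2) (Fin 2) ℤ) • z₂).im) with hT_def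
  have hT1 : ∀ γ, 1 ≤ T γ := fun γ => one_le_coshDistArg z₁ _
  have hsum : Summable fun γ => (T γ ^ s)⁻¹ := summable_inv_pow_coshDistArg hm hs z₁ z₂
  have hs1 : 1 ≤ s := by omega
  -- the finite exceptional set `{γ : T γ ≤ 2}`
  have hfin : {γ : heckeMatrices N m | T γ ≤ 2}.Finite := by
    have hev := hsum.tendsto_cofinite_zero.eventually
      (gt_mem_nhds (show (0 : ℝ) < (2 ^ s)⁻¹ by positivity))
    refine (Filter.eventually_cofinite.mp hev).subset fun γ hγ => ?_
    simp only [Set.mem_setOf_eq, not_lt] at hγ ⊢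
    exact inv_anti₀ (by positivity) (pow_le_pow_left₀ (by linarith [hT1 γ]) hγ s)
  set S := hfin.toFinset with hS
  have hbound : ∀ γ, greenQ s (T γ) ≤
      (S : Set (heckeMatrices N m)).indicator (fun γ => greenQ s (T γ)) γ +
        4 ^ s / s * (T γ ^ s)⁻¹ := by
    intro γ
    by_cases hγ : T γ ≤ 2
    · have hmem : γ ∈ (S : Set (heckeMatrices N m)) := by simpa [hS] using hγ
      rw [Set.indicator_of_mem hmem]
      have : 0 ≤ 4 ^ s / s * (T γ ^ s)⁻¹ := by
        have := hT1 γ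
        positivity
      linarith
    · have hmem : γ ∉ (S : Set (heckeMatrices N m)) := by simpa [hS] using hγ
      rw [Set.indicator_of_notMem hmem, zero_add]
      exact greenQ_le_of_two_le (by linarith) hs1
  refine Summable.of_nonneg_of_le (fun γ => greenQ_nonneg (by linarith [hT1 γ]) s) hbound ?_
  refine Summable.add ?_ (hsum.mul_left _)
  refine summable_of_ne_finset_zero (s := S) fun γ hγ => ?_
  exact Set.indicator_of_notMem (by simpa using hγ) _

/-- `R_N^{(m)}` is nonempty: it contains `diag(1, m)`. [folklore] -/
theorem diag_mem_heckeMatrices (N : ℕ) (m : ℤ) : !![1, 0; 0, m] ∈ heckeMatrices N m := by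
  rw [mem_heckeMatrices, Matrix.det_fin_two_of]
  simp

/-- **Higher Green functions are negative off the Hecke correspondence.** For `m ≥ 1`, `s ≥ 2`
and `(z₁, z₂) ∉ T_m`, `G_s^{Γ₀(N), m}(z₁, z₂) = -2 Σ_{γ ∈ R_N^{(m)}} Q_{s-1}(cosh d(z₁, γ z₂)) < 0`:
the series converges (`summable_greenQ_heckeMatrices`), every term is positive (`Q_{s-1} > 0` on
`(1, ∞)` and `cosh d(z₁, γ z₂) > 1` as `z₁ ≠ γ z₂`), and `R_N^{(m)} ∋ diag(1, m)` is nonempty —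
so the Lean `tsum` in `higherGreen` is a genuine, nonzero value. [cite: BruinierLiYang2025, (1.1)–(1.2)] -/
theorem higherGreen_neg {N : ℕ} {m : ℤ} (hm : 0 < m) {s : ℕ} (hs : 2 ≤ s) {z₁ z₂ : ℍ}
    (h : ¬ OnHeckeCorrespondence N m z₁ z₂) : higherGreen N s m z₁ z₂ < 0 := by
  have hsum := summable_greenQ_heckeMatrices (N := N) hm hs z₁ z₂
  have hpos : ∀ γ : heckeMatrices N m,
      0 < greenQ s (1 + dist (z₁ : ℂ) ((intGL (γ : Matrix (Fin 2) (Fin 2) ℤ) • z₂ : ℍ) : ℂ) ^ 2 /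
        (2 * z₁.im * (intGL (γ : Matrix (Fin 2) (Fin 2) ℤ) • z₂).im)) := by
    intro γ
    refine greenQ_pos ?_ (by omega)
    have hne : (z₁ : ℂ) ≠ ((intGL (γ : Matrix (Fin 2) (Fin 2) ℤ) • z₂ : ℍ) : ℂ) := by
      intro heq
      exact h ⟨γ, γ.2, (UpperHalfPlane.ext heq).symm⟩
    have hd : 0 < dist (z₁ : ℂ) ((intGL (γ : Matrix (Fin 2) (Fin 2) ℤ) • z₂ : ℍ) : ℂ) :=
      dist_pos.mpr hne
    have hy := z₁.im_pos
    have hv := (intGL (γ : Matrix (Fin 2) (Fin 2) ℤ) • z₂).im_pos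
    have : 0 < dist (z₁ : ℂ) ((intGL (γ : Matrix (Fin 2) (Fin 2) ℤ) • z₂ : ℍ) : ℂ) ^ 2 /
        (2 * z₁.im * (intGL (γ : Matrix (Fin 2) (Fin 2) ℤ) • z₂).im) := by positivity
    linarith
  let γ₀ : heckeMatrices N m := ⟨!![1, 0; 0, m], diag_mem_heckeMatrices N m⟩
  have := hsum.tsum_pos (fun γ => (hpos γ).le) γ₀ (hpos γ₀)
  unfold higherGreen
  linarith


/-! ## `Γ₀(N)`-invariance of `G_s^{Γ₀(N), m}` in each variable -/

/-- `G_s^{Γ₀(N), m}(z₁, z₂) = -2 Σ_{γ ∈ R_N^{(m)}} Q_{s-1}(cosh d(z₁, γ z₂))`: the argument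
`1 + |z₁ - γz₂|²/(2 Im z₁ Im γz₂)` of (1.1) is `cosh` of the hyperbolic distance. [folklore] -/
theorem higherGreen_eq_tsum_cosh_dist (N s : ℕ) (m : ℤ) (z₁ z₂ : ℍ) :
    higherGreen N s m z₁ z₂ = -2 * ∑' γ : heckeMatrices N m,
      greenQ s (Real.cosh (dist z₁ (intGL (γ : Matrix (Fin 2) (Fin 2) ℤ) • z₂))) := by
  unfold higherGreen
  simp_rw [one_add_dist_sq_div_eq_cosh_dist]

/-- The action of `γ ∈ SL(2, ℤ)` on `ℍ` is that of the integer matrix `γ` through `intGL`.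
[folklore] -/
theorem sl_smul_eq_intGL_smul (γ : SL(2, ℤ)) (z : ℍ) :
    γ • z = intGL (γ : Matrix (Fin 2) (Fin 2) ℤ) • z := by
  rw [MulAction.compHom_smul_def, mapGL_eq_intGL]

/-- The action of `γ ∈ SL(2, ℤ)` on `ℍ` agrees with that of its image in `SL(2, ℝ)`. [folklore] -/
theorem sl_smul_eq_coe_smul (γ : SL(2, ℤ)) (z : ℍ) : γ • z = (γ : SL(2, ℝ)) • z := by
  rw [MulAction.compHom_smul_def, MulAction.compHom_smul_def]
  congr 1

/-- `SL(2, ℤ)` acts on `ℍ` by isometries (through `SL(2, ℝ)`). [folklore] -/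
theorem dist_sl_smul_sl_smul (γ : SL(2, ℤ)) (z w : ℍ) : dist (γ • z) (γ • w) = dist z w := by
  rw [sl_smul_eq_coe_smul, sl_smul_eq_coe_smul, dist_smul]

/-- **`Γ₀(N)`-invariance in the second variable**: `G_s^{Γ₀(N), m}(z₁, γ z₂) = G_s^{Γ₀(N), m}(z₁, z₂)`
for `γ ∈ Γ₀(N)` (`m ≠ 0`), by the reindexing `δ ↦ δγ` of `R_N^{(m)}` (`mul_gamma0_mem_heckeMatrices`).
This is what makes (1.2) of Bruinier–Li–Yang 2025 a function on `X₀(N)` in `z₂`.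
[cite: BruinierLiYang2025, (1.2)] -/
theorem higherGreen_smul_right {N : ℕ} {m : ℤ} (hm : m ≠ 0) {γ : SL(2, ℤ)} (hγ : γ ∈ Gamma0 N)
    (s : ℕ) (z₁ z₂ : ℍ) : higherGreen N s m z₁ (γ • z₂) = higherGreen N s m z₁ z₂ := by
  rw [higherGreen_eq_tsum_cosh_dist, higherGreen_eq_tsum_cosh_dist]
  congr 1
  have hγdet : (γ : Matrix (Fin 2) (Fin 2) ℤ).det ≠ 0 := by
    rw [Matrix.SpecialLinearGroup.det_coe]
    exact one_ne_zero
  let e : heckeMatrices N m ≃ heckeMatrices N m :=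
    { toFun := fun δ => ⟨(δ : Matrix (Fin 2) (Fin 2) ℤ) * (γ : Matrix (Fin 2) (Fin 2) ℤ),
        mul_gamma0_mem_heckeMatrices δ.2 hγ⟩
      invFun := fun δ =>
        ⟨(δ : Matrix (Fin 2) (Fin 2) ℤ) * ((γ⁻¹ : SL(2, ℤ)) : Matrix (Fin 2) (Fin 2) ℤ),
          mul_gamma0_mem_heckeMatrices δ.2 (inv_mem hγ)⟩
      left_inv := fun δ => Subtype.ext (by
        simp only
        rw [Matrix.mul_assoc, ← Matrix.SpecialLinearGroup.coe_mul, mul_inv_cancel,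
          Matrix.SpecialLinearGroup.coe_one, Matrix.mul_one])
      right_inv := fun δ => Subtype.ext (by
        simp only
        rw [Matrix.mul_assoc, ← Matrix.SpecialLinearGroup.coe_mul, inv_mul_cancel,
          Matrix.SpecialLinearGroup.coe_one, Matrix.mul_one]) }
  calc ∑' δ : heckeMatrices N m,
        greenQ s (Real.cosh (dist z₁ (intGL (δ : Matrix (Fin 2) (Fin 2) ℤ) • γ • z₂)))
      = ∑' δ : heckeMatrices N m,
        greenQ s (Real.cosh (dist z₁ (intGL ((e δ : heckeMatrices N m) : Matrix (Fin 2) (Fin 2) ℤ)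
          • z₂))) := by
        refine tsum_congr fun δ => ?_
        congr 3
        show intGL (δ : Matrix (Fin 2) (Fin 2) ℤ) • γ • z₂ =
          intGL ((δ : Matrix (Fin 2) (Fin 2) ℤ) * (γ : Matrix (Fin 2) (Fin 2) ℤ)) • z₂
        rw [intGL_mul (det_ne_zero_of_mem_heckeMatrices hm δ.2) hγdet, mul_smul,
          sl_smul_eq_intGL_smul]
    _ = ∑' δ : heckeMatrices N m,
        greenQ s (Real.cosh (dist z₁ (intGL (δ : Matrix (Fin 2) (Fin 2) ℤ) • z₂))) :=
        e.tsum_eq (fun δ : heckeMatrices N m =>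
          greenQ s (Real.cosh (dist z₁ (intGL (δ : Matrix (Fin 2) (Fin 2) ℤ) • z₂))))

/-- **`Γ₀(N)`-invariance in the first variable**: `G_s^{Γ₀(N), m}(γ z₁, z₂) = G_s^{Γ₀(N), m}(z₁, z₂)`
for `γ ∈ Γ₀(N)` (`m ≠ 0`): `d(γ z₁, δ z₂) = d(z₁, γ⁻¹δ z₂)` (`SL(2, ℝ)` acts by isometries) and
`δ ↦ γ⁻¹ δ` permutes `R_N^{(m)}` (`gamma0_mul_mem_heckeMatrices`). With `higherGreen_smul_right`
this makes `G_s^{Γ₀(N), m}` a function on `X₀(N) × X₀(N)` ((1.1)–(1.2) of Bruinier–Li–Yang 2025).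
[cite: BruinierLiYang2025, (1.1)–(1.2)] -/
theorem higherGreen_smul_left {N : ℕ} {m : ℤ} (hm : m ≠ 0) {γ : SL(2, ℤ)} (hγ : γ ∈ Gamma0 N)
    (s : ℕ) (z₁ z₂ : ℍ) : higherGreen N s m (γ • z₁) z₂ = higherGreen N s m z₁ z₂ := by
  rw [higherGreen_eq_tsum_cosh_dist, higherGreen_eq_tsum_cosh_dist]
  congr 1
  have hγdet : ((γ⁻¹ : SL(2, ℤ)) : Matrix (Fin 2) (Fin 2) ℤ).det ≠ 0 := by
    rw [Matrix.SpecialLinearGroup.det_coe]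
    exact one_ne_zero
  have hdist : ∀ w : ℍ, dist (γ • z₁) w = dist z₁ (γ⁻¹ • w) := by
    intro w
    conv_lhs => rw [← smul_inv_smul γ w]
    exact dist_sl_smul_sl_smul γ z₁ (γ⁻¹ • w)
  let e : heckeMatrices N m ≃ heckeMatrices N m :=
    { toFun := fun δ => ⟨((γ⁻¹ : SL(2, ℤ)) : Matrix (Fin 2) (Fin 2) ℤ) * (δ : Matrix (Fin 2) (Fin 2) ℤ),
        gamma0_mul_mem_heckeMatrices (inv_mem hγ) δ.2⟩
      invFun := fun δ => ⟨(γ : Matrix (Fin 2) (Fin 2) ℤ) * (δ : Matrix (Fin 2) (Fin 2) ℤ),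
        gamma0_mul_mem_heckeMatrices hγ δ.2⟩
      left_inv := fun δ => Subtype.ext (by
        simp only
        rw [← Matrix.mul_assoc, ← Matrix.SpecialLinearGroup.coe_mul, mul_inv_cancel,
          Matrix.SpecialLinearGroup.coe_one, Matrix.one_mul])
      right_inv := fun δ => Subtype.ext (by
        simp only
        rw [← Matrix.mul_assoc, ← Matrix.SpecialLinearGroup.coe_mul, inv_mul_cancel,
          Matrix.SpecialLinearGroup.coe_one, Matrix.one_mul]) }
  calc ∑' δ : heckeMatrices N m,
        greenQ s (Real.cosh (dist (γ • z₁) (intGL (δ : Matrix (Fin 2) (Fin 2) ℤ) • z₂)))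
      = ∑' δ : heckeMatrices N m,
        greenQ s (Real.cosh (dist z₁ (intGL ((e δ : heckeMatrices N m) : Matrix (Fin 2) (Fin 2) ℤ)
          • z₂))) := by
        refine tsum_congr fun δ => ?_
        rw [hdist]
        congr 3
        show γ⁻¹ • intGL (δ : Matrix (Fin 2) (Fin 2) ℤ) • z₂ =
          intGL (((γ⁻¹ : SL(2, ℤ)) : Matrix (Fin 2) (Fin 2) ℤ) * (δ : Matrix (Fin 2) (Fin 2) ℤ)) • z₂
        rw [intGL_mul hγdet (det_ne_zero_of_mem_heckeMatrices hm δ.2), mul_smul,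
          sl_smul_eq_intGL_smul]
    _ = ∑' δ : heckeMatrices N m,
        greenQ s (Real.cosh (dist z₁ (intGL (δ : Matrix (Fin 2) (Fin 2) ℤ) • z₂))) :=
        e.tsum_eq (fun δ : heckeMatrices N m =>
          greenQ s (Real.cosh (dist z₁ (intGL (δ : Matrix (Fin 2) (Fin 2) ℤ) • z₂))))


/-! ## Symmetry: `GL(2, ℝ)⁺` acts by isometries, `T_m` and `G_s^{Γ₀(N), m}` are symmetric -/

/-- An element of `GL(2, ℝ)` of positive determinant acts on `ℍ` as the element
`det(g)^{-1/2} g` of `SL(2, ℝ)`. [folklore] -/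
theorem exists_sl_smul_eq_of_det_pos {g : GL (Fin 2) ℝ} (hg : 0 < g.det.val) :
    ∃ g₁ : SL(2, ℝ), ∀ z : ℍ, g • z = g₁ • z := by
  set t : ℝ := √(g.det.val) with ht
  have ht0 : 0 < t := Real.sqrt_pos.mpr hg
  have ht2 : t ^ 2 = g.det.val := Real.sq_sqrt hg.le
  let M : Matrix (Fin 2) (Fin 2) ℝ := t⁻¹ • (g : Matrix (Fin 2) (Fin 2) ℝ)
  have hM : M.det = 1 := by
    simp only [M, Matrix.det_smul, Fintype.card_fin, ← Matrix.GeneralLinearGroup.val_det_apply,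
      ← ht2]
    field_simp
  refine ⟨⟨M, hM⟩, fun z => UpperHalfPlane.ext ?_⟩
  rw [coe_smul_of_det_pos hg, coe_specialLinearGroup_apply]
  have ht' : (t⁻¹ : ℂ) ≠ 0 := by exact_mod_cast (inv_pos.mpr ht0).ne'
  simp only [M, num, denom, Matrix.smul_apply, smul_eq_mul, Algebra.algebraMap_self,
    RingHom.id_apply, Complex.ofReal_mul, Complex.ofReal_inv]
  rw [← mul_div_mul_left _ _ ht']
  ring_nf

/-- Elements of `GL(2, ℝ)` of positive determinant act on `ℍ` by isometries. [folklore] -/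
theorem dist_smul_smul_of_det_pos {g : GL (Fin 2) ℝ} (hg : 0 < g.det.val) (z w : ℍ) :
    dist (g • z) (g • w) = dist z w := by
  obtain ⟨g₁, h⟩ := exists_sl_smul_eq_of_det_pos hg
  rw [h, h, dist_smul]

/-- The scalar integer matrix `m · 1`, `m ≠ 0`, acts trivially on `ℍ`. [folklore] -/
theorem intGL_smul_one_smul {m : ℤ} (hm : m ≠ 0) (z : ℍ) :
    intGL (m • (1 : Matrix (Fin 2) (Fin 2) ℤ)) • z = z := by
  have hdet : (m • (1 : Matrix (Fin 2) (Fin 2) ℤ)).det ≠ 0 := by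
    rw [Matrix.det_smul, Matrix.det_one, mul_one, Fintype.card_fin]
    exact pow_ne_zero 2 hm
  have hm' : (m : ℝ) ≠ 0 := by exact_mod_cast hm
  have hpos : 0 < ((intGL (m • (1 : Matrix (Fin 2) (Fin 2) ℤ))).det : ℝ) := by
    rw [val_det_intGL hdet, Matrix.det_smul, Matrix.det_one, mul_one, Fintype.card_fin]
    push_cast
    positivity
  apply UpperHalfPlane.ext
  rw [coe_smul_of_det_pos hpos]
  simp only [num, denom, intGL_apply hdet, Matrix.smul_apply, smul_eq_mul]
  have hmC : ((m : ℝ) : ℂ) ≠ 0 := by exact_mod_cast hm'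
  simp
  field_simp


/-- For `δ ∈ R_N^{(m)}`, `m > 0`: `δ^{adj} δ = m · 1` acts trivially, so `δ^{adj}` undoes `δ` on `ℍ`.
[folklore] -/
theorem intGL_adjugate_smul_intGL_smul {N : ℕ} {m : ℤ} (hm : 0 < m)
    {δ : Matrix (Fin 2) (Fin 2) ℤ} (hδ : δ ∈ heckeMatrices N m) (z : ℍ) :
    intGL δ.adjugate • intGL δ • z = z := by
  have hdet := det_ne_zero_of_mem_heckeMatrices hm.ne' hδ
  have hadj : δ.adjugate.det ≠ 0 :=
    det_ne_zero_of_mem_heckeMatrices hm.ne' (adjugate_mem_heckeMatrices hδ)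
  rw [← mul_smul, ← intGL_mul hadj hdet, Matrix.adjugate_mul, (mem_heckeMatrices.mp hδ).1]
  exact intGL_smul_one_smul hm.ne' z

/-- `d(z₁, δ z₂) = d(z₂, δ^{adj} z₁)` for `δ ∈ R_N^{(m)}`, `m > 0` (`δ^{adj}` is an isometry
inverting `δ`). [folklore] -/
theorem dist_intGL_smul_eq_dist_intGL_adjugate_smul {N : ℕ} {m : ℤ} (hm : 0 < m)
    {δ : Matrix (Fin 2) (Fin 2) ℤ} (hδ : δ ∈ heckeMatrices N m) (z₁ z₂ : ℍ) :
    dist z₁ (intGL δ • z₂) = dist z₂ (intGL δ.adjugate • z₁) := by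
  have hadjmem := adjugate_mem_heckeMatrices hδ
  have hpos : 0 < ((intGL δ.adjugate).det : ℝ) := by
    rw [val_det_intGL (det_ne_zero_of_mem_heckeMatrices hm.ne' hadjmem),
      (mem_heckeMatrices.mp hadjmem).1]
    exact_mod_cast hm
  rw [← dist_smul_smul_of_det_pos hpos z₁, intGL_adjugate_smul_intGL_smul hm hδ, dist_comm]

/-- **The Hecke correspondence `T_m` is symmetric**: `(z₁, z₂) ∈ T_m ↔ (z₂, z₁) ∈ T_m`
(`γ ↦ γ^{adj}` on `R_N^{(m)}`, `adjugate_mem_heckeMatrices`). [folklore] -/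
theorem onHeckeCorrespondence_comm {N : ℕ} {m : ℤ} (hm : 0 < m) (z₁ z₂ : ℍ) :
    OnHeckeCorrespondence N m z₁ z₂ ↔ OnHeckeCorrespondence N m z₂ z₁ := by
  suffices h : ∀ z₁ z₂ : ℍ, OnHeckeCorrespondence N m z₁ z₂ → OnHeckeCorrespondence N m z₂ z₁ from
    ⟨h z₁ z₂, h z₂ z₁⟩
  rintro z₁ z₂ ⟨δ, hδ, rfl⟩
  exact ⟨δ.adjugate, adjugate_mem_heckeMatrices hδ, intGL_adjugate_smul_intGL_smul hm hδ z₂⟩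

/-- **Symmetry** `G_s^{Γ₀(N), m}(z₁, z₂) = G_s^{Γ₀(N), m}(z₂, z₁)` (`m > 0`): the second line of
(1.2) of Bruinier–Li–Yang 2025 (`G_s | T_{m, z₁} = G_s | T_{m, z₂}`), by the involution
`γ ↦ γ^{adj}` of `R_N^{(m)}` and `d(z₁, γ z₂) = d(z₂, γ^{adj} z₁)`. [cite: BruinierLiYang2025, (1.2)] -/
theorem higherGreen_symm {N : ℕ} {m : ℤ} (hm : 0 < m) (s : ℕ) (z₁ z₂ : ℍ) :
    higherGreen N s m z₁ z₂ = higherGreen N s m z₂ z₁ := by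
  rw [higherGreen_eq_tsum_cosh_dist, higherGreen_eq_tsum_cosh_dist]
  congr 1
  have hadj2 : ∀ A : Matrix (Fin 2) (Fin 2) ℤ, A.adjugate.adjugate = A := fun A => by
    rw [Matrix.adjugate_adjugate _ (by simp)]
    simp
  let e : heckeMatrices N m ≃ heckeMatrices N m :=
    { toFun := fun δ => ⟨(δ : Matrix (Fin 2) (Fin 2) ℤ).adjugate, adjugate_mem_heckeMatrices δ.2⟩
      invFun := fun δ => ⟨(δ : Matrix (Fin 2) (Fin 2) ℤ).adjugate, adjugate_mem_heckeMatrices δ.2⟩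
      left_inv := fun δ => Subtype.ext (hadj2 _)
      right_inv := fun δ => Subtype.ext (hadj2 _) }
  calc ∑' δ : heckeMatrices N m,
        greenQ s (Real.cosh (dist z₁ (intGL (δ : Matrix (Fin 2) (Fin 2) ℤ) • z₂)))
      = ∑' δ : heckeMatrices N m,
        greenQ s (Real.cosh (dist z₂ (intGL ((e δ : heckeMatrices N m) : Matrix (Fin 2) (Fin 2) ℤ)
          • z₁))) :=
        tsum_congr fun δ => by rw [dist_intGL_smul_eq_dist_intGL_adjugate_smul hm δ.2]; rfl
    _ = ∑' δ : heckeMatrices N m,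
        greenQ s (Real.cosh (dist z₂ (intGL (δ : Matrix (Fin 2) (Fin 2) ℤ) • z₁))) :=
        e.tsum_eq (fun δ : heckeMatrices N m =>
          greenQ s (Real.cosh (dist z₂ (intGL (δ : Matrix (Fin 2) (Fin 2) ℤ) • z₁))))

/-! ## Descent of `T_m` and `G_{r+1,f}` to `X₀(N) × X₀(N)` -/

/-- `T_m` is `Γ₀(N)`-stable in the second variable. [folklore] -/
theorem onHeckeCorrespondence_smul_right_iff {N : ℕ} {m : ℤ} (hm : m ≠ 0) {γ : SL(2, ℤ)}
    (hγ : γ ∈ Gamma0 N) (z₁ z₂ : ℍ) :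
    OnHeckeCorrespondence N m z₁ (γ • z₂) ↔ OnHeckeCorrespondence N m z₁ z₂ := by
  have hγdet : (γ : Matrix (Fin 2) (Fin 2) ℤ).det ≠ 0 := by
    rw [Matrix.SpecialLinearGroup.det_coe]
    exact one_ne_zero
  have hγidet : ((γ⁻¹ : SL(2, ℤ)) : Matrix (Fin 2) (Fin 2) ℤ).det ≠ 0 := by
    rw [Matrix.SpecialLinearGroup.det_coe]
    exact one_ne_zero
  constructor
  · rintro ⟨δ, hδ, h⟩
    refine ⟨δ * (γ : Matrix (Fin 2) (Fin 2) ℤ), mul_gamma0_mem_heckeMatrices hδ hγ, ?_⟩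
    rw [intGL_mul (det_ne_zero_of_mem_heckeMatrices hm hδ) hγdet, mul_smul,
      ← sl_smul_eq_intGL_smul, h]
  · rintro ⟨δ, hδ, h⟩
    refine ⟨δ * ((γ⁻¹ : SL(2, ℤ)) : Matrix (Fin 2) (Fin 2) ℤ),
      mul_gamma0_mem_heckeMatrices hδ (inv_mem hγ), ?_⟩
    rw [intGL_mul (det_ne_zero_of_mem_heckeMatrices hm hδ) hγidet, mul_smul,
      ← sl_smul_eq_intGL_smul, inv_smul_smul, h]

/-- `T_m` is `Γ₀(N)`-stable in the first variable. [folklore] -/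
theorem onHeckeCorrespondence_smul_left_iff {N : ℕ} {m : ℤ} (hm : m ≠ 0) {γ : SL(2, ℤ)}
    (hγ : γ ∈ Gamma0 N) (z₁ z₂ : ℍ) :
    OnHeckeCorrespondence N m (γ • z₁) z₂ ↔ OnHeckeCorrespondence N m z₁ z₂ := by
  have hγdet : (γ : Matrix (Fin 2) (Fin 2) ℤ).det ≠ 0 := by
    rw [Matrix.SpecialLinearGroup.det_coe]
    exact one_ne_zero
  have hγidet : ((γ⁻¹ : SL(2, ℤ)) : Matrix (Fin 2) (Fin 2) ℤ).det ≠ 0 := by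
    rw [Matrix.SpecialLinearGroup.det_coe]
    exact one_ne_zero
  constructor
  · rintro ⟨δ, hδ, h⟩
    refine ⟨((γ⁻¹ : SL(2, ℤ)) : Matrix (Fin 2) (Fin 2) ℤ) * δ,
      gamma0_mul_mem_heckeMatrices (inv_mem hγ) hδ, ?_⟩
    rw [intGL_mul hγidet (det_ne_zero_of_mem_heckeMatrices hm hδ), mul_smul,
      ← sl_smul_eq_intGL_smul, h, inv_smul_smul]
  · rintro ⟨δ, hδ, h⟩
    refine ⟨(γ : Matrix (Fin 2) (Fin 2) ℤ) * δ, gamma0_mul_mem_heckeMatrices hγ hδ, ?_⟩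
    rw [intGL_mul hγdet (det_ne_zero_of_mem_heckeMatrices hm hδ), mul_smul,
      ← sl_smul_eq_intGL_smul, h]

/-- **`G_{r+1,f}` descends to `X₀(N) × X₀(N)`** (first variable): the principal higher Green
function (1.3) of Bruinier–Li–Yang 2025 is `Γ₀(N)`-invariant in `z₁`. [cite: BruinierLiYang2025, (1.3)] -/
theorem principalHigherGreen_smul_left {N : ℕ} (r : ℕ) (c : ℤ → ℚ) {γ : SL(2, ℤ)}
    (hγ : γ ∈ Gamma0 N) (z₁ z₂ : ℍ) :
    principalHigherGreen N r c (γ • z₁) z₂ = principalHigherGreen N r c z₁ z₂ := by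
  unfold principalHigherGreen
  refine tsum_congr fun m => ?_
  rw [higherGreen_smul_left (by exact_mod_cast m.ne_zero) hγ]

/-- **`G_{r+1,f}` descends to `X₀(N) × X₀(N)`** (second variable). [cite: BruinierLiYang2025, (1.3)] -/
theorem principalHigherGreen_smul_right {N : ℕ} (r : ℕ) (c : ℤ → ℚ) {γ : SL(2, ℤ)}
    (hγ : γ ∈ Gamma0 N) (z₁ z₂ : ℍ) :
    principalHigherGreen N r c z₁ (γ • z₂) = principalHigherGreen N r c z₁ z₂ := by
  unfold principalHigherGreen
  refine tsum_congr fun m => ?_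
  rw [higherGreen_smul_right (by exact_mod_cast m.ne_zero) hγ]

/-- `G_{r+1,f}` is symmetric: `G_{r+1,f}(z₁, z₂) = G_{r+1,f}(z₂, z₁)`. [cite: BruinierLiYang2025, (1.2)–(1.3)] -/
theorem principalHigherGreen_symm {N : ℕ} (r : ℕ) (c : ℤ → ℚ) (z₁ z₂ : ℍ) :
    principalHigherGreen N r c z₁ z₂ = principalHigherGreen N r c z₂ z₁ := by
  unfold principalHigherGreen
  refine tsum_congr fun m => ?_
  rw [higherGreen_symm (by exact_mod_cast m.pos) (r + 1) z₁ z₂]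


/-! ## (1.2), first line: `G_s^{Γ₀(N), m}` as a sum of `G_s^{Γ₀(N)}` over `Γ₀(N) \ R_N^{(m)}` -/

open Literature.NumberTheory.EllipticCurves.ModularForms (matrix_mul_right_cancel_of_det_ne_zero) in
/-- **(1.2) of Bruinier–Li–Yang 2025, first line, for an arbitrary system of representatives.**
Let `m ≥ 1`, `s ≥ 2`, and let `(βᵢ)_{i ∈ ι}` be a system of representatives of
`Γ₀(N) \ R_N^{(m)}`, i.e. `βᵢ ∈ R_N^{(m)}` and every `δ ∈ R_N^{(m)}` is `γ βᵢ` with `γ ∈ Γ₀(N)` for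
exactly one `i`. Then
`G_s^{Γ₀(N), m}(z₁, z₂) = Σ_i G_s^{Γ₀(N)}(z₁, βᵢ z₂)`,
which is the printed definition `Σ_{γ ∈ Γ₀(N) \ R_N, det γ = m} G_s^{Γ₀(N)}(z₁, γ z₂)` of
`G_s^{Γ₀(N), m}` (the vendored `higherGreen N s m` being the unfolded sum over `R_N^{(m)}`):
`(i, γ) ↦ γ βᵢ` is a bijection `ι × Γ₀(N) → R_N^{(m)}`, and the double series may be summed
fibrewise because it converges absolutely (`summable_greenQ_heckeMatrices`).
[cite: BruinierLiYang2025, (1.2)] -/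
theorem higherGreen_eq_tsum_higherGreen_one {N : ℕ} {m : ℤ} (hm : 0 < m) {s : ℕ} (hs : 2 ≤ s)
    {ι : Type*} (β : ι → Matrix (Fin 2) (Fin 2) ℤ) (hβ : ∀ i, β i ∈ heckeMatrices N m)
    (hT : ∀ δ ∈ heckeMatrices N m,
      ∃! i, ∃ γ : SL(2, ℤ), γ ∈ Gamma0 N ∧ (γ : Matrix (Fin 2) (Fin 2) ℤ) * β i = δ)
    (z₁ z₂ : ℍ) :
    higherGreen N s m z₁ z₂ = ∑' i, higherGreen N s 1 z₁ (intGL (β i) • z₂) := by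
  -- the bijection `ι × Γ₀(N) ≃ R_N^{(m)}`
  let Φ : ι × Gamma0 N → heckeMatrices N m := fun p =>
    ⟨((p.2 : SL(2, ℤ)) : Matrix (Fin 2) (Fin 2) ℤ) * β p.1,
      gamma0_mul_mem_heckeMatrices p.2.2 (hβ p.1)⟩
  have hΦ : Function.Bijective Φ := by
    constructor
    · rintro ⟨i, γ⟩ ⟨i', γ'⟩ h
      have hmat : ((γ : SL(2, ℤ)) : Matrix (Fin 2) (Fin 2) ℤ) * β i =
          ((γ' : SL(2, ℤ)) : Matrix (Fin 2) (Fin 2) ℤ) * β i' := congrArg Subtype.val h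
      have hi : i = i' := by
        obtain ⟨i₀, -, huniq⟩ := hT _ (gamma0_mul_mem_heckeMatrices γ.2 (hβ i))
        exact (huniq i ⟨γ, γ.2, rfl⟩).trans (huniq i' ⟨γ', γ'.2, hmat.symm⟩).symm
      subst hi
      have hγ : ((γ : SL(2, ℤ)) : Matrix (Fin 2) (Fin 2) ℤ) = ((γ' : SL(2, ℤ)) : Matrix _ _ ℤ) :=
        matrix_mul_right_cancel_of_det_ne_zero (det_ne_zero_of_mem_heckeMatrices hm.ne' (hβ i))
          hmat
      have : γ = γ' := Subtype.ext (Subtype.ext hγ)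
      rw [this]
    · rintro ⟨δ, hδ⟩
      obtain ⟨i, ⟨γ, hγ, h⟩, -⟩ := hT δ hδ
      exact ⟨(i, ⟨γ, hγ⟩), Subtype.ext h⟩
  let e : ι × Gamma0 N ≃ heckeMatrices N m := Equiv.ofBijective Φ hΦ
  -- the summand in `cosh` form, summable
  set F : heckeMatrices N m → ℝ := fun δ =>
    greenQ s (Real.cosh (dist z₁ (intGL (δ : Matrix (Fin 2) (Fin 2) ℤ) • z₂))) with hF
  have hsum : Summable F := by
    refine (summable_greenQ_heckeMatrices (N := N) hm hs z₁ z₂).congr fun δ => ?_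
    simp only [hF, one_add_dist_sq_div_eq_cosh_dist]
  have hsum' : Summable fun q : ι × Gamma0 N => F (e q) := (Equiv.summable_iff e).mpr hsum
  -- `Γ₀(N) ≃ R_N^{(1)}` (`coe_mem_heckeMatrices_one_iff`)
  let e₁ : Gamma0 N ≃ heckeMatrices N 1 :=
    { toFun := fun γ => ⟨((γ : SL(2, ℤ)) : Matrix (Fin 2) (Fin 2) ℤ),
        (coe_mem_heckeMatrices_one_iff _).mpr γ.2⟩
      invFun := fun δ => ⟨⟨(δ : Matrix (Fin 2) (Fin 2) ℤ), (mem_heckeMatrices.mp δ.2).1⟩,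
        (coe_mem_heckeMatrices_one_iff _).mp δ.2⟩
      left_inv := fun _ => rfl
      right_inv := fun _ => rfl }
  -- fibres: `F (γ βᵢ) = Q_{s-1}(cosh d(z₁, γ βᵢ z₂))`, a term of `G_s(z₁, βᵢ z₂)`
  have hfib : ∀ i, ∑' γ : Gamma0 N, F (e (i, γ)) =
      ∑' δ : heckeMatrices N 1,
        greenQ s (Real.cosh (dist z₁ (intGL (δ : Matrix (Fin 2) (Fin 2) ℤ) • intGL (β i) • z₂))) := by
    intro i
    rw [← e₁.tsum_eq]
    refine tsum_congr fun γ => ?_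
    have hγdet : (((γ : SL(2, ℤ)) : Matrix (Fin 2) (Fin 2) ℤ)).det ≠ 0 := by
      rw [Matrix.SpecialLinearGroup.det_coe]
      exact one_ne_zero
    simp only [hF, e, Equiv.ofBijective_apply, Φ]
    rw [intGL_mul hγdet (det_ne_zero_of_mem_heckeMatrices hm.ne' (hβ i)), mul_smul]
    rfl
  calc higherGreen N s m z₁ z₂ = -2 * ∑' δ, F δ := higherGreen_eq_tsum_cosh_dist N s m z₁ z₂
    _ = -2 * ∑' q : ι × Gamma0 N, F (e q) := by rw [e.tsum_eq]
    _ = -2 * ∑' i, ∑' γ : Gamma0 N, F (e (i, γ)) := by rw [hsum'.tsum_prod]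
    _ = ∑' i, -2 * ∑' γ : Gamma0 N, F (e (i, γ)) := by rw [tsum_mul_left]
    _ = ∑' i, higherGreen N s 1 z₁ (intGL (β i) • z₂) :=
        tsum_congr fun i => by rw [hfib i, higherGreen_eq_tsum_cosh_dist]

open Literature.NumberTheory.EllipticCurves.ModularForms (Delta0) in
/-- For `m` coprime to `N`, `R_N^{(m)}` is the set `Δ₀ᴺ(m)` of Diamond–Shurman (3.16)
(`Delta0`: the extra condition `gcd(a, N) = 1` is automatic, since `ad ≡ m (mod N)`). [folklore] -/
theorem heckeMatrices_eq_delta0 {N : ℕ} {m : ℤ} (hmN : IsCoprime m (N : ℤ)) :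
    heckeMatrices N m = Delta0 N m := by
  ext M
  simp only [mem_heckeMatrices, Delta0, Set.mem_setOf_eq]
  constructor
  · rintro ⟨hdet, hc⟩
    refine ⟨hdet, hc, ?_⟩
    obtain ⟨c', hc'⟩ := hc
    obtain ⟨u, v, huv⟩ := hmN
    rw [Matrix.det_fin_two] at hdet
    exact ⟨u * M 1 1, v - u * M 0 1 * c', by linear_combination huv + u * hdet + u * M 0 1 * hc'⟩
  · rintro ⟨hdet, hc, -⟩
    exact ⟨hdet, hc⟩

open Literature.NumberTheory.EllipticCurves.ModularForms (Delta0 heckeRep HeckeIdx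
  heckeRep_mem_delta0 existsUnique_mem_delta0_mul_heckeRep exists_mem_delta0_one_iff) in
/-- **`G_s^{Γ₀(N), p} = G_s^{Γ₀(N)} | T_p` explicitly**, for a prime `p ∤ N` and `s ≥ 2`:
`G_s^{Γ₀(N), p}(z₁, z₂) = Σ_{j mod p} G_s^{Γ₀(N)}(z₁, (z₂ + j)/p) + G_s^{Γ₀(N)}(z₁, p z₂)`, i.e.
(1.2) of Bruinier–Li–Yang 2025 with the standard representatives `βⱼ = (1 j; 0 p)`, `β_∞ = (p 0; 0 1)`
of `Γ₀(N) \ Γ₀(N) diag(1, p) Γ₀(N) = Γ₀(N) \ R_N^{(p)}` (Diamond–Shurman Prop. 5.2.1; the tree's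
`heckeRep`, `existsUnique_mem_delta0_mul_heckeRep`). [cite: BruinierLiYang2025, (1.2)] -/
theorem higherGreen_prime_eq_sum {N p : ℕ} [NeZero p] (hp : p.Prime) (hpN : ¬p ∣ N) {s : ℕ}
    (hs : 2 ≤ s) (z₁ z₂ : ℍ) :
    higherGreen N s p z₁ z₂ =
      ∑ i : Option (ZMod p), higherGreen N s 1 z₁ (intGL (heckeRep p i) • z₂) := by
  have hp0 : (0 : ℤ) < p := by exact_mod_cast hp.pos
  have hcop : IsCoprime (p : ℤ) (N : ℤ) :=
    Nat.isCoprime_iff_coprime.2 ((Nat.Prime.coprime_iff_not_dvd hp).2 hpN)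
  have hR : heckeMatrices N p = Delta0 N p := heckeMatrices_eq_delta0 hcop
  have hβ : ∀ i : Option (ZMod p), heckeRep p i ∈ heckeMatrices N p := fun i => by
    rw [hR]
    exact heckeRep_mem_delta0 (N := N) hp ⟨i, fun _ => hpN⟩
  have hT : ∀ δ ∈ heckeMatrices N p,
      ∃! i : Option (ZMod p), ∃ γ : SL(2, ℤ), γ ∈ Gamma0 N ∧
        (γ : Matrix (Fin 2) (Fin 2) ℤ) * heckeRep p i = δ := by
    intro δ hδ
    rw [hR, ← mul_one (p : ℤ)] at hδ
    have hp1 : ¬(p : ℤ) ∣ 1 := fun h =>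
      hp.ne_one (by exact_mod_cast Int.eq_one_of_dvd_one (by positivity) h)
    obtain ⟨⟨i, hi⟩, hex, huniq⟩ := existsUnique_mem_delta0_mul_heckeRep hp hp1 hδ
    refine ⟨i, (exists_mem_delta0_one_iff _).mp hex, fun i' hi' => ?_⟩
    have h := huniq ⟨i', fun _ => hpN⟩ ((exists_mem_delta0_one_iff _).mpr hi')
    exact congrArg Subtype.val h
  rw [higherGreen_eq_tsum_higherGreen_one hp0 hs (heckeRep p) hβ hT z₁ z₂, tsum_fintype]


/-! ## CM points: the discriminant is `SL(2, ℤ)`-invariant -/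

/-- **The discriminant of a CM point is `SL(2, ℤ)`-invariant**: if `z` is a root of the primitive
positive definite form `a X² + b XY + c Y²` of discriminant `d`, then `γ z` (`γ = (p q; r t) ∈ SL(2, ℤ)`)
is a root of the equivalent form `(a, b, c) ∘ γ⁻¹ = (a t² - b t r + c r², -2atq + b(tp + qr) - 2crp,
a q² - b q p + c p²)`, again primitive, positive definite and of discriminant `d`. Hence "CM point of
`X₀(N)` of discriminant `d`" in Conjecture 1.1 of Bruinier–Li–Yang 2025 does not depend on the lift
to `ℍ` (with `principalHigherGreen_smul_left/right`, `onHeckeCorrespondence_smul_left/right_iff`: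
the vendored `GKZAlgebraicity`, quantified over lifts, is a statement about points of
`X₀(N) × X₀(N)`). [folklore] -/
theorem IsCMPointOfDisc.sl_smul {z : ℍ} {d : ℤ} (h : IsCMPointOfDisc z d) (γ : SL(2, ℤ)) :
    IsCMPointOfDisc (γ • z) d := by
  have hdneg : d < 0 := h.disc_neg
  obtain ⟨a, b, c, ha, hgcd, hz, hd⟩ := h
  -- entries of `γ`
  set p : ℤ := (γ : Matrix (Fin 2) (Fin 2) ℤ) 0 0 with hp
  set q : ℤ := (γ : Matrix (Fin 2) (Fin 2) ℤ) 0 1 with hq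
  set r : ℤ := (γ : Matrix (Fin 2) (Fin 2) ℤ) 1 0 with hr
  set t : ℤ := (γ : Matrix (Fin 2) (Fin 2) ℤ) 1 1 with ht
  have hdet : p * t - q * r = 1 := by
    have h1 := γ.det_coe
    rw [Matrix.det_fin_two] at h1
    exact h1
  -- the transformed form
  set a' : ℤ := a * t ^ 2 - b * t * r + c * r ^ 2 with ha'
  set b' : ℤ := -2 * a * t * q + b * (t * p + q * r) - 2 * c * r * p with hb'
  set c' : ℤ := a * q ^ 2 - b * q * p + c * p ^ 2 with hc'
  refine ⟨a', b', c', ?_, ?_, ?_, ?_⟩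
  · -- positivity of `a' = Q(t, -r)`: `4 a a' = (2at - br)² - d r²`
    have hdisc : b ^ 2 - 4 * a * c < 0 := hd ▸ hdneg
    by_cases hr0 : r = 0
    · have hpt : p * t = 1 := by rw [hr0, mul_zero, sub_zero] at hdet; exact hdet
      have ht0 : t ≠ 0 := by
        rintro h0
        rw [h0, mul_zero] at hpt
        exact zero_ne_one hpt
      have : 0 < t ^ 2 := by positivity
      rw [ha', hr0]
      nlinarith
    · have hr2 : 0 < r ^ 2 := by positivity
      have key : 4 * a * a' = (2 * a * t - b * r) ^ 2 + (4 * a * c - b ^ 2) * r ^ 2 := by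
        rw [ha']
        ring
      nlinarith [sq_nonneg (2 * a * t - b * r), mul_pos (by linarith : 0 < 4 * a * c - b ^ 2) hr2]
  · -- primitivity: `(a, b, c) (pt - qr)²` is recovered from `(a', b', c')`
    have e1 : a' * p ^ 2 + b' * (p * r) + c' * r ^ 2 = a * (p * t - q * r) ^ 2 := by
      rw [ha', hb', hc']; ring
    have e2 : 2 * a' * (p * q) + b' * (p * t + q * r) + 2 * c' * (r * t) = b * (p * t - q * r) ^ 2 := by
      rw [ha', hb', hc']; ring
    have e3 : a' * q ^ 2 + b' * (q * t) + c' * t ^ 2 = c * (p * t - q * r) ^ 2 := by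
      rw [ha', hb', hc']; ring
    rw [hdet, one_pow, mul_one] at e1 e2 e3
    set g : ℕ := Int.gcd (Int.gcd a' b') c' with hg
    have hg1 : (g : ℤ) ∣ (Int.gcd a' b' : ℤ) := Int.gcd_dvd_left _ _
    have hga : (g : ℤ) ∣ a' := hg1.trans (Int.gcd_dvd_left _ _)
    have hgb : (g : ℤ) ∣ b' := hg1.trans (Int.gcd_dvd_right _ _)
    have hgc : (g : ℤ) ∣ c' := Int.gcd_dvd_right _ _
    have hda : (g : ℤ) ∣ a := e1 ▸ dvd_add (dvd_add (dvd_mul_of_dvd_left hga _)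
      (dvd_mul_of_dvd_left hgb _)) (dvd_mul_of_dvd_left hgc _)
    have hdb : (g : ℤ) ∣ b := e2 ▸ dvd_add (dvd_add (dvd_mul_of_dvd_left (dvd_mul_of_dvd_right hga _) _)
      (dvd_mul_of_dvd_left hgb _)) (dvd_mul_of_dvd_left (dvd_mul_of_dvd_right hgc _) _)
    have hdc : (g : ℤ) ∣ c := e3 ▸ dvd_add (dvd_add (dvd_mul_of_dvd_left hga _)
      (dvd_mul_of_dvd_left hgb _)) (dvd_mul_of_dvd_left hgc _)
    have hg_one : g ∣ 1 := by
      have h1 : g ∣ Int.gcd (Int.gcd a b) c :=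
        Int.dvd_gcd (Int.natCast_dvd_natCast.mpr (Int.dvd_gcd hda hdb)) hdc
      rwa [hgcd] at h1
    exact Nat.dvd_one.mp hg_one
  · -- `γ z` is a root of the transformed form
    have hγ1 : (γ : Matrix (Fin 2) (Fin 2) ℤ) ∈ heckeMatrices 1 1 := by
      rw [mem_heckeMatrices]
      exact ⟨γ.det_coe, by simp⟩
    have hw : ((γ • z : ℍ) : ℂ) = ((p : ℂ) * z + q) / ((r : ℂ) * z + t) := by
      rw [sl_smul_eq_intGL_smul, coe_intGL_smul one_pos hγ1]
    have hden : (r : ℂ) * z + t ≠ 0 :=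
      linear_ne_zero_of_det_ne_zero (γ := (γ : Matrix (Fin 2) (Fin 2) ℤ))
        (by rw [γ.det_coe]; exact one_ne_zero) z
    have key : ((a' : ℂ) * (((p : ℂ) * z + q) / ((r : ℂ) * z + t)) ^ 2 +
        b' * (((p : ℂ) * z + q) / ((r : ℂ) * z + t)) + c') * ((r : ℂ) * z + t) ^ 2 = 0 := by
      rw [ha', hb', hc']
      push_cast
      field_simp
      linear_combination ((p : ℂ) * t - q * r) ^ 2 * hz
    rw [hw]
    exact (mul_eq_zero.mp key).resolve_right (pow_ne_zero 2 hden)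
  · -- the discriminant is unchanged: `b'² - 4a'c' = (pt - qr)² (b² - 4ac)`
    rw [hd, ha', hb', hc']
    linear_combination (-(p * t - q * r + 1) * (b ^ 2 - 4 * a * c)) * hdet

/-- The discriminant of a CM point is well defined on `X₀(N)` (indeed on `SL(2, ℤ) \ ℍ`):
`IsCMPointOfDisc (γ z) d ↔ IsCMPointOfDisc z d`. [folklore] -/
theorem isCMPointOfDisc_sl_smul_iff (γ : SL(2, ℤ)) (z : ℍ) (d : ℤ) :
    IsCMPointOfDisc (γ • z) d ↔ IsCMPointOfDisc z d :=
  ⟨fun h => by simpa using h.sl_smul γ⁻¹, fun h => h.sl_smul γ⟩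


/-! ## Normalisations: rational rescalings of `log|α|`, `α ∈ ℚ̄ˣ` -/

/-- The absolute value of a nonzero algebraic number is algebraic (`|α|² = α ᾱ`). [folklore] -/
theorem isAlgebraic_norm_of_isAlgebraic {α : ℂ} (hα : IsAlgebraic ℚ α) :
    IsAlgebraic ℚ ((‖α‖ : ℝ) : ℂ) := by
  have hconj : IsAlgebraic ℚ (starRingEnd ℂ α) :=
    hα.algHom ((Complex.conjAe.restrictScalars ℚ).toAlgHom)
  have hsq : ((‖α‖ : ℝ) : ℂ) ^ 2 = α * starRingEnd ℂ α := by
    rw [Complex.mul_conj, Complex.normSq_eq_norm_sq]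
    push_cast
    ring
  exact IsAlgebraic.of_pow two_pos (hsq ▸ hα.mul hconj)

/-- A positive real algebraic number has algebraic rational powers. [folklore] -/
theorem isAlgebraic_rpow_ratCast {ρ : ℝ} (hρ : 0 < ρ) (hρalg : IsAlgebraic ℚ (ρ : ℂ)) (q : ℚ) :
    IsAlgebraic ℚ ((ρ ^ (q : ℝ) : ℝ) : ℂ) := by
  have hden : 0 < q.den := q.den_pos
  refine IsAlgebraic.of_pow hden ?_
  have hpow : ((ρ ^ (q : ℝ) : ℝ) : ℂ) ^ q.den = (ρ : ℂ) ^ q.num := by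
    rw [← Complex.ofReal_pow, ← Real.rpow_natCast, ← Real.rpow_mul hρ.le,
      show (q : ℝ) * (q.den : ℕ) = (q.num : ℤ) by exact_mod_cast Rat.mul_den_eq_num q,
      Real.rpow_intCast, Complex.ofReal_zpow]
  rw [hpow]
  obtain ⟨n, hn | hn⟩ := Int.eq_nat_or_neg q.num
  · rw [hn, zpow_natCast]
    exact hρalg.pow n
  · rw [hn, zpow_neg, zpow_natCast]
    exact (hρalg.pow n).inv

/-- **Rational rescaling of the conclusion of Conjecture 1.1.** If `x = κ log|α|` with `α ∈ ℚ̄ˣ`,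
then for every rational `q` also `q x = κ log|α'|` with `α' = |α|^q ∈ ℚ̄ˣ`. This is the
normalisation remark in the docstring of `GKZAlgebraicity`: replacing `G_{r+1,f}` by a nonzero
rational multiple (e.g. summing (1.1) over `Γ₀(N)` versus `Γ₀(N)/{±1}`, or another admissible
weight normalisation), or `dⱼ` by the discriminant `dⱼ f²` of another order (`|d₁d₂|^{-r/2}` changes
by the rational factor `|f|^{-r}`), does not change the truth value of the conclusion
`∃ α ∈ ℚ̄ˣ, G = |d₁d₂|^{-r/2} log|α|`. [folklore] -/
theorem exists_isAlgebraic_rat_mul_log_norm {x κ : ℝ}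
    (h : ∃ α : ℂ, IsAlgebraic ℚ α ∧ α ≠ 0 ∧ x = κ * Real.log ‖α‖) (q : ℚ) :
    ∃ α : ℂ, IsAlgebraic ℚ α ∧ α ≠ 0 ∧ (q : ℝ) * x = κ * Real.log ‖α‖ := by
  obtain ⟨α, hα, hne, rfl⟩ := h
  have hρ : 0 < ‖α‖ := norm_pos_iff.mpr hne
  refine ⟨((‖α‖ ^ (q : ℝ) : ℝ) : ℂ), isAlgebraic_rpow_ratCast hρ (isAlgebraic_norm_of_isAlgebraic hα) q,
    ?_, ?_⟩
  · exact_mod_cast (Real.rpow_pos_of_pos hρ _).ne'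
  · rw [Complex.norm_real, Real.norm_of_nonneg (Real.rpow_nonneg hρ.le _), Real.log_rpow hρ]
    ring


/-! ## The classical transversal of `Γ₀(N) \ R_N^{(m)}`, `gcd(m, N) = 1` -/

/-- **Row reduction inside `Γ₀(N)`.** For `δ = (A B; C D) ∈ R_N^{(m)}`, `m ≠ 0`, with
`gcd(A, N) = 1`, there is `γ ∈ Γ₀(N)` with `γδ` upper triangular: `γ = (u v; -C/g A/g)`,
`g = gcd(A, C) = uA + vC` (`N ∣ C/g` because `gcd(g, N) ∣ gcd(A, N) = 1`). [folklore] -/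
theorem exists_gamma0_mul_apply_eq_zero {N : ℕ} {m : ℤ} (hm : m ≠ 0)
    {δ : Matrix (Fin 2) (Fin 2) ℤ} (hδ : δ ∈ heckeMatrices N m) (hcop : IsCoprime (δ 0 0) (N : ℤ)) :
    ∃ γ : SL(2, ℤ), γ ∈ Gamma0 N ∧ ((γ : Matrix (Fin 2) (Fin 2) ℤ) * δ) 1 0 = 0 := by
  obtain ⟨hdet, hNC⟩ := mem_heckeMatrices.mp hδ
  obtain ⟨A', hA'⟩ : (Int.gcd (δ 0 0) (δ 1 0) : ℤ) ∣ δ 0 0 := Int.gcd_dvd_left _ _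
  obtain ⟨C', hC'⟩ : (Int.gcd (δ 0 0) (δ 1 0) : ℤ) ∣ δ 1 0 := Int.gcd_dvd_right _ _
  set g : ℕ := Int.gcd (δ 0 0) (δ 1 0) with hg
  have hg0 : (g : ℤ) ≠ 0 := by
    intro h0
    apply hm
    rw [← hdet, Matrix.det_fin_two, hA', hC', h0]
    ring
  have hbez : (δ 0 0) * Int.gcdA (δ 0 0) (δ 1 0) + (δ 1 0) * Int.gcdB (δ 0 0) (δ 1 0) = g :=
    (Int.gcd_eq_gcd_ab (δ 0 0) (δ 1 0)).symm
  set u : ℤ := Int.gcdA (δ 0 0) (δ 1 0) with hu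
  set v : ℤ := Int.gcdB (δ 0 0) (δ 1 0) with hv
  have hbez' : u * A' + v * C' = 1 := by
    apply mul_left_cancel₀ hg0
    linear_combination -(u * hA') - v * hC' + hbez
  have hγdet : Matrix.det !![u, v; -C', A'] = 1 := by
    rw [Matrix.det_fin_two_of]
    linear_combination hbez'
  refine ⟨⟨!![u, v; -C', A'], hγdet⟩, ?_, ?_⟩
  · rw [Gamma0_mem]
    have hgN : IsCoprime (g : ℤ) (N : ℤ) := hcop.of_isCoprime_of_dvd_left ⟨A', hA'⟩
    have h1 : (N : ℤ) ∣ (g : ℤ) * C' := hC' ▸ hNC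
    have hNC' : (N : ℤ) ∣ C' := hgN.symm.dvd_of_dvd_mul_left h1
    have h10 : ((⟨!![u, v; -C', A'], hγdet⟩ : SL(2, ℤ)) : Matrix (Fin 2) (Fin 2) ℤ) 1 0 = -C' := by
      simp
    rw [h10, Int.cast_neg, neg_eq_zero, ZMod.intCast_zmod_eq_zero_iff_dvd]
    exact hNC'
  · simp [Matrix.mul_apply, Fin.sum_univ_two]
    rw [hA', hC']
    ring

/-- Normalisation of an upper triangular integer matrix `(A B; 0 D)`: a power of
`T = (1 1; 0 1) ∈ Γ₀(N)` reduces `B` modulo `D`. [folklore] -/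
theorem exists_gamma0_mul_eq_upper_emod (N : ℕ) {δ : Matrix (Fin 2) (Fin 2) ℤ} (hc : δ 1 0 = 0) :
    ∃ γ : SL(2, ℤ), γ ∈ Gamma0 N ∧
      (γ : Matrix (Fin 2) (Fin 2) ℤ) * δ = !![δ 0 0, δ 0 1 % δ 1 1; 0, δ 1 1] := by
  refine ⟨ModularGroup.T ^ (-(δ 0 1 / δ 1 1)), ?_, ?_⟩
  · rw [Gamma0_mem, ModularGroup.coe_T_zpow]
    simp
  · rw [ModularGroup.coe_T_zpow]
    ext i j
    fin_cases i <;> fin_cases j <;>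
      simp [Matrix.mul_apply, Fin.sum_univ_two, hc, Int.emod_def]
    ring


/-- **Normal form under `Γ₀(N)`.** Every `δ ∈ R_N^{(m)}`, `m > 0`, with `gcd(δ₀₀, N) = 1` is
`Γ₀(N)`-equivalent to an upper triangular `(a b; 0 d)` with `a, d > 0`, `ad = m`, `0 ≤ b < d`
(row reduction, then `±1`, then a power of `T`). [folklore] -/
theorem exists_gamma0_mul_eq_upper {N : ℕ} {m : ℤ} (hm : 0 < m) {δ : Matrix (Fin 2) (Fin 2) ℤ}
    (hδ : δ ∈ heckeMatrices N m) (hcop : IsCoprime (δ 0 0) (N : ℤ)) :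
    ∃ γ : SL(2, ℤ), γ ∈ Gamma0 N ∧ ∃ a b d : ℤ, 0 < a ∧ 0 < d ∧ 0 ≤ b ∧ b < d ∧ a * d = m ∧
      (γ : Matrix (Fin 2) (Fin 2) ℤ) * δ = !![a, b; 0, d] := by
  -- step 1: upper triangular
  obtain ⟨γ₁, hγ₁, hc⟩ := exists_gamma0_mul_apply_eq_zero hm.ne' hδ hcop
  set δ₁ : Matrix (Fin 2) (Fin 2) ℤ := (γ₁ : Matrix (Fin 2) (Fin 2) ℤ) * δ with hδ₁
  have hδ₁mem : δ₁ ∈ heckeMatrices N m := gamma0_mul_mem_heckeMatrices hγ₁ hδ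
  have hAD : δ₁ 0 0 * δ₁ 1 1 = m := mul_eq_of_mem_heckeMatrices_of_eq_zero hδ₁mem hc
  have hD0 : δ₁ 1 1 ≠ 0 := fun h => hm.ne' (by rw [← hAD, h, mul_zero])
  -- step 2: positive lower-right entry, using `±1 ∈ Γ₀(N)`
  obtain ⟨ε, hε, hεc, hεD⟩ : ∃ ε : SL(2, ℤ), ε ∈ Gamma0 N ∧
      ((ε : Matrix (Fin 2) (Fin 2) ℤ) * δ₁) 1 0 = 0 ∧ 0 < ((ε : Matrix (Fin 2) (Fin 2) ℤ) * δ₁) 1 1 := by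
    rcases lt_or_gt_of_ne hD0 with hneg | hpos
    · refine ⟨-1, ?_, ?_, ?_⟩
      · rw [Gamma0_mem]
        simp
      · simp [hc]
      · simp only [Matrix.SpecialLinearGroup.coe_neg, Matrix.SpecialLinearGroup.coe_one,
          neg_mul, one_mul, Matrix.neg_apply]
        linarith
    · exact ⟨1, one_mem _, by simpa using hc, by simpa using hpos⟩
  set δ₂ : Matrix (Fin 2) (Fin 2) ℤ := (ε : Matrix (Fin 2) (Fin 2) ℤ) * δ₁ with hδ₂
  have hδ₂mem : δ₂ ∈ heckeMatrices N m := gamma0_mul_mem_heckeMatrices hε hδ₁mem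
  have hAD₂ : δ₂ 0 0 * δ₂ 1 1 = m := mul_eq_of_mem_heckeMatrices_of_eq_zero hδ₂mem hεc
  -- step 3: reduce the upper-right entry modulo `d`
  obtain ⟨γ₃, hγ₃, h₃⟩ := exists_gamma0_mul_eq_upper_emod N (δ := δ₂) hεc
  have ha : 0 < δ₂ 0 0 := by
    by_contra ha
    simp only [not_lt] at ha
    have : δ₂ 0 0 * δ₂ 1 1 ≤ 0 := mul_nonpos_of_nonpos_of_nonneg ha hεD.le
    linarith
  refine ⟨γ₃ * ε * γ₁, mul_mem (mul_mem hγ₃ hε) hγ₁, δ₂ 0 0, δ₂ 0 1 % δ₂ 1 1, δ₂ 1 1, ha, hεD,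
    Int.emod_nonneg _ hεD.ne', Int.emod_lt_of_pos _ hεD, hAD₂, ?_⟩
  rw [Matrix.SpecialLinearGroup.coe_mul, Matrix.SpecialLinearGroup.coe_mul, Matrix.mul_assoc,
    Matrix.mul_assoc, ← hδ₁, ← hδ₂]
  exact h₃

/-- **Uniqueness of the normal form**: if `γ (a b; 0 d) = (a' b'; 0 d')` with `γ ∈ SL(2, ℤ)`,
`a, a' > 0`, `0 ≤ b < d`, `0 ≤ b' < d'`, then `(a, b, d) = (a', b', d')` (`γ` is forced to be
`T^q`, and then `q = 0`). [folklore] -/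
theorem upper_normalForm_unique {γ : SL(2, ℤ)} {a b d a' b' d' : ℤ} (ha : 0 < a) (hb : 0 ≤ b)
    (hbd : b < d) (ha' : 0 < a') (hb' : 0 ≤ b') (hbd' : b' < d')
    (h : (γ : Matrix (Fin 2) (Fin 2) ℤ) * !![a, b; 0, d] = !![a', b'; 0, d']) :
    a = a' ∧ b = b' ∧ d = d' := by
  have e00 := congrFun (congrFun h 0) 0
  have e01 := congrFun (congrFun h 0) 1
  have e10 := congrFun (congrFun h 1) 0
  have e11 := congrFun (congrFun h 1) 1
  simp [Matrix.mul_apply, Fin.sum_univ_two] at e00 e01 e10 e11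
  -- `e00 : γ₀₀ a = a'`, `e01 : γ₀₀ b + γ₀₁ d = b'`, `e10 : γ₁₀ a = 0`, `e11 : γ₁₀ b + γ₁₁ d = d'`
  have hr : (γ : Matrix (Fin 2) (Fin 2) ℤ) 1 0 = 0 := e10.resolve_right ha.ne'
  have hdet := γ.det_coe
  rw [Matrix.det_fin_two, hr, mul_zero, sub_zero] at hdet
  have hp : 0 < (γ : Matrix (Fin 2) (Fin 2) ℤ) 0 0 := by
    by_contra hp
    simp only [not_lt] at hp
    have : (γ : Matrix (Fin 2) (Fin 2) ℤ) 0 0 * a ≤ 0 := mul_nonpos_of_nonpos_of_nonneg hp ha.le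
    linarith
  obtain ⟨hp1, ht1⟩ | ⟨hp1, -⟩ := Int.eq_one_or_neg_one_of_mul_eq_one' hdet
  · rw [hp1, one_mul] at e00 e01
    rw [hr, ht1, zero_mul, one_mul, zero_add] at e11
    have hd : 0 < d := by omega
    have hq : (γ : Matrix (Fin 2) (Fin 2) ℤ) 0 1 = 0 := by
      rcases lt_trichotomy ((γ : Matrix (Fin 2) (Fin 2) ℤ) 0 1) 0 with hlt | heq | hgt
      · exfalso
        have h1 : (γ : Matrix (Fin 2) (Fin 2) ℤ) 0 1 ≤ -1 := by omega
        have h2 : (γ : Matrix (Fin 2) (Fin 2) ℤ) 0 1 * d ≤ -1 * d := mul_le_mul_of_nonneg_right h1 hd.le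
        linarith
      · exact heq
      · exfalso
        have h1 : 1 ≤ (γ : Matrix (Fin 2) (Fin 2) ℤ) 0 1 := by omega
        have h2 : 1 * d ≤ (γ : Matrix (Fin 2) (Fin 2) ℤ) 0 1 * d := mul_le_mul_of_nonneg_right h1 hd.le
        linarith
    rw [hq, zero_mul, add_zero] at e01
    exact ⟨e00, e01, e11⟩
  · exfalso
    rw [hp1] at hp
    norm_num at hp



/-- **The classical `T_m`-formula for `G_s^{Γ₀(N), m}`, `gcd(m, N) = 1`.** For `m ≥ 1` coprime to
`N` and `s ≥ 2`,
`G_s^{Γ₀(N), m}(z₁, z₂) = Σ_{ad = m, a, d > 0} Σ_{b = 0}^{d-1} G_s^{Γ₀(N)}(z₁, (a z₂ + b)/d)`: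
the matrices `(a b; 0 d)`, `ad = m`, `0 ≤ b < d`, are a system of representatives of
`Γ₀(N) \ R_N^{(m)}` (`exists_gamma0_mul_eq_upper`, `upper_normalForm_unique`), and (1.2) of
Bruinier–Li–Yang 2025 (`higherGreen_eq_tsum_higherGreen_one`) becomes the textbook finite sum
(Gross–Zagier 1986, §II.2, `G_{N,s}^m`; Diamond–Shurman Prop. 5.2.1 for `m = p`). In particular
the sum in (1.2) is finite. [cite: BruinierLiYang2025, (1.2)] -/
theorem higherGreen_eq_sum_divisorsAntidiagonal {N m : ℕ} (hm : 0 < m) (hmN : Nat.Coprime m N)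
    {s : ℕ} (hs : 2 ≤ s) (z₁ z₂ : ℍ) :
    higherGreen N s m z₁ z₂ =
      ∑ x ∈ Nat.divisorsAntidiagonal m, ∑ b ∈ Finset.range x.2,
        higherGreen N s 1 z₁ (intGL !![(x.1 : ℤ), (b : ℤ); 0, (x.2 : ℤ)] • z₂) := by
  classical
  -- the index finset `T = {((a, d), b) : ad = m, b < d}` and the representatives
  set T : Finset ((ℕ × ℕ) × ℕ) :=
    (Nat.divisorsAntidiagonal m ×ˢ Finset.range m).filter (fun x => x.2 < x.1.2) with hT
  let f : (ℕ × ℕ) × ℕ → ℝ := fun y =>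
    higherGreen N s 1 z₁ (intGL !![(y.1.1 : ℤ), (y.2 : ℤ); 0, (y.1.2 : ℤ)] • z₂)
  let β : T → Matrix (Fin 2) (Fin 2) ℤ := fun x =>
    !![((x : (ℕ × ℕ) × ℕ).1.1 : ℤ), ((x : (ℕ × ℕ) × ℕ).2 : ℤ); 0, ((x : (ℕ × ℕ) × ℕ).1.2 : ℤ)]
  have hle : ∀ x : ℕ × ℕ, x ∈ Nat.divisorsAntidiagonal m → x.2 ≤ m := by
    intro x hx
    rw [Nat.mem_divisorsAntidiagonal] at hx
    exact Nat.le_of_dvd hm ⟨x.1, by rw [mul_comm]; exact hx.1.symm⟩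
  have hmem : ∀ x : (ℕ × ℕ) × ℕ, x ∈ T ↔ x.1.1 * x.1.2 = m ∧ x.2 < x.1.2 := by
    intro x
    simp only [hT, Finset.mem_filter, Finset.mem_product, Finset.mem_range]
    constructor
    · rintro ⟨⟨h1, -⟩, h3⟩
      exact ⟨(Nat.mem_divisorsAntidiagonal.mp h1).1, h3⟩
    · rintro ⟨h1, h3⟩
      have h1' : x.1 ∈ Nat.divisorsAntidiagonal m := Nat.mem_divisorsAntidiagonal.mpr ⟨h1, hm.ne'⟩
      exact ⟨⟨h1', lt_of_lt_of_le h3 (hle x.1 h1')⟩, h3⟩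
  have hβ : ∀ x : T, β x ∈ heckeMatrices N m := by
    intro x
    obtain ⟨h1, -⟩ := (hmem x).mp x.2
    refine mem_heckeMatrices.mpr ⟨?_, ?_⟩
    · show Matrix.det !![((x : (ℕ × ℕ) × ℕ).1.1 : ℤ), ((x : (ℕ × ℕ) × ℕ).2 : ℤ); 0,
        ((x : (ℕ × ℕ) × ℕ).1.2 : ℤ)] = (m : ℤ)
      rw [Matrix.det_fin_two_of, mul_zero, sub_zero]
      exact_mod_cast h1
    · show (N : ℤ) ∣ (!![((x : (ℕ × ℕ) × ℕ).1.1 : ℤ), ((x : (ℕ × ℕ) × ℕ).2 : ℤ); 0,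
        ((x : (ℕ × ℕ) × ℕ).1.2 : ℤ)] : Matrix (Fin 2) (Fin 2) ℤ) 1 0
      simp
  have hm' : (0 : ℤ) < (m : ℤ) := by exact_mod_cast hm
  have hT' : ∀ δ ∈ heckeMatrices N m,
      ∃! x : T, ∃ γ : SL(2, ℤ), γ ∈ Gamma0 N ∧ (γ : Matrix (Fin 2) (Fin 2) ℤ) * β x = δ := by
    intro δ hδ
    have hcopm : IsCoprime (m : ℤ) (N : ℤ) := Nat.isCoprime_iff_coprime.mpr hmN
    have hcop : IsCoprime (δ 0 0) (N : ℤ) := by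
      have hδ' : δ ∈ Literature.NumberTheory.EllipticCurves.ModularForms.Delta0 N m :=
        heckeMatrices_eq_delta0 hcopm ▸ hδ
      exact hδ'.2.2
    obtain ⟨γ, hγ, a, b, d, ha, hd, hb, hbd, had, hγδ⟩ := exists_gamma0_mul_eq_upper hm' hδ hcop
    -- the index of `δ`
    have hx : ((a.toNat, d.toNat), b.toNat) ∈ T := by
      rw [hmem]
      constructor
      · zify
        rw [Int.toNat_of_nonneg ha.le, Int.toNat_of_nonneg hd.le]
        exact had
      · zify
        rw [Int.toNat_of_nonneg hb, Int.toNat_of_nonneg hd.le]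
        exact hbd
    have hβx : β ⟨_, hx⟩ = !![a, b; 0, d] := by
      simp only [β, Int.toNat_of_nonneg ha.le, Int.toNat_of_nonneg hd.le, Int.toNat_of_nonneg hb]
    refine ⟨⟨_, hx⟩, ⟨γ⁻¹, inv_mem hγ, ?_⟩, ?_⟩
    · rw [hβx, ← hγδ, ← Matrix.mul_assoc, ← Matrix.SpecialLinearGroup.coe_mul, inv_mul_cancel,
        Matrix.SpecialLinearGroup.coe_one, Matrix.one_mul]
    · rintro ⟨x', hx'⟩ ⟨γ', hγ', h'⟩
      obtain ⟨h1, h3⟩ := (hmem x').mp hx'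
      have hrel : ((γ * γ' : SL(2, ℤ)) : Matrix (Fin 2) (Fin 2) ℤ) *
          !![(x'.1.1 : ℤ), (x'.2 : ℤ); 0, (x'.1.2 : ℤ)] = !![a, b; 0, d] := by
        rw [Matrix.SpecialLinearGroup.coe_mul, Matrix.mul_assoc]
        change (γ : Matrix (Fin 2) (Fin 2) ℤ) * ((γ' : Matrix (Fin 2) (Fin 2) ℤ) * β ⟨x', hx'⟩) = _
        rw [h', hγδ]
      have hx'a : 0 < (x'.1.1 : ℤ) := by
        have : x'.1.1 ≠ 0 := fun h0 => hm.ne' (by rw [← h1, h0, zero_mul])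
        exact_mod_cast Nat.pos_of_ne_zero this
      obtain ⟨e1, e2, e3⟩ := upper_normalForm_unique hx'a (by positivity) (by exact_mod_cast h3)
        ha hb hbd hrel
      apply Subtype.ext
      ext
      · simp only
        zify
        rw [Int.toNat_of_nonneg ha.le]
        exact e1
      · simp only
        zify
        rw [Int.toNat_of_nonneg hd.le]
        exact e3
      · simp only
        zify
        rw [Int.toNat_of_nonneg hb]
        exact e2
  -- (1.2) for this transversal, then the `tsum` over `T` as a finite double sum
  rw [higherGreen_eq_tsum_higherGreen_one hm' hs β hβ hT' z₁ z₂]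
  calc ∑' x : T, higherGreen N s 1 z₁ (intGL (β x) • z₂)
      = ∑' x : T, f (x : (ℕ × ℕ) × ℕ) := rfl
    _ = ∑ x ∈ T, f x := Finset.tsum_subtype T f
    _ = ∑ x ∈ Nat.divisorsAntidiagonal m ×ˢ Finset.range m, if x.2 < x.1.2 then f x else 0 :=
        Finset.sum_filter _ _
    _ = ∑ x ∈ Nat.divisorsAntidiagonal m, ∑ b ∈ Finset.range m,
          if b < x.2 then f (x, b) else 0 := Finset.sum_product _ _ _
    _ = ∑ x ∈ Nat.divisorsAntidiagonal m, ∑ b ∈ Finset.range x.2, f (x, b) := by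
        refine Finset.sum_congr rfl fun x hx => ?_
        rw [← Finset.sum_filter]
        congr 1
        ext b
        simp only [Finset.mem_filter, Finset.mem_range]
        have := hle x hx
        omega


/-! ## The logarithmic singularity of `Q_{s-1}` at `t → 1⁺` -/

/-- `Q_{s-1}(t) ≤ Q_0(t)` for `s ≥ 1`, `t > 1` (the base of Heine's integrand is `≥ t > 1`). [folklore] -/
theorem greenQ_le_greenQ_one {t : ℝ} (ht : 1 < t) {s : ℕ} (hs : 1 ≤ s) : greenQ s t ≤ greenQ 1 t := by
  refine setIntegral_mono_on (integrableOn_greenQ_integrand ht hs)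
    (integrableOn_greenQ_integrand ht le_rfl) measurableSet_Ioi fun u _ => ?_
  have hb : 1 ≤ t + √(t ^ 2 - 1) * Real.cosh u := by
    have : 0 ≤ √(t ^ 2 - 1) * Real.cosh u := mul_nonneg (Real.sqrt_nonneg _) (Real.cosh_pos u).le
    linarith
  exact inv_anti₀ (by positivity) (pow_le_pow_right₀ hb hs)

/-- **At most a logarithmic singularity**: for `1 < t ≤ 2`,
`Q_0(t) ≤ 1 + log 2 - ½ log(t² - 1)`. Split Heine's integral at `u₀ = log(2/√(t²-1)) ≥ 0`: on
`(0, u₀]` the integrand is `≤ 1/t ≤ 1`, on `(u₀, ∞)` it is `≤ (2/√(t²-1)) e^{-u}`, whose tail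
integral is `(2/√(t²-1)) e^{-u₀} = 1`. (Classically `Q_0(t) = ½ log((t+1)/(t-1))`.) [folklore] -/
theorem greenQ_one_le_log {t : ℝ} (ht : 1 < t) (ht2 : t ≤ 2) :
    greenQ 1 t ≤ 1 + Real.log 2 - Real.log (t ^ 2 - 1) / 2 := by
  set σ : ℝ := √(t ^ 2 - 1) with hσ
  have ht21 : 0 < t ^ 2 - 1 := by nlinarith
  have hσ0 : 0 < σ := Real.sqrt_pos.mpr ht21
  have hσ2 : σ ≤ 2 := by
    rw [hσ, Real.sqrt_le_left (by norm_num : (0:ℝ) ≤ 2)]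
    nlinarith
  set u₀ : ℝ := Real.log (2 / σ) with hu₀
  have hu₀0 : 0 ≤ u₀ := Real.log_nonneg (by rw [le_div_iff₀ hσ0]; linarith)
  have hexp : Real.exp (-u₀) = σ / 2 := by
    rw [hu₀, Real.exp_neg, Real.exp_log (by positivity), inv_div]
  -- the integrand for `s = 1`
  set f : ℝ → ℝ := fun u => ((t + √(t ^ 2 - 1) * Real.cosh u) ^ 1)⁻¹ with hf
  have hfi : IntegrableOn f (Ioi 0) := integrableOn_greenQ_integrand ht le_rfl
  have hf1 : ∀ u, f u ≤ 1 := fun u => by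
    simp only [hf, pow_one]
    have : 0 ≤ √(t ^ 2 - 1) * Real.cosh u := mul_nonneg (Real.sqrt_nonneg _) (Real.cosh_pos u).le
    rw [inv_le_one₀ (by linarith)]
    linarith
  have hf2 : ∀ u, f u ≤ 2 / σ * Real.exp (-u) := fun u => by
    have h := greenQ_integrand_le ht 1 u
    simp only [pow_one, Nat.cast_one, neg_mul, one_mul] at h
    simpa only [hf, pow_one] using h
  -- split `(0, ∞) = (0, u₀] ∪ (u₀, ∞)`
  have hsplit : ∫ u in Ioi (0:ℝ), f u = (∫ u in Ioc (0:ℝ) u₀, f u) + ∫ u in Ioi u₀, f u := by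
    rw [← setIntegral_union (Set.Ioc_disjoint_Ioi le_rfl) measurableSet_Ioi
      (hfi.mono_set Set.Ioc_subset_Ioi_self) (hfi.mono_set (Set.Ioi_subset_Ioi hu₀0)),
      Set.Ioc_union_Ioi_eq_Ioi hu₀0]
  have h1 : ∫ u in Ioc (0:ℝ) u₀, f u ≤ u₀ := by
    calc ∫ u in Ioc (0:ℝ) u₀, f u ≤ ∫ u in Ioc (0:ℝ) u₀, (1:ℝ) :=
          setIntegral_mono_on (hfi.mono_set Set.Ioc_subset_Ioi_self)
            (integrableOn_const (by simp [Real.volume_Ioc]) ) measurableSet_Ioc fun u _ => hf1 u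
      _ = u₀ := by
          rw [setIntegral_const, Real.volume_real_Ioc_of_le hu₀0, sub_zero, smul_eq_mul, mul_one]
  have h2 : ∫ u in Ioi u₀, f u ≤ 1 := by
    calc ∫ u in Ioi u₀, f u ≤ ∫ u in Ioi u₀, 2 / σ * Real.exp (-u) :=
          setIntegral_mono_on (hfi.mono_set (Set.Ioi_subset_Ioi hu₀0))
            ((integrableOn_exp_neg_Ioi u₀).const_mul _) measurableSet_Ioi fun u _ => hf2 u
      _ = 1 := by
          rw [integral_const_mul, integral_exp_neg_Ioi, hexp]
          field_simp
  have hlog : u₀ = Real.log 2 - Real.log (t ^ 2 - 1) / 2 := by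
    rw [hu₀, Real.log_div (by norm_num) hσ0.ne', hσ, Real.log_sqrt ht21.le]
  calc greenQ 1 t = ∫ u in Ioi (0:ℝ), f u := rfl
    _ ≤ u₀ + 1 := by rw [hsplit]; exact add_le_add h1 h2
    _ = 1 + Real.log 2 - Real.log (t ^ 2 - 1) / 2 := by rw [hlog]; ring


/-- **At most a logarithmic singularity**, all `s ≥ 1`: for `1 < t ≤ 2`,
`Q_{s-1}(t) ≤ 1 + log 2 - ½ log(t² - 1)`. [folklore] -/
theorem greenQ_le_log {t : ℝ} (ht : 1 < t) (ht2 : t ≤ 2) {s : ℕ} (hs : 1 ≤ s) :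
    greenQ s t ≤ 1 + Real.log 2 - Real.log (t ^ 2 - 1) / 2 :=
  (greenQ_le_greenQ_one ht hs).trans (greenQ_one_le_log ht ht2)

/-- **At least a logarithmic singularity**: for `1 < t ≤ 2` and `s ≥ 1`,
`Q_{s-1}(t) ≥ 4^{-s} (log 2 - ½ log(t² - 1))`: on `(0, u₀]`, `u₀ = log(2/√(t²-1))`, the base
`t + √(t²-1) cosh u` of Heine's integrand is `≤ 2 + (1 + (t²-1)/4) ≤ 4`. Together with
`greenQ_le_log`: `Q_{s-1}(t) ≍ -log(t - 1)` as `t → 1⁺`, the logarithmic singularity of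
`G_s^{Γ₀(N)}` along the diagonal (Bruinier–Li–Yang 2025, after (1.1)). [folklore] -/
theorem log_le_greenQ {t : ℝ} (ht : 1 < t) (ht2 : t ≤ 2) {s : ℕ} (hs : 1 ≤ s) :
    (4 ^ s : ℝ)⁻¹ * (Real.log 2 - Real.log (t ^ 2 - 1) / 2) ≤ greenQ s t := by
  set σ : ℝ := √(t ^ 2 - 1) with hσ
  have ht21 : 0 < t ^ 2 - 1 := by nlinarith
  have hσ0 : 0 < σ := Real.sqrt_pos.mpr ht21
  have hσ2 : σ ≤ 2 := by
    rw [hσ, Real.sqrt_le_left (by norm_num : (0:ℝ) ≤ 2)]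
    nlinarith
  set u₀ : ℝ := Real.log (2 / σ) with hu₀
  have hu₀0 : 0 ≤ u₀ := Real.log_nonneg (by rw [le_div_iff₀ hσ0]; linarith)
  have hexpu : Real.exp u₀ = 2 / σ := by rw [hu₀, Real.exp_log (by positivity)]
  have hexp : Real.exp (-u₀) = σ / 2 := by rw [Real.exp_neg, hexpu, inv_div]
  have hlog : u₀ = Real.log 2 - Real.log (t ^ 2 - 1) / 2 := by
    rw [hu₀, Real.log_div (by norm_num) hσ0.ne', hσ, Real.log_sqrt ht21.le]
  set f : ℝ → ℝ := fun u => ((t + √(t ^ 2 - 1) * Real.cosh u) ^ s)⁻¹ with hf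
  have hfi : IntegrableOn f (Ioi 0) := integrableOn_greenQ_integrand ht hs
  have hcosh : ∀ u ∈ Ioc (0:ℝ) u₀, √(t ^ 2 - 1) * Real.cosh u ≤ 2 := by
    intro u hu
    have hcu : Real.cosh u ≤ Real.cosh u₀ :=
      Real.cosh_le_cosh.mpr (by rw [abs_of_nonneg hu.1.le, abs_of_nonneg hu₀0]; exact hu.2)
    have hcu₀ : σ * Real.cosh u₀ = 1 + σ ^ 2 / 4 := by
      rw [Real.cosh_eq, hexp, hexpu]
      field_simp
      ring
    calc √(t ^ 2 - 1) * Real.cosh u = σ * Real.cosh u := by rw [hσ]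
      _ ≤ σ * Real.cosh u₀ := mul_le_mul_of_nonneg_left hcu hσ0.le
      _ = 1 + σ ^ 2 / 4 := hcu₀
      _ ≤ 2 := by nlinarith
  have hbase : ∀ u ∈ Ioc (0:ℝ) u₀, (4 ^ s : ℝ)⁻¹ ≤ f u := by
    intro u hu
    have hb0 := greenQ_base_pos (by linarith : (0:ℝ) < t) u
    exact inv_anti₀ (pow_pos hb0 s) (pow_le_pow_left₀ hb0.le (by linarith [hcosh u hu]) s)
  calc (4 ^ s : ℝ)⁻¹ * (Real.log 2 - Real.log (t ^ 2 - 1) / 2) = (4 ^ s : ℝ)⁻¹ * u₀ := by rw [hlog]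
    _ = ∫ _ in Ioc (0:ℝ) u₀, (4 ^ s : ℝ)⁻¹ := by
        rw [setIntegral_const, Real.volume_real_Ioc_of_le hu₀0, sub_zero, smul_eq_mul, mul_comm]
    _ ≤ ∫ u in Ioc (0:ℝ) u₀, f u :=
        setIntegral_mono_on (integrableOn_const (by simp [Real.volume_Ioc]))
          (hfi.mono_set Set.Ioc_subset_Ioi_self) measurableSet_Ioc hbase
    _ ≤ ∫ u in Ioi (0:ℝ), f u :=
        setIntegral_mono_set hfi (ae_of_all _ fun u => (greenQ_integrand_pos (by linarith) s u).le)
          Set.Ioc_subset_Ioi_self.eventuallyLE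
    _ = greenQ s t := rfl

open scoped _root_.Topology in
/-- `Q_{s-1}(t) → +∞` as `t → 1⁺` (`s ≥ 1`): the singularity of Heine's integral. [folklore] -/
theorem tendsto_greenQ_nhdsGT_one {s : ℕ} (hs : 1 ≤ s) : Tendsto (greenQ s) (𝓝[>] 1) atTop := by
  have h1 : Tendsto (fun t : ℝ => t ^ 2 - 1) (𝓝[>] (1:ℝ)) (𝓝[>] 0) := by
    refine tendsto_nhdsWithin_of_tendsto_nhds_of_eventually_within _ ?_ ?_
    · have hc : Tendsto (fun t : ℝ => t ^ 2 - 1) (𝓝 1) (𝓝 ((1:ℝ) ^ 2 - 1)) :=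
        ((continuous_pow 2).sub continuous_const).tendsto 1
      rw [one_pow, sub_self] at hc
      exact hc.mono_left nhdsWithin_le_nhds
    · filter_upwards [self_mem_nhdsWithin] with t ht
      simp only [Set.mem_Ioi] at ht ⊢
      nlinarith
  have hlog : Tendsto (fun t : ℝ => Real.log (t ^ 2 - 1)) (𝓝[>] 1) atBot :=
    Real.tendsto_log_nhdsGT_zero.comp h1
  have hneg : Tendsto (fun t : ℝ => -(Real.log (t ^ 2 - 1) / 2)) (𝓝[>] 1) atTop :=
    tendsto_neg_atBot_atTop.comp (hlog.atBot_div_const (by norm_num))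
  have hbound : Tendsto (fun t : ℝ => (4 ^ s : ℝ)⁻¹ * (Real.log 2 - Real.log (t ^ 2 - 1) / 2))
      (𝓝[>] 1) atTop := by
    refine Tendsto.const_mul_atTop (by positivity) ?_
    simpa only [sub_eq_add_neg] using tendsto_atTop_add_const_left _ (Real.log 2) hneg
  refine tendsto_atTop_mono' _ ?_ hbound
  filter_upwards [Ioo_mem_nhdsGT (show (1:ℝ) < 2 by norm_num)] with t ht
  exact log_le_greenQ ht.1 ht.2.le hs


/-! ## Vanishing at the cusp `∞`: `G_s^{Γ₀(N)}(z₁, w) → 0` as `Im w → ∞` -/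

/-- `t = 1 + |z₁ - w|²/(2 y₁ v)` in coordinates: `t = ((x₁ - u)² + y₁² + v²)/(2 y₁ v)`,
`w = u + iv`. [folklore] -/
theorem coshDistArg_eq (z₁ w : ℍ) :
    1 + dist (z₁ : ℂ) (w : ℂ) ^ 2 / (2 * z₁.im * w.im) =
      ((z₁.re - w.re) ^ 2 + z₁.im ^ 2 + w.im ^ 2) / (2 * z₁.im * w.im) := by
  have hy := z₁.im_pos
  have hv := w.im_pos
  have hdist : dist (z₁ : ℂ) (w : ℂ) ^ 2 = (z₁.re - w.re) ^ 2 + (z₁.im - w.im) ^ 2 := by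
    rw [Complex.dist_eq, Complex.sq_norm, Complex.normSq_apply, Complex.sub_re, Complex.sub_im,
      UpperHalfPlane.coe_re, UpperHalfPlane.coe_re, UpperHalfPlane.coe_im, UpperHalfPlane.coe_im]
    ring
  rw [hdist]
  field_simp
  ring

/-- `t^{-s} = (2 y₁ v)^s ((x₁ - u)² + y₁² + v²)^{-s}` exactly. [folklore] -/
theorem inv_pow_coshDistArg_eq (z₁ w : ℍ) (s : ℕ) :
    ((1 + dist (z₁ : ℂ) (w : ℂ) ^ 2 / (2 * z₁.im * w.im)) ^ s)⁻¹ =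
      (2 * z₁.im * w.im) ^ s * (((z₁.re - w.re) ^ 2 + z₁.im ^ 2 + w.im ^ 2) ^ s)⁻¹ := by
  rw [coshDistArg_eq, div_pow, inv_div, div_eq_mul_inv]

/-- Far from both `0` and `∞` in the ratio `v/y₁`, the argument `t` is at least `2`:
if `v ≥ 4 y₁` or `v ≤ y₁/4` then `t ≥ (y₁² + v²)/(2 y₁ v) ≥ 2`. [folklore] -/
theorem two_le_coshDistArg_of_im (z₁ w : ℍ) (h : 4 * z₁.im ≤ w.im ∨ 4 * w.im ≤ z₁.im) :
    2 ≤ 1 + dist (z₁ : ℂ) (w : ℂ) ^ 2 / (2 * z₁.im * w.im) := by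
  have hy := z₁.im_pos
  have hv := w.im_pos
  rw [coshDistArg_eq, le_div_iff₀ (by positivity)]
  rcases h with h | h <;> nlinarith [sq_nonneg (z₁.re - w.re), sq_nonneg (w.im - 4 * z₁.im),
    sq_nonneg (z₁.im - 4 * w.im)]

/-- `Σ_{c ∈ ℤ} 1/(c² + 1) ≤ 9` together with summability (the lattice-sum lemma with `s = 1`,
`B = 1`). [folklore] -/
theorem summable_tsum_inv_intSq_add_one :
    Summable (fun c : ℤ => ((c : ℝ) ^ 2 + 1)⁻¹) ∧ ∑' c : ℤ, ((c : ℝ) ^ 2 + 1)⁻¹ ≤ 9 := by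
  obtain ⟨hS, hT⟩ := summable_tsum_inv_intSub_sq_add_sq_pow one_pos (0 : ℝ) le_rfl
  simp only [sub_zero, one_pow, pow_one, mul_one] at hS hT
  refine ⟨hS, hT.trans ?_⟩
  norm_num


/-- **Cusp estimate.** For `s ≥ 2` and fixed `z₁` there is `K = K(z₁, s)` such that for every `w`
with `Im w ≥ max(1, Im z₁)`,
`Σ_{γ ∈ R_N^{(1)}} cosh d(z₁, γw)^{-s} ≤ K (Im w)^{1-s}`.
Refinement of the proof of `summable_inv_pow_coshDistArg` for `m = 1`, keeping the term `v_γ²`: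
the rows `c = 0` (where `d = ±1`, `v_γ = Im w`) contribute `O((Im w)^{1-s})` by the lattice-sum lemma
with `B = √(y₁² + Im(w)²)`, and a row `c ≠ 0` contributes `O(|c| Σ_d v_γ^s)`,
`v_γ = Im w/((cu + d)² + c² Im(w)²)`, which the lattice-sum lemma in `d` (`B = |c| Im w`) bounds by
`O(|c|^{2-2s} (Im w)^{1-s})`. [folklore] -/
theorem exists_tsum_inv_pow_coshDistArg_one_le (N : ℕ) {s : ℕ} (hs : 2 ≤ s) (z₁ : ℍ) :
    ∃ K : ℝ, ∀ w : ℍ, 1 ≤ w.im → z₁.im ≤ w.im →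
      ∑' γ : heckeMatrices N 1,
        ((1 + dist (z₁ : ℂ) ((intGL (γ : Matrix (Fin 2) (Fin 2) ℤ) • w : ℍ) : ℂ) ^ 2 /
          (2 * z₁.im * (intGL (γ : Matrix (Fin 2) (Fin 2) ℤ) • w).im)) ^ s)⁻¹ ≤
        K * (w.im / w.im ^ s) := by
  have hy : 0 < z₁.im := z₁.im_pos
  have hs1 : 1 ≤ s := by omega
  have hm : (0 : ℤ) < 1 := one_pos
  -- the constant
  set κ : ℝ := (6 * √(z₁.im ^ 2 + 1) + 3) / z₁.im ^ (2 * s) with hκ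
  have hκ0 : 0 ≤ κ := by positivity
  refine ⟨9 * ((30 + 18 * κ) * (2 * z₁.im) ^ s), fun w hw1 hwy => ?_⟩
  have hv : 0 < w.im := w.im_pos
  -- data attached to a bottom row `x = (c, d)`
  let V : (Fin 2 → ℤ) → ℝ := fun x => w.im / Complex.normSq ((x 0 : ℂ) * w + x 1)
  let q : (Fin 2 → ℤ) → ℤ := fun x => if x 0 = 0 then x 1 else x 0
  let β : (Fin 2 → ℤ) → ℝ := fun x =>
    if x 0 = 0 then z₁.re - ((1 : ℤ) : ℝ) * w.re / (x 1 : ℝ) ^ 2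
    else z₁.re + (((1 : ℤ) : ℂ) / ((x 0 : ℂ) * ((x 0 : ℂ) * w + x 1))).re
  let A : (Fin 2 → ℤ) → ℝ := fun x => √(z₁.im ^ 2 + V x ^ 2)
  let f : (Fin 2 → ℤ) → ℤ → ℝ := fun x e =>
    ((((e : ℝ) / (q x : ℝ) - β x) ^ 2 + A x ^ 2) ^ s)⁻¹
  let P : (Fin 2 → ℤ) → Prop := fun x => x = 0 ∨ (x 0 = 0 ∧ x 1 ≠ 1 ∧ x 1 ≠ -1)
  let G : (Fin 2 → ℤ) × ℤ → ℝ := fun p =>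
    if P p.1 then 0 else (2 * z₁.im * V p.1) ^ s * f p.1 p.2
  let key : heckeMatrices N 1 → (Fin 2 → ℤ) × ℤ := fun γ =>
    (![(γ : Matrix (Fin 2) (Fin 2) ℤ) 1 0, (γ : Matrix (Fin 2) (Fin 2) ℤ) 1 1],
      if (γ : Matrix (Fin 2) (Fin 2) ℤ) 1 0 = 0 then (γ : Matrix (Fin 2) (Fin 2) ℤ) 0 1
      else (γ : Matrix (Fin 2) (Fin 2) ℤ) 0 0)
  have hkey : Function.Injective key := by
    intro γ γ' h
    apply Subtype.ext
    simp only [key, Prod.mk.injEq] at h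
    obtain ⟨hrow, htop⟩ := h
    have hc := congrFun hrow 0
    have hd := congrFun hrow 1
    simp only [Matrix.cons_val_zero, Matrix.cons_val_one] at hc hd
    exact eq_of_mem_heckeMatrices_of_row_eq hm.ne' γ.2 γ'.2 hc hd htop
  -- elementary facts
  have hV0 : ∀ x, 0 ≤ V x := fun x => div_nonneg hv.le (Complex.normSq_nonneg _)
  have hA0 : ∀ x, 0 < A x := fun x => Real.sqrt_pos.mpr (by have := hV0 x; positivity)
  have hAy : ∀ x, z₁.im ≤ A x := fun x => by
    dsimp only [A]
    calc z₁.im = √(z₁.im ^ 2) := (Real.sqrt_sq hy.le).symm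
      _ ≤ √(z₁.im ^ 2 + V x ^ 2) := Real.sqrt_le_sqrt (by nlinarith [sq_nonneg (V x)])
  have hAV : ∀ x, V x ≤ A x := fun x => by
    dsimp only [A]
    calc V x = √(V x ^ 2) := (Real.sqrt_sq (hV0 x)).symm
      _ ≤ √(z₁.im ^ 2 + V x ^ 2) := Real.sqrt_le_sqrt (by nlinarith [sq_nonneg z₁.im])
  have hAsq : ∀ x, A x ^ 2 = z₁.im ^ 2 + V x ^ 2 := fun x =>
    Real.sq_sqrt (by have := hV0 x; positivity)
  have hG0 : ∀ p, 0 ≤ G p := by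
    intro p
    simp only [G]
    split_ifs
    · exact le_rfl
    · have := hV0 p.1
      positivity
  have hq : ∀ x : Fin 2 → ℤ, x ≠ 0 → q x ≠ 0 := by
    intro x hx h
    simp only [q] at h
    split_ifs at h with h0
    · exact hx (by ext i; fin_cases i <;> simp [h0, h])
    · exact h0 h
  -- inner sums over the top entry
  have hinner : ∀ x : Fin 2 → ℤ, x ≠ 0 →
      Summable (f x) ∧ ∑' e, f x e ≤ (6 * |(q x : ℝ)| * A x + 3) / A x ^ (2 * s) := by
    intro x hx
    have hqx : (q x : ℝ) ≠ 0 := by exact_mod_cast hq x hx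
    exact summable_tsum_inv_intDivSub_sq_add_sq_pow hqx (β x) (hA0 x) hs1
  -- row bounds
  let r : (Fin 2 → ℤ) → ℝ := fun x =>
    if P x then 0 else (2 * z₁.im * V x) ^ s * ((6 * |(q x : ℝ)| * A x + 3) / A x ^ (2 * s))
  have hr0 : ∀ x, 0 ≤ r x := by
    intro x
    simp only [r]
    split_ifs
    · exact le_rfl
    · have := hV0 x
      have := hA0 x
      positivity
  have hrow : ∀ x : Fin 2 → ℤ, ∑' e, G (x, e) ≤ r x := by
    intro x
    by_cases hx : P x
    · simp only [G, r, hx, if_true, tsum_zero, le_refl]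
    · simp only [G, r, hx, if_false]
      rw [tsum_mul_left]
      have hx0 : x ≠ 0 := fun h => hx (Or.inl h)
      have := hV0 x
      exact mul_le_mul_of_nonneg_left (hinner x hx0).2 (by positivity)
  have hGx : ∀ x, Summable fun e => G (x, e) := by
    intro x
    by_cases hx : P x
    · simp only [G, hx, if_true]
      exact summable_zero
    · simp only [G, hx, if_false]
      exact (hinner x (fun h => hx (Or.inl h))).1.mul_left _
  -- the row bounds are summable with total `≤ K v^{1-s}`: rows `c = 0`
  set L : ℝ := (30 + 18 * κ) * (2 * z₁.im) ^ s * (w.im / w.im ^ s) with hL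
  have hL0 : 0 ≤ L := by positivity
  let ρ : ℤ → ℝ := fun c => L * ((c : ℝ) ^ 2 + 1)⁻¹
  have hrow0 : ∀ d : ℤ, d = 1 ∨ d = -1 → r ![0, d] ≤ 15 * (2 * z₁.im) ^ s * (w.im / w.im ^ s) := by
    intro d hd
    have hP : ¬P ![0, d] := by
      rintro (h | ⟨-, h1, h2⟩)
      · have := congrFun h 1
        rcases hd with rfl | rfl <;> simp at this
      · simp at h1 h2
        rcases hd with rfl | rfl
        · exact h1 rfl
        · exact h2 rfl
    have hVd : V ![0, d] = w.im := by
      rcases hd with rfl | rfl <;> simp [V, Complex.normSq_apply]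
    have hqd : |(q ![0, d] : ℝ)| = 1 := by
      rcases hd with rfl | rfl <;> simp [q]
    simp only [r, hP, if_false, hqd, mul_one]
    have hAd := hAV ![0, d]
    have hAd' : A ![0, d] ≤ z₁.im + w.im := by
      dsimp only [A]
      rw [Real.sqrt_le_left (by positivity), hVd]
      nlinarith
    rw [hVd] at hAd
    have h6 : 6 * A ![0, d] + 3 ≤ 15 * w.im := by linarith
    have hpow : w.im ^ (2 * s) ≤ A ![0, d] ^ (2 * s) := pow_le_pow_left₀ hv.le hAd _
    calc (2 * z₁.im * V ![0, d]) ^ s * ((6 * A ![0, d] + 3) / A ![0, d] ^ (2 * s))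
        ≤ (2 * z₁.im * w.im) ^ s * (15 * w.im / w.im ^ (2 * s)) := by
          rw [hVd]
          gcongr (2 * z₁.im * w.im) ^ s * ?_
          calc (6 * A ![0, d] + 3) / A ![0, d] ^ (2 * s) ≤ 15 * w.im / A ![0, d] ^ (2 * s) := by
                gcongr
            _ ≤ 15 * w.im / w.im ^ (2 * s) := by
                apply div_le_div_of_nonneg_left (by positivity) (by positivity) hpow
      _ = 15 * (2 * z₁.im) ^ s * (w.im / w.im ^ s) := by
          rw [mul_pow, pow_mul, show (w.im ^ 2) ^ s = w.im ^ s * w.im ^ s by rw [← mul_pow, sq]]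
          field_simp
  -- rows `c ≠ 0`
  have hrowc : ∀ c : ℤ, c ≠ 0 →
      Summable (fun d : ℤ => r ![c, d]) ∧ ∑' d : ℤ, r ![c, d] ≤ ρ c := by
    intro c hc
    have hc1 : (1 : ℝ) ≤ |(c : ℝ)| := by
      rw [← Int.cast_abs]
      exact_mod_cast Int.one_le_abs hc
    have hcv : 0 < |(c : ℝ)| * w.im := by positivity
    -- the lattice sum in `d`
    obtain ⟨hSd, hTd⟩ := summable_tsum_inv_intSub_sq_add_sq_pow hcv (-((c : ℝ) * w.re)) hs1
    have hnormSq : ∀ d : ℤ, Complex.normSq ((c : ℂ) * w + d) =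
        ((d : ℝ) - -((c : ℝ) * w.re)) ^ 2 + (|(c : ℝ)| * w.im) ^ 2 := by
      intro d
      rw [Complex.normSq_apply, mul_pow, sq_abs]
      simp only [Complex.add_re, Complex.mul_re, Complex.intCast_re, Complex.intCast_im,
        UpperHalfPlane.coe_re, UpperHalfPlane.coe_im, zero_mul, sub_zero, Complex.add_im,
        Complex.mul_im, add_zero]
      ring
    have hnormSq_pos : ∀ d : ℤ, 0 < Complex.normSq ((c : ℂ) * w + d) := by
      intro d
      rw [hnormSq]
      positivity
    -- `V ≤ 1`, hence `A ≤ √(y₁² + 1)` and `(6|c|A + 3)/A^{2s} ≤ κ |c|`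
    have hV1 : ∀ d : ℤ, V ![c, d] ≤ 1 := by
      intro d
      simp only [V, Matrix.cons_val_zero, Matrix.cons_val_one]
      rw [div_le_one (hnormSq_pos d), hnormSq]
      have h2 : w.im ≤ (|(c : ℝ)| * w.im) ^ 2 := by
        calc w.im ≤ w.im ^ 2 := by nlinarith
          _ = (1 * w.im) ^ 2 := by ring
          _ ≤ (|(c : ℝ)| * w.im) ^ 2 := pow_le_pow_left₀ (by positivity) (by nlinarith) 2
      nlinarith [sq_nonneg ((d : ℝ) - -((c : ℝ) * w.re))]
    have hcoef : ∀ d : ℤ, (6 * |(q ![c, d] : ℝ)| * A ![c, d] + 3) / A ![c, d] ^ (2 * s) ≤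
        κ * |(c : ℝ)| := by
      intro d
      have hqc : q ![c, d] = c := by simp [q, hc]
      rw [hqc]
      have hA1 : A ![c, d] ≤ √(z₁.im ^ 2 + 1) := by
        dsimp only [A]
        exact Real.sqrt_le_sqrt (by nlinarith [hV1 d, hV0 ![c, d]])
      have hApow : z₁.im ^ (2 * s) ≤ A ![c, d] ^ (2 * s) :=
        pow_le_pow_left₀ hy.le (hAy _) _
      calc (6 * |(c : ℝ)| * A ![c, d] + 3) / A ![c, d] ^ (2 * s)
          ≤ (6 * |(c : ℝ)| * √(z₁.im ^ 2 + 1) + 3 * |(c : ℝ)|) / z₁.im ^ (2 * s) := by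
            have h3 : (3 : ℝ) ≤ 3 * |(c : ℝ)| := by nlinarith
            calc _ ≤ (6 * |(c : ℝ)| * √(z₁.im ^ 2 + 1) + 3 * |(c : ℝ)|) / A ![c, d] ^ (2 * s) := by
                  gcongr
              _ ≤ _ := div_le_div_of_nonneg_left (by positivity) (by positivity) hApow
        _ = κ * |(c : ℝ)| := by
            rw [hκ]
            field_simp
    -- compare `r ![c, d]` with `κ |c| (2 y₁)^s v^s / normSq^s`
    let g : ℤ → ℝ := fun d =>
      κ * |(c : ℝ)| * (2 * z₁.im) ^ s * w.im ^ s *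
        ((((d : ℝ) - -((c : ℝ) * w.re)) ^ 2 + (|(c : ℝ)| * w.im) ^ 2) ^ s)⁻¹
    have hrg : ∀ d : ℤ, r ![c, d] ≤ g d := by
      intro d
      simp only [r]
      split_ifs with hP
      · have := hV0 ![c, d]
        positivity
      · have hVeq : V ![c, d] = w.im * (Complex.normSq ((c : ℂ) * w + d))⁻¹ := by
          simp only [V, Matrix.cons_val_zero, Matrix.cons_val_one, div_eq_mul_inv]
        calc (2 * z₁.im * V ![c, d]) ^ s * ((6 * |(q ![c, d] : ℝ)| * A ![c, d] + 3) / A ![c, d] ^ (2 * s))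
            ≤ (2 * z₁.im * V ![c, d]) ^ s * (κ * |(c : ℝ)|) := by
              have := hV0 ![c, d]
              exact mul_le_mul_of_nonneg_left (hcoef d) (by positivity)
          _ = g d := by
              simp only [g]
              rw [hVeq, hnormSq]
              simp only [mul_pow, inv_pow]
              ring
    have hgsum : Summable g := hSd.mul_left _
    refine ⟨Summable.of_nonneg_of_le (fun d => hr0 _) hrg hgsum, ?_⟩
    calc ∑' d : ℤ, r ![c, d] ≤ ∑' d, g d :=
          (Summable.of_nonneg_of_le (fun d => hr0 _) hrg hgsum).tsum_le_tsum hrg hgsum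
      _ = κ * |(c : ℝ)| * (2 * z₁.im) ^ s * w.im ^ s *
            ∑' d : ℤ, ((((d : ℝ) - -((c : ℝ) * w.re)) ^ 2 + (|(c : ℝ)| * w.im) ^ 2) ^ s)⁻¹ := by
          simp only [g]
          rw [tsum_mul_left]
      _ ≤ κ * |(c : ℝ)| * (2 * z₁.im) ^ s * w.im ^ s *
            ((6 * (|(c : ℝ)| * w.im) + 3) / (|(c : ℝ)| * w.im) ^ (2 * s)) := by
          gcongr
      _ ≤ κ * |(c : ℝ)| * (2 * z₁.im) ^ s * w.im ^ s *
            ((9 * (|(c : ℝ)| * w.im)) / (|(c : ℝ)| * w.im) ^ (2 * s)) := by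
          gcongr
          nlinarith
      _ = 9 * κ * (2 * z₁.im) ^ s * (w.im / w.im ^ s) * (|(c : ℝ)| ^ 2 / |(c : ℝ)| ^ (2 * s)) := by
          have hws : w.im ^ (2 * s) = w.im ^ s * w.im ^ s := by rw [two_mul, pow_add]
          simp only [mul_pow]
          rw [hws]
          field_simp
      _ ≤ 9 * κ * (2 * z₁.im) ^ s * (w.im / w.im ^ s) * (2 * ((c : ℝ) ^ 2 + 1)⁻¹) := by
          gcongr
          -- `|c|² / |c|^{2s} ≤ 1/c² ≤ 2/(c² + 1)`
          have hc2 : (1 : ℝ) ≤ (c : ℝ) ^ 2 := by nlinarith [sq_abs (c : ℝ)]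
          have hpow : |(c : ℝ)| ^ (2 * s) = ((c : ℝ) ^ 2) ^ s := by rw [pow_mul, sq_abs]
          rw [hpow, sq_abs, div_le_iff₀ (by positivity)]
          have hs2 : ((c : ℝ) ^ 2) ^ 2 ≤ ((c : ℝ) ^ 2) ^ s := pow_le_pow_right₀ hc2 hs
          rw [show ((c : ℝ) ^ 2) ^ 2 = (c : ℝ) ^ 2 * (c : ℝ) ^ 2 by ring] at hs2
          have : (c : ℝ) ^ 2 * ((c : ℝ) ^ 2 + 1) ≤ 2 * ((c : ℝ) ^ 2 * (c : ℝ) ^ 2) := by nlinarith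
          calc (c : ℝ) ^ 2 = (c : ℝ) ^ 2 * ((c : ℝ) ^ 2 + 1) * ((c : ℝ) ^ 2 + 1)⁻¹ := by
                field_simp
            _ ≤ 2 * ((c : ℝ) ^ 2 * (c : ℝ) ^ 2) * ((c : ℝ) ^ 2 + 1)⁻¹ := by gcongr
            _ ≤ 2 * ((c : ℝ) ^ 2) ^ s * ((c : ℝ) ^ 2 + 1)⁻¹ := by gcongr
            _ = 2 * ((c : ℝ) ^ 2 + 1)⁻¹ * ((c : ℝ) ^ 2) ^ s := by ring
      _ ≤ ρ c := by
          simp only [ρ, hL]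
          have h18 : 9 * κ * (2 * z₁.im) ^ s * (w.im / w.im ^ s) * (2 * ((c : ℝ) ^ 2 + 1)⁻¹) =
              (18 * κ) * (2 * z₁.im) ^ s * (w.im / w.im ^ s) * ((c : ℝ) ^ 2 + 1)⁻¹ := by ring
          rw [h18]
          gcongr
          linarith
  -- the row `c = 0`: only `d = ±1` contribute
  have hr0d : ∀ d : ℤ, d ∉ ({1, -1} : Finset ℤ) → r ![0, d] = 0 := by
    intro d hd
    simp only [Finset.mem_insert, Finset.mem_singleton, not_or] at hd
    have hP : P ![0, d] := Or.inr ⟨by simp, by simpa using hd.1, by simpa using hd.2⟩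
    simp only [r, hP, if_true]
  have hsum0 : Summable (fun d : ℤ => r ![0, d]) := summable_of_ne_finset_zero hr0d
  have hX0 : 0 ≤ (2 * z₁.im) ^ s * (w.im / w.im ^ s) := by positivity
  have htsum0 : ∑' d : ℤ, r ![0, d] ≤ ρ 0 := by
    rw [tsum_eq_sum hr0d, Finset.sum_pair (by norm_num)]
    calc r ![0, 1] + r ![0, -1]
        ≤ 15 * (2 * z₁.im) ^ s * (w.im / w.im ^ s) + 15 * (2 * z₁.im) ^ s * (w.im / w.im ^ s) :=
          add_le_add (hrow0 1 (Or.inl rfl)) (hrow0 (-1) (Or.inr rfl))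
      _ ≤ ρ 0 := by
          simp only [ρ, hL, Int.cast_zero]
          norm_num
          nlinarith [mul_nonneg hκ0 hX0]
  have hcol : ∀ c : ℤ, Summable (fun d : ℤ => r ![c, d]) ∧ ∑' d, r ![c, d] ≤ ρ c := by
    intro c
    by_cases hc : c = 0
    · subst hc
      exact ⟨hsum0, htsum0⟩
    · exact hrowc c hc
  -- summability of the row bounds over `ℤ²` and the total `≤ 9 L`
  obtain ⟨hSc, hTc⟩ := summable_tsum_inv_intSq_add_one
  have hρsum : Summable ρ := hSc.mul_left L
  have hρtsum : ∑' c, ρ c ≤ 9 * L := by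
    simp only [ρ]
    rw [tsum_mul_left]
    nlinarith [hTc, hL0]
  have hcsum : Summable fun c : ℤ => ∑' d : ℤ, r ![c, d] :=
    Summable.of_nonneg_of_le (fun c => tsum_nonneg fun d => hr0 _) (fun c => (hcol c).2) hρsum
  have hrprod : Summable (fun p : ℤ × ℤ => r ![p.1, p.2]) :=
    (summable_prod_of_nonneg fun p => hr0 _).mpr ⟨fun c => (hcol c).1, hcsum⟩
  let e₂ : (Fin 2 → ℤ) ≃ ℤ × ℤ := finTwoArrowEquiv ℤ
  have hre : ∀ p : ℤ × ℤ, r (e₂.symm p) = r ![p.1, p.2] := fun p => rfl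
  have hrsum : Summable r :=
    (e₂.symm.summable_iff).mp (hrprod.congr fun p => (hre p).symm)
  have hrtsum : ∑' x, r x ≤ 9 * L := by
    calc ∑' x, r x = ∑' p : ℤ × ℤ, r (e₂.symm p) := (e₂.symm.tsum_eq r).symm
      _ = ∑' c : ℤ, ∑' d : ℤ, r ![c, d] := hrprod.tsum_prod
      _ ≤ ∑' c, ρ c := hcsum.tsum_le_tsum (fun c => (hcol c).2) hρsum
      _ ≤ 9 * L := hρtsum
  -- summability of `G`
  have hGout : Summable fun x : Fin 2 → ℤ => ∑' e, G (x, e) :=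
    Summable.of_nonneg_of_le (fun x => tsum_nonneg fun e => hG0 (x, e)) hrow hrsum
  have hGsum : Summable G := (summable_prod_of_nonneg fun p => hG0 p).mpr ⟨hGx, hGout⟩
  -- pointwise: `t_γ^{-s} = G (key γ)`
  have hle : ∀ γ : heckeMatrices N 1,
      ((1 + dist (z₁ : ℂ) ((intGL (γ : Matrix (Fin 2) (Fin 2) ℤ) • w : ℍ) : ℂ) ^ 2 /
        (2 * z₁.im * (intGL (γ : Matrix (Fin 2) (Fin 2) ℤ) • w).im)) ^ s)⁻¹ ≤ (G ∘ key) γ := by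
    rintro ⟨M, hM⟩
    set w' : ℍ := intGL M • w with hw'
    set x : Fin 2 → ℤ := ![M 1 0, M 1 1] with hx_def
    have hx0 : x 0 = M 1 0 := by simp [hx_def]
    have hx1 : x 1 = M 1 1 := by simp [hx_def]
    have hdet := det_ne_zero_of_mem_heckeMatrices hm.ne' hM
    have hPx : ¬P x := by
      rintro (h | ⟨h0, h1, h2⟩)
      · have hc0 : M 1 0 = 0 := by rw [← hx0, h]; rfl
        have hd0 : M 1 1 = 0 := by rw [← hx1, h]; rfl
        apply hdet
        rw [Matrix.det_fin_two, hc0, hd0, mul_zero, mul_zero, sub_zero]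
      · rw [hx0] at h0
        rw [hx1] at h1 h2
        have had := mul_eq_of_mem_heckeMatrices_of_eq_zero hM h0
        rcases Int.eq_one_or_neg_one_of_mul_eq_one' had with ⟨-, hd⟩ | ⟨-, hd⟩
        · exact h1 hd
        · exact h2 hd
    have hvx : w'.im = V x := by
      simp only [V, hw', hx0, hx1]
      rw [im_intGL_smul hm hM w, Int.cast_one, one_mul]
    have hu : (z₁.re - w'.re) ^ 2 =
        (((if M 1 0 = 0 then M 0 1 else M 0 0 : ℤ) : ℝ) / (q x : ℝ) - β x) ^ 2 := by
      simp only [q, β, hx0, hx1]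
      by_cases hc : M 1 0 = 0
      · simp only [hc, if_true]
        rw [hw', re_intGL_smul_of_eq_zero hm hM hc w]
        ring
      · simp only [hc, if_false]
        rw [hw', re_intGL_smul_of_ne_zero hm hM hc w]
        ring
    have heq : ((1 + dist (z₁ : ℂ) (w' : ℂ) ^ 2 / (2 * z₁.im * w'.im)) ^ s)⁻¹ = G (key ⟨M, hM⟩) := by
      rw [inv_pow_coshDistArg_eq]
      simp only [G, key, f]
      rw [if_neg hPx, hvx, hu, add_assoc, ← hAsq x]
    exact heq.le
  have h0 : ∀ γ : heckeMatrices N 1,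
      0 ≤ ((1 + dist (z₁ : ℂ) ((intGL (γ : Matrix (Fin 2) (Fin 2) ℤ) • w : ℍ) : ℂ) ^ 2 /
        (2 * z₁.im * (intGL (γ : Matrix (Fin 2) (Fin 2) ℤ) • w).im)) ^ s)⁻¹ := by
    intro γ
    have := one_le_coshDistArg z₁ (intGL (γ : Matrix (Fin 2) (Fin 2) ℤ) • w)
    positivity
  have hGkey : Summable (G ∘ key) := hGsum.comp_injective hkey
  -- conclusion
  calc ∑' γ : heckeMatrices N 1,
        ((1 + dist (z₁ : ℂ) ((intGL (γ : Matrix (Fin 2) (Fin 2) ℤ) • w : ℍ) : ℂ) ^ 2 /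
          (2 * z₁.im * (intGL (γ : Matrix (Fin 2) (Fin 2) ℤ) • w).im)) ^ s)⁻¹
      ≤ ∑' γ, (G ∘ key) γ := (Summable.of_nonneg_of_le h0 hle hGkey).tsum_le_tsum hle hGkey
    _ ≤ ∑' p, G p := tsum_comp_le_tsum_of_inj hGsum hG0 hkey
    _ = ∑' x, ∑' e, G (x, e) := hGsum.tsum_prod
    _ ≤ ∑' x, r x := hGout.tsum_le_tsum hrow hrsum
    _ ≤ 9 * L := hrtsum
    _ = 9 * ((30 + 18 * κ) * (2 * z₁.im) ^ s) * (w.im / w.im ^ s) := by rw [hL]; ring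


/-- `|c w + d|² = (c u + d)² + (c v)²` for `w = u + iv`. [folklore] -/
theorem normSq_intCast_mul_add_intCast (c d : ℤ) (w : ℍ) :
    Complex.normSq ((c : ℂ) * w + d) = ((c : ℝ) * w.re + d) ^ 2 + ((c : ℝ) * w.im) ^ 2 := by
  rw [Complex.normSq_apply]
  simp only [Complex.add_re, Complex.mul_re, Complex.intCast_re, Complex.intCast_im,
    UpperHalfPlane.coe_re, UpperHalfPlane.coe_im, zero_mul, sub_zero, Complex.add_im,
    Complex.mul_im, add_zero]
  ring

/-- For `γ ∈ R_N^{(1)}` and `Im w` large, `cosh d(z₁, γ w) ≥ 2`: either `γ` fixes `∞` and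
`Im(γw) = Im w ≥ 4 Im z₁`, or `Im(γw) = Im w/|cw + d|² ≤ 1/Im w ≤ Im z₁/4`. [folklore] -/
theorem two_le_coshDistArg_heckeMatrices_one {N : ℕ} (z₁ w : ℍ) (h4 : 4 * z₁.im ≤ w.im)
    (h4' : 4 / z₁.im ≤ w.im) {γ : Matrix (Fin 2) (Fin 2) ℤ} (hγ : γ ∈ heckeMatrices N 1) :
    2 ≤ 1 + dist (z₁ : ℂ) ((intGL γ • w : ℍ) : ℂ) ^ 2 / (2 * z₁.im * (intGL γ • w).im) := by
  have hy := z₁.im_pos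
  have hv := w.im_pos
  have hm : (0 : ℤ) < 1 := one_pos
  have him : (intGL γ • w).im = w.im / Complex.normSq ((γ 1 0 : ℂ) * w + γ 1 1) := by
    rw [im_intGL_smul hm hγ w, Int.cast_one, one_mul]
  apply two_le_coshDistArg_of_im
  by_cases hc : γ 1 0 = 0
  · left
    have had := mul_eq_of_mem_heckeMatrices_of_eq_zero hγ hc
    have hd : Complex.normSq ((γ 1 0 : ℂ) * w + γ 1 1) = 1 := by
      rw [normSq_intCast_mul_add_intCast, hc]
      rcases Int.eq_one_or_neg_one_of_mul_eq_one' had with ⟨-, hd⟩ | ⟨-, hd⟩ <;> simp [hd]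
    rw [him, hd, div_one]
    exact h4
  · right
    have hc1 : (1 : ℝ) ≤ ((γ 1 0 : ℤ) : ℝ) ^ 2 := by
      have h := Int.one_le_abs hc
      have h' : (1 : ℝ) ≤ |((γ 1 0 : ℤ) : ℝ)| := by rw [← Int.cast_abs]; exact_mod_cast h
      nlinarith [sq_abs ((γ 1 0 : ℤ) : ℝ)]
    have hns : w.im ^ 2 ≤ Complex.normSq ((γ 1 0 : ℂ) * w + γ 1 1) := by
      rw [normSq_intCast_mul_add_intCast]
      nlinarith [sq_nonneg (((γ 1 0 : ℤ) : ℝ) * w.re + (γ 1 1 : ℤ)), mul_pow (((γ 1 0 : ℤ) : ℝ)) w.im 2]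
    rw [him]
    have hns0 : 0 < Complex.normSq ((γ 1 0 : ℂ) * w + γ 1 1) := lt_of_lt_of_le (by positivity) hns
    have hle : w.im / Complex.normSq ((γ 1 0 : ℂ) * w + γ 1 1) ≤ 1 / w.im := by
      rw [div_le_div_iff₀ hns0 hv]
      nlinarith
    have h4'' : 4 * (1 / w.im) ≤ z₁.im := by
      rw [div_le_iff₀ hy] at h4'
      rw [mul_one_div, div_le_iff₀ hv]
      linarith
    linarith

open scoped _root_.Topology in
/-- **`G_s^{Γ₀(N)}(z₁, ·)` vanishes at the cusp `∞`** (Bruinier–Li–Yang 2025, after (1.1): "The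
function vanishes when one of the `z_i` approaches the cusps"; here the cusp `∞` in the second
variable, `s ≥ 2`): `G_s^{Γ₀(N)}(z₁, w) → 0` as `Im w → ∞`, indeed
`|G_s^{Γ₀(N)}(z₁, w)| ≤ C (Im w)^{1-s}` (`exists_tsum_inv_pow_coshDistArg_one_le` and
`Q_{s-1}(t) ≤ (4^s/s) t^{-s}` once all `cosh d(z₁, γw) ≥ 2`). By the symmetry `higherGreen_symm`
the same holds in the first variable. [cite: BruinierLiYang2025, (1.1)] -/
theorem tendsto_higherGreen_one_atImInfty (N : ℕ) {s : ℕ} (hs : 2 ≤ s) (z₁ : ℍ) :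
    Tendsto (fun w : ℍ => higherGreen N s 1 z₁ w) UpperHalfPlane.atImInfty (𝓝 0) := by
  have hy : 0 < z₁.im := z₁.im_pos
  have hs1 : 1 ≤ s := by omega
  obtain ⟨K, hK⟩ := exists_tsum_inv_pow_coshDistArg_one_le N hs z₁
  set V₀ : ℝ := max (max 1 z₁.im) (max (4 * z₁.im) (4 / z₁.im)) with hV₀
  have hbound : ∀ w : ℍ, V₀ ≤ w.im →
      ‖higherGreen N s 1 z₁ w‖ ≤ 2 * (4 ^ s / s) * (K * (w.im / w.im ^ s)) := by
    intro w hw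
    have hw1 : 1 ≤ w.im := le_trans (le_trans (le_max_left _ _) (le_max_left _ _)) hw
    have hwy : z₁.im ≤ w.im := le_trans (le_trans (le_max_right _ _) (le_max_left _ _)) hw
    have hw4 : 4 * z₁.im ≤ w.im := le_trans (le_trans (le_max_left _ _) (le_max_right _ _)) hw
    have hw4' : 4 / z₁.im ≤ w.im := le_trans (le_trans (le_max_right _ _) (le_max_right _ _)) hw
    set T : heckeMatrices N 1 → ℝ := fun γ =>
      1 + dist (z₁ : ℂ) ((intGL (γ : Matrix (Fin 2) (Fin 2) ℤ) • w : ℍ) : ℂ) ^ 2 /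
        (2 * z₁.im * (intGL (γ : Matrix (Fin 2) (Fin 2) ℤ) • w).im) with hT_def
    have hT1 : ∀ γ, 1 ≤ T γ := fun γ => one_le_coshDistArg z₁ _
    have hQ : ∀ γ, greenQ s (T γ) ≤ 4 ^ s / s * (T γ ^ s)⁻¹ := fun γ =>
      greenQ_le_of_two_le (two_le_coshDistArg_heckeMatrices_one z₁ w hw4 hw4' γ.2) hs1
    have hsumQ : Summable fun γ => greenQ s (T γ) := summable_greenQ_heckeMatrices one_pos hs z₁ w
    have hsumT : Summable fun γ => (T γ ^ s)⁻¹ := summable_inv_pow_coshDistArg one_pos hs z₁ w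
    have hG : higherGreen N s 1 z₁ w = -2 * ∑' γ, greenQ s (T γ) := rfl
    rw [hG, norm_mul, norm_neg, Real.norm_two,
      Real.norm_of_nonneg (tsum_nonneg fun γ => greenQ_nonneg (by linarith [hT1 γ]) s)]
    calc 2 * ∑' γ, greenQ s (T γ) ≤ 2 * ∑' γ, 4 ^ s / s * (T γ ^ s)⁻¹ :=
          mul_le_mul_of_nonneg_left (hsumQ.tsum_le_tsum hQ (hsumT.mul_left _)) (by norm_num)
      _ = 2 * (4 ^ s / s) * ∑' γ, (T γ ^ s)⁻¹ := by rw [tsum_mul_left]; ring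
      _ ≤ 2 * (4 ^ s / s) * (K * (w.im / w.im ^ s)) := by
          gcongr
          exact hK w hw1 hwy
  -- the bound tends to `0`
  have him : Tendsto (fun w : ℍ => w.im) UpperHalfPlane.atImInfty atTop := Filter.tendsto_comap
  have hdecay : Tendsto (fun w : ℍ => 2 * (4 ^ s / s) * (K * (w.im / w.im ^ s)))
      UpperHalfPlane.atImInfty (𝓝 0) := by
    have h1 : Tendsto (fun v : ℝ => v / v ^ s) atTop (𝓝 0) := by
      have h2 : Tendsto (fun v : ℝ => (v ^ (s - 1))⁻¹) atTop (𝓝 0) :=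
        tendsto_inv_atTop_zero.comp (tendsto_pow_atTop (by omega))
      refine h2.congr' ?_
      filter_upwards [eventually_gt_atTop 0] with v hv
      have hvs : v ^ s = v ^ (s - 1) * v := by rw [← pow_succ, Nat.sub_add_cancel hs1]
      rw [hvs]
      field_simp
    have h3 := (h1.comp him).const_mul K
    have h4 := h3.const_mul (2 * (4 ^ s / s : ℝ))
    simpa only [mul_zero, Function.comp_def] using h4
  refine squeeze_zero_norm' ?_ hdecay
  rw [UpperHalfPlane.atImInfty, Filter.eventually_comap]
  filter_upwards [eventually_ge_atTop V₀] with v hv w hwv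
  exact hbound w (hwv ▸ hv)


open Literature.NumberTheory.EllipticCurves.ModularForms (matrix_mul_right_cancel_of_det_ne_zero) in
open scoped _root_.Topology in
/-- **`G_s^{Γ₀(N)}(z₁, ·)` vanishes at every cusp**: for any `σ ∈ SL(2, ℤ)`,
`G_s^{Γ₀(N)}(z₁, σ w) → 0` as `Im w → ∞` (`s ≥ 2`). The sum over `Γ₀(N)` at `σw` is the sum over the
coset `Γ₀(N)σ ⊆ SL(2, ℤ)`, which is dominated termwise by the full sum over `R_1^{(1)} = SL(2, ℤ)`
(`exists_tsum_inv_pow_coshDistArg_one_le` with `N = 1`). The cusps of `X₀(N)` are the `σ∞`, so this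
is "the function vanishes when one of the `z_i` approaches the cusps" (Bruinier–Li–Yang 2025, after
(1.1)) in the second variable; the first follows by `higherGreen_symm`. [cite: BruinierLiYang2025, (1.1)] -/
theorem tendsto_higherGreen_one_sl_smul_atImInfty (N : ℕ) {s : ℕ} (hs : 2 ≤ s) (z₁ : ℍ)
    (σ : SL(2, ℤ)) :
    Tendsto (fun w : ℍ => higherGreen N s 1 z₁ (σ • w)) UpperHalfPlane.atImInfty (𝓝 0) := by
  have hy : 0 < z₁.im := z₁.im_pos
  have hs1 : 1 ≤ s := by omega
  have hσdet : (σ : Matrix (Fin 2) (Fin 2) ℤ).det ≠ 0 := by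
    rw [Matrix.SpecialLinearGroup.det_coe]
    exact one_ne_zero
  obtain ⟨K, hK⟩ := exists_tsum_inv_pow_coshDistArg_one_le 1 hs z₁
  -- the coset map `γ ↦ γσ` into `R_1^{(1)}`
  have hmem : ∀ γ : heckeMatrices N 1,
      (γ : Matrix (Fin 2) (Fin 2) ℤ) * (σ : Matrix (Fin 2) (Fin 2) ℤ) ∈ heckeMatrices 1 1 := by
    intro γ
    rw [mem_heckeMatrices, Matrix.det_mul, (mem_heckeMatrices.mp γ.2).1,
      Matrix.SpecialLinearGroup.det_coe, mul_one]
    exact ⟨rfl, by simp⟩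
  let ι : heckeMatrices N 1 → heckeMatrices 1 1 := fun γ => ⟨_, hmem γ⟩
  have hι : Function.Injective ι := by
    intro γ γ' h
    exact Subtype.ext (matrix_mul_right_cancel_of_det_ne_zero hσdet (congrArg Subtype.val h))
  have hact : ∀ (γ : heckeMatrices N 1) (w : ℍ),
      intGL (γ : Matrix (Fin 2) (Fin 2) ℤ) • σ • w =
        intGL ((ι γ : heckeMatrices 1 1) : Matrix (Fin 2) (Fin 2) ℤ) • w := by
    intro γ w
    show intGL (γ : Matrix (Fin 2) (Fin 2) ℤ) • σ • w =
      intGL ((γ : Matrix (Fin 2) (Fin 2) ℤ) * (σ : Matrix (Fin 2) (Fin 2) ℤ)) • w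
    rw [intGL_mul (det_ne_zero_of_mem_heckeMatrices one_ne_zero γ.2) hσdet, mul_smul,
      sl_smul_eq_intGL_smul]
  set V₀ : ℝ := max (max 1 z₁.im) (max (4 * z₁.im) (4 / z₁.im)) with hV₀
  have hbound : ∀ w : ℍ, V₀ ≤ w.im →
      ‖higherGreen N s 1 z₁ (σ • w)‖ ≤ 2 * (4 ^ s / s) * (K * (w.im / w.im ^ s)) := by
    intro w hw
    have hw1 : 1 ≤ w.im := le_trans (le_trans (le_max_left _ _) (le_max_left _ _)) hw
    have hwy : z₁.im ≤ w.im := le_trans (le_trans (le_max_right _ _) (le_max_left _ _)) hw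
    have hw4 : 4 * z₁.im ≤ w.im := le_trans (le_trans (le_max_left _ _) (le_max_right _ _)) hw
    have hw4' : 4 / z₁.im ≤ w.im := le_trans (le_trans (le_max_right _ _) (le_max_right _ _)) hw
    -- the summand over the full `R_1^{(1)}` at `w`
    set T : heckeMatrices 1 1 → ℝ := fun δ =>
      1 + dist (z₁ : ℂ) ((intGL (δ : Matrix (Fin 2) (Fin 2) ℤ) • w : ℍ) : ℂ) ^ 2 /
        (2 * z₁.im * (intGL (δ : Matrix (Fin 2) (Fin 2) ℤ) • w).im) with hT_def
    have hT1 : ∀ δ, 1 ≤ T δ := fun δ => one_le_coshDistArg z₁ _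
    have hT0 : ∀ δ, 0 ≤ (T δ ^ s)⁻¹ := fun δ => by have := hT1 δ; positivity
    have hsumT : Summable fun δ => (T δ ^ s)⁻¹ := summable_inv_pow_coshDistArg one_pos hs z₁ w
    have hQ : ∀ γ : heckeMatrices N 1, greenQ s (T (ι γ)) ≤ 4 ^ s / s * (T (ι γ) ^ s)⁻¹ := fun γ =>
      greenQ_le_of_two_le (two_le_coshDistArg_heckeMatrices_one z₁ w hw4 hw4' (ι γ).2) hs1
    have hsumQ : Summable fun γ : heckeMatrices N 1 => greenQ s (T (ι γ)) := by
      have h := summable_greenQ_heckeMatrices (N := N) one_pos hs z₁ (σ • w)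
      refine h.congr fun γ => ?_
      simp only [hT_def, hact γ w]
    have hG : higherGreen N s 1 z₁ (σ • w) = -2 * ∑' γ : heckeMatrices N 1, greenQ s (T (ι γ)) := by
      unfold higherGreen
      congr 1
      exact tsum_congr fun γ => by simp only [hT_def, hact γ w]
    rw [hG, norm_mul, norm_neg, Real.norm_two,
      Real.norm_of_nonneg (tsum_nonneg fun γ => greenQ_nonneg (by linarith [hT1 (ι γ)]) s)]
    have hsumTι : Summable fun γ : heckeMatrices N 1 => (T (ι γ) ^ s)⁻¹ := hsumT.comp_injective hι
    calc 2 * ∑' γ : heckeMatrices N 1, greenQ s (T (ι γ))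
        ≤ 2 * ∑' γ : heckeMatrices N 1, 4 ^ s / s * (T (ι γ) ^ s)⁻¹ :=
          mul_le_mul_of_nonneg_left (hsumQ.tsum_le_tsum hQ (hsumTι.mul_left _)) (by norm_num)
      _ = 2 * (4 ^ s / s) * ∑' γ : heckeMatrices N 1, (T (ι γ) ^ s)⁻¹ := by rw [tsum_mul_left]; ring
      _ ≤ 2 * (4 ^ s / s) * ∑' δ : heckeMatrices 1 1, (T δ ^ s)⁻¹ := by
          gcongr
          exact tsum_comp_le_tsum_of_inj hsumT hT0 hι
      _ ≤ 2 * (4 ^ s / s) * (K * (w.im / w.im ^ s)) := by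
          gcongr
          exact hK w hw1 hwy
  have him : Tendsto (fun w : ℍ => w.im) UpperHalfPlane.atImInfty atTop := Filter.tendsto_comap
  have hdecay : Tendsto (fun w : ℍ => 2 * (4 ^ s / s) * (K * (w.im / w.im ^ s)))
      UpperHalfPlane.atImInfty (𝓝 0) := by
    have h1 : Tendsto (fun v : ℝ => v / v ^ s) atTop (𝓝 0) := by
      have h2 : Tendsto (fun v : ℝ => (v ^ (s - 1))⁻¹) atTop (𝓝 0) :=
        tendsto_inv_atTop_zero.comp (tendsto_pow_atTop (by omega))
      refine h2.congr' ?_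
      filter_upwards [eventually_gt_atTop 0] with v hv
      have hvs : v ^ s = v ^ (s - 1) * v := by rw [← pow_succ, Nat.sub_add_cancel hs1]
      rw [hvs]
      field_simp
    have h3 := (h1.comp him).const_mul K
    have h4 := h3.const_mul (2 * (4 ^ s / s : ℝ))
    simpa only [mul_zero, Function.comp_def] using h4
  refine squeeze_zero_norm' ?_ hdecay
  rw [UpperHalfPlane.atImInfty, Filter.eventually_comap]
  filter_upwards [eventually_ge_atTop V₀] with v hv w hwv
  exact hbound w (hwv ▸ hv)

open scoped _root_.Topology in
/-- The upper triangular Hecke representative `(a b; 0 d)`, `a, d > 0`, maps the cusp `∞` to itself: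
`Im((aw + b)/d) = (a/d) Im w → ∞` with `Im w`. [folklore] -/
theorem tendsto_intGL_upper_smul_atImInfty {a b d : ℤ} (ha : 0 < a) (hd : 0 < d) :
    Tendsto (fun w : ℍ => intGL !![a, b; 0, d] • w) UpperHalfPlane.atImInfty
      UpperHalfPlane.atImInfty := by
  have hmem : !![a, b; 0, d] ∈ heckeMatrices 1 (a * d) := by
    rw [mem_heckeMatrices, Matrix.det_fin_two_of]
    exact ⟨by ring, by simp⟩
  have him : ∀ w : ℍ, (intGL !![a, b; 0, d] • w).im = (a : ℝ) / d * w.im := by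
    intro w
    rw [im_intGL_smul (mul_pos ha hd) hmem w]
    simp only [Matrix.of_apply, Matrix.cons_val', Matrix.cons_val_zero, Matrix.cons_val_one,
      Matrix.cons_val_fin_one, Int.cast_zero, zero_mul, zero_add, Complex.normSq_intCast]
    have hd' : (d : ℝ) ≠ 0 := by exact_mod_cast hd.ne'
    push_cast
    field_simp
  simp only [UpperHalfPlane.atImInfty, Filter.tendsto_comap_iff, Function.comp_def, him]
  exact (Filter.tendsto_comap.const_mul_atTop (by positivity))

open scoped _root_.Topology in
/-- **`G_s^{Γ₀(N), m}(z₁, ·)` vanishes at the cusp `∞`** for `gcd(m, N) = 1`, `s ≥ 2`: by the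
classical `T_m`-formula (`higherGreen_eq_sum_divisorsAntidiagonal`) it is a finite sum of
`G_s^{Γ₀(N)}(z₁, (aw + b)/d)`, each of which tends to `0` (`tendsto_higherGreen_one_atImInfty`,
`tendsto_intGL_upper_smul_atImInfty`). [cite: BruinierLiYang2025, (1.1)–(1.2)] -/
theorem tendsto_higherGreen_atImInfty {N m : ℕ} (hm : 0 < m) (hmN : Nat.Coprime m N) {s : ℕ}
    (hs : 2 ≤ s) (z₁ : ℍ) :
    Tendsto (fun w : ℍ => higherGreen N s m z₁ w) UpperHalfPlane.atImInfty (𝓝 0) := by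
  have hfun : (fun w : ℍ => higherGreen N s m z₁ w) = fun w =>
      ∑ x ∈ Nat.divisorsAntidiagonal m, ∑ b ∈ Finset.range x.2,
        higherGreen N s 1 z₁ (intGL !![(x.1 : ℤ), (b : ℤ); 0, (x.2 : ℤ)] • w) :=
    funext fun w => higherGreen_eq_sum_divisorsAntidiagonal hm hmN hs z₁ w
  rw [hfun, show (0 : ℝ) = ∑ x ∈ Nat.divisorsAntidiagonal m, ∑ b ∈ Finset.range x.2, (0 : ℝ) by simp]
  refine tendsto_finsetSum _ fun x hx => tendsto_finsetSum _ fun b _ => ?_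
  rw [Nat.mem_divisorsAntidiagonal] at hx
  have ha : 0 < (x.1 : ℤ) := by
    have : x.1 ≠ 0 := fun h0 => hm.ne' (by rw [← hx.1, h0, zero_mul])
    exact_mod_cast Nat.pos_of_ne_zero this
  have hd : 0 < (x.2 : ℤ) := by
    have : x.2 ≠ 0 := fun h0 => hm.ne' (by rw [← hx.1, h0, mul_zero])
    exact_mod_cast Nat.pos_of_ne_zero this
  exact (tendsto_higherGreen_one_atImInfty N hs z₁).comp (tendsto_intGL_upper_smul_atImInfty ha hd)


/-! ## Continuity: `t ↦ Q_{s-1}(t)` on `(1, ∞)` and `w ↦ G_s^{Γ₀(N), m}(z₁, w)` off `T_m` -/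

open scoped _root_.Topology in
/-- **`Q_{s-1}` is continuous on `(1, ∞)`** (`s ≥ 1`): dominated convergence for Heine's integral,
with the dominating function `(2/√(t₁² - 1))^s e^{-su}`, `t₁ = (1 + t₀)/2`, near `t₀ > 1`. [folklore] -/
theorem continuousAt_greenQ {t₀ : ℝ} (ht₀ : 1 < t₀) {s : ℕ} (hs : 1 ≤ s) :
    ContinuousAt (greenQ s) t₀ := by
  set t₁ : ℝ := (1 + t₀) / 2 with ht₁
  have ht₁1 : 1 < t₁ := by rw [ht₁]; linarith
  have ht₁0 : t₁ < t₀ := by rw [ht₁]; linarith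
  have hs' : -(s : ℝ) < 0 := by
    have : (1 : ℝ) ≤ s := by exact_mod_cast hs
    linarith
  have hev : ∀ᶠ t in 𝓝 t₀, t₁ < t := lt_mem_nhds ht₁0
  refine MeasureTheory.continuousAt_of_dominated (μ := volume.restrict (Ioi (0:ℝ)))
    (F := fun t u => ((t + √(t ^ 2 - 1) * Real.cosh u) ^ s)⁻¹)
    (bound := fun u => (2 / √(t₁ ^ 2 - 1)) ^ s * Real.exp (-(s : ℝ) * u)) ?_ ?_ ?_ ?_
  · filter_upwards [hev] with t ht
    exact (continuous_greenQ_integrand (by linarith) s).aestronglyMeasurable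
  · filter_upwards [hev] with t ht
    refine ae_of_all _ fun u => ?_
    rw [Real.norm_of_nonneg (greenQ_integrand_pos (by linarith) s u).le]
    -- monotonicity in `t`, then the exponential bound at `t₁`
    have hb1 : 0 < t₁ + √(t₁ ^ 2 - 1) * Real.cosh u := greenQ_base_pos (by linarith) u
    have hmono : t₁ + √(t₁ ^ 2 - 1) * Real.cosh u ≤ t + √(t ^ 2 - 1) * Real.cosh u :=
      add_le_add ht.le (mul_le_mul_of_nonneg_right (Real.sqrt_le_sqrt (by nlinarith))
        (Real.cosh_pos u).le)
    exact (inv_anti₀ (pow_pos hb1 s) (pow_le_pow_left₀ hb1.le hmono s)).trans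
      (greenQ_integrand_le ht₁1 s u)
  · exact (integrableOn_exp_mul_Ioi hs' 0).const_mul _
  · refine ae_of_all _ fun u => ?_
    have hcont : ContinuousAt (fun t : ℝ => t + √(t ^ 2 - 1) * Real.cosh u) t₀ := by fun_prop
    exact ((hcont.pow s).inv₀ (pow_pos (greenQ_base_pos (by linarith) u) s).ne')

open scoped _root_.Topology in
/-- `Q_{s-1}` is continuous on `(1, ∞)`. [folklore] -/
theorem continuousOn_greenQ {s : ℕ} (hs : 1 ≤ s) : ContinuousOn (greenQ s) (Ioi 1) :=
  fun _ ht => (continuousAt_greenQ ht hs).continuousWithinAt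

/-- `cosh a ≤ e^{δ} cosh b` whenever `|a - b| ≤ δ`. [folklore] -/
theorem cosh_le_exp_mul_cosh {a b δ : ℝ} (h : |a - b| ≤ δ) : Real.cosh a ≤ Real.exp δ * Real.cosh b := by
  have hδ : 0 ≤ δ := (abs_nonneg _).trans h
  have h1 : |a| ≤ |b| + δ := by
    have := abs_sub_abs_le_abs_sub a b
    linarith
  calc Real.cosh a = Real.cosh |a| := (Real.cosh_abs a).symm
    _ ≤ Real.cosh (|b| + δ) :=
        Real.cosh_le_cosh.mpr (by rw [abs_abs, abs_of_nonneg (add_nonneg (abs_nonneg b) hδ)]; exact h1)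
    _ = Real.cosh |b| * Real.cosh δ + Real.sinh |b| * Real.sinh δ := Real.cosh_add _ _
    _ ≤ Real.cosh |b| * Real.cosh δ + Real.cosh |b| * Real.sinh δ := by
        have hsδ : 0 ≤ Real.sinh δ := Real.sinh_nonneg_iff.mpr hδ
        have hsc : Real.sinh |b| ≤ Real.cosh |b| := (Real.sinh_lt_cosh _).le
        nlinarith
    _ = Real.exp δ * Real.cosh b := by
        rw [Real.cosh_abs, ← mul_add, Real.cosh_add_sinh, mul_comm]

/-- **Local comparison of the kernel under a change of `w`.** For `γ ∈ R_N^{(m)}`, `m > 0`: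
`cosh d(z₁, γ w₀) ≤ e^{d(w, w₀)} cosh d(z₁, γ w)`, because `γ` acts isometrically
(`|d(z₁, γw) - d(z₁, γw₀)| ≤ d(γw, γw₀) = d(w, w₀)`). [folklore] -/
theorem coshDistArg_le_exp_mul {N : ℕ} {m : ℤ} (hm : 0 < m) {γ : Matrix (Fin 2) (Fin 2) ℤ}
    (hγ : γ ∈ heckeMatrices N m) (z₁ w w₀ : ℍ) :
    1 + dist (z₁ : ℂ) ((intGL γ • w₀ : ℍ) : ℂ) ^ 2 / (2 * z₁.im * (intGL γ • w₀).im) ≤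
      Real.exp (dist w w₀) *
        (1 + dist (z₁ : ℂ) ((intGL γ • w : ℍ) : ℂ) ^ 2 / (2 * z₁.im * (intGL γ • w).im)) := by
  rw [one_add_dist_sq_div_eq_cosh_dist, one_add_dist_sq_div_eq_cosh_dist]
  apply cosh_le_exp_mul_cosh
  have hpos : 0 < ((intGL γ).det : ℝ) := by
    rw [val_det_intGL (det_ne_zero_of_mem_heckeMatrices hm.ne' hγ), (mem_heckeMatrices.mp hγ).1]
    exact_mod_cast hm
  calc |dist z₁ (intGL γ • w₀) - dist z₁ (intGL γ • w)|
      ≤ dist (intGL γ • w₀) (intGL γ • w) := by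
        rw [dist_comm z₁, dist_comm z₁]
        exact abs_dist_sub_le _ _ _
    _ = dist w₀ w := dist_smul_smul_of_det_pos hpos w₀ w
    _ = dist w w₀ := dist_comm _ _

/-- The argument `t_γ(w) = 1 + |z₁ - γw|²/(2 Im z₁ Im γw)` is continuous in `w`. [folklore] -/
theorem continuous_coshDistArg (z₁ : ℍ) (g : GL (Fin 2) ℝ) :
    Continuous fun w : ℍ => 1 + dist (z₁ : ℂ) ((g • w : ℍ) : ℂ) ^ 2 / (2 * z₁.im * (g • w).im) := by
  have hsm : Continuous fun w : ℍ => g • w := continuous_const_smul g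
  refine continuous_const.add (Continuous.div ?_ ?_ fun w => ?_)
  · exact (continuous_const.dist (UpperHalfPlane.continuous_coe.comp hsm)).pow 2
  · exact continuous_const.mul (UpperHalfPlane.continuous_im.comp hsm)
  · have := (g • w).im_pos
    have := z₁.im_pos
    positivity

open scoped _root_.Topology in
/-- **`G_s^{Γ₀(N), m}(z₁, ·)` is continuous off the Hecke correspondence.** For `m ≥ 1`, `s ≥ 2`
and `(z₁, w₀) ∉ T_m`, `w ↦ G_s^{Γ₀(N), m}(z₁, w)` is continuous at `w₀`. The series converges
locally uniformly: on the hyperbolic unit ball around `w₀`, `cosh d(z₁, γ w₀) ≤ e · cosh d(z₁, γ w)`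
(`coshDistArg_le_exp_mul`), so the finitely many `γ` with `cosh d(z₁, γw₀) ≤ 2e` are controlled
by the continuity and monotonicity of `Q_{s-1}` near `cosh d(z₁, γw₀) > 1`, and all the others by
the summable majorant `(4^s/s) e^s cosh d(z₁, γw₀)^{-s}` (Weierstrass `M`-test, `continuousOn_tsum`).
[cite: BruinierLiYang2025, (1.1)–(1.2)] -/
theorem continuousAt_higherGreen {N : ℕ} {m : ℤ} (hm : 0 < m) {s : ℕ} (hs : 2 ≤ s) (z₁ : ℍ)
    {w₀ : ℍ} (h : ¬ OnHeckeCorrespondence N m z₁ w₀) :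
    ContinuousAt (fun w : ℍ => higherGreen N s m z₁ w) w₀ := by
  have hy : 0 < z₁.im := z₁.im_pos
  have hs1 : 1 ≤ s := by omega
  set T : heckeMatrices N m → ℍ → ℝ := fun γ w =>
    1 + dist (z₁ : ℂ) ((intGL (γ : Matrix (Fin 2) (Fin 2) ℤ) • w : ℍ) : ℂ) ^ 2 /
      (2 * z₁.im * (intGL (γ : Matrix (Fin 2) (Fin 2) ℤ) • w).im) with hT_def
  have hT1 : ∀ γ w, 1 ≤ T γ w := fun γ w => one_le_coshDistArg z₁ _
  have hTcont : ∀ γ, Continuous (T γ) := fun γ => continuous_coshDistArg z₁ _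
  -- at `w₀` every term is off the singularity
  have hT0 : ∀ γ, 1 < T γ w₀ := by
    intro γ
    have hne : (z₁ : ℂ) ≠ ((intGL (γ : Matrix (Fin 2) (Fin 2) ℤ) • w₀ : ℍ) : ℂ) := fun heq =>
      h ⟨γ, γ.2, (UpperHalfPlane.ext heq).symm⟩
    have hd := dist_pos.mpr hne
    have hv := (intGL (γ : Matrix (Fin 2) (Fin 2) ℤ) • w₀).im_pos
    have : 0 < dist (z₁ : ℂ) ((intGL (γ : Matrix (Fin 2) (Fin 2) ℤ) • w₀ : ℍ) : ℂ) ^ 2 /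
        (2 * z₁.im * (intGL (γ : Matrix (Fin 2) (Fin 2) ℤ) • w₀).im) := by positivity
    show 1 < 1 + _
    linarith
  -- local comparison on the hyperbolic unit ball
  have hcmp : ∀ γ w, dist w w₀ < 1 → T γ w₀ ≤ Real.exp 1 * T γ w := by
    intro γ w hw
    calc T γ w₀ ≤ Real.exp (dist w w₀) * T γ w := coshDistArg_le_exp_mul hm γ.2 z₁ w w₀
      _ ≤ Real.exp 1 * T γ w :=
          mul_le_mul_of_nonneg_right (Real.exp_le_exp.mpr hw.le) (by linarith [hT1 γ w])
  -- the finite set of `γ` close to the singularity at `w₀`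
  have hsum0 : Summable fun γ => (T γ w₀ ^ s)⁻¹ := summable_inv_pow_coshDistArg hm hs z₁ w₀
  have hfin : {γ : heckeMatrices N m | T γ w₀ ≤ 2 * Real.exp 1}.Finite := by
    have hpos : (0 : ℝ) < ((2 * Real.exp 1) ^ s)⁻¹ := by positivity
    have hev := hsum0.tendsto_cofinite_zero.eventually (gt_mem_nhds hpos)
    refine (Filter.eventually_cofinite.mp hev).subset fun γ hγ => ?_
    simp only [Set.mem_setOf_eq, not_lt] at hγ ⊢
    exact inv_anti₀ (by have := hT1 γ w₀; positivity)
      (pow_le_pow_left₀ (by linarith [hT1 γ w₀]) hγ s)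
  set S₀ := hfin.toFinset with hS₀
  have hmemS₀ : ∀ γ, γ ∈ S₀ ↔ T γ w₀ ≤ 2 * Real.exp 1 := fun γ => by
    rw [hS₀, Set.Finite.mem_toFinset, Set.mem_setOf_eq]
  let τ : heckeMatrices N m → ℝ := fun γ => (1 + T γ w₀) / 2
  have hτ1 : ∀ γ, 1 < τ γ := fun γ => by simp only [τ]; linarith [hT0 γ]
  have hτT : ∀ γ, τ γ < T γ w₀ := fun γ => by simp only [τ]; linarith [hT0 γ]
  -- the neighbourhood `U`
  set U : Set ℍ := {w | dist w w₀ < 1 ∧ ∀ γ ∈ S₀, τ γ < T γ w} with hU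
  have hUmem : U ∈ 𝓝 w₀ := by
    have h2 : ∀ᶠ w in 𝓝 w₀, ∀ γ ∈ S₀, τ γ < T γ w :=
      (Filter.eventually_all_finset S₀).mpr fun γ _ =>
        continuousAt_const.eventually_lt (hTcont γ).continuousAt (hτT γ)
    filter_upwards [Metric.ball_mem_nhds w₀ one_pos, h2] with w hw1 hw2
    exact ⟨Metric.mem_ball.mp hw1, hw2⟩
  -- on `U`: terms with `γ ∉ S₀` have `T γ w > 2`, terms with `γ ∈ S₀` have `T γ w > τ γ > 1`
  have hfar : ∀ γ, γ ∉ S₀ → ∀ w ∈ U,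
      2 < T γ w ∧ (T γ w ^ s)⁻¹ ≤ Real.exp 1 ^ s * (T γ w₀ ^ s)⁻¹ := by
    intro γ hγ w hw
    rw [hmemS₀, not_le] at hγ
    have hc := hcmp γ w hw.1
    have he : 0 < Real.exp 1 := Real.exp_pos 1
    refine ⟨?_, ?_⟩
    · by_contra hle
      simp only [not_lt] at hle
      nlinarith
    · have hTw : 0 < T γ w := by linarith [hT1 γ w]
      have h1 : T γ w₀ ^ s ≤ Real.exp 1 ^ s * T γ w ^ s := by
        rw [← mul_pow]
        exact pow_le_pow_left₀ (by linarith [hT1 γ w₀]) hc s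
      have hes : 0 < Real.exp 1 ^ s := pow_pos he s
      calc (T γ w ^ s)⁻¹ = Real.exp 1 ^ s * (Real.exp 1 ^ s * T γ w ^ s)⁻¹ := by
            field_simp
        _ ≤ Real.exp 1 ^ s * (T γ w₀ ^ s)⁻¹ :=
            mul_le_mul_of_nonneg_left (inv_anti₀ (by have := hT1 γ w₀; positivity) h1) hes.le
  -- the summable majorant
  let v : heckeMatrices N m → ℝ := fun γ =>
    (S₀ : Set (heckeMatrices N m)).indicator (fun γ => greenQ s (τ γ)) γ +
      4 ^ s / s * Real.exp 1 ^ s * (T γ w₀ ^ s)⁻¹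
  have hv : Summable v := by
    refine Summable.add ?_ ?_
    · refine summable_of_ne_finset_zero (s := S₀) fun γ hγ => ?_
      exact Set.indicator_of_notMem (by simpa using hγ) _
    · simpa only [mul_assoc] using (hsum0.mul_left (4 ^ s / s * Real.exp 1 ^ s))
  have hbound : ∀ γ (w : ℍ), w ∈ U → ‖greenQ s (T γ w)‖ ≤ v γ := by
    intro γ w hw
    rw [Real.norm_of_nonneg (greenQ_nonneg (by linarith [hT1 γ w]) s)]
    by_cases hγ : γ ∈ S₀
    · have hmem : γ ∈ (S₀ : Set (heckeMatrices N m)) := hγ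
      have hτw : τ γ < T γ w := hw.2 γ hγ
      have hQ : greenQ s (T γ w) ≤ greenQ s (τ γ) :=
        greenQ_antitoneOn hs1 (Set.mem_Ioi.mpr (hτ1 γ)) (Set.mem_Ioi.mpr (lt_trans (hτ1 γ) hτw))
          hτw.le
      simp only [v, Set.indicator_of_mem hmem]
      have : 0 ≤ 4 ^ s / s * Real.exp 1 ^ s * (T γ w₀ ^ s)⁻¹ := by
        have := hT1 γ w₀
        positivity
      linarith
    · obtain ⟨h2, hinv⟩ := hfar γ hγ w hw
      have hmem : γ ∉ (S₀ : Set (heckeMatrices N m)) := hγ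
      simp only [v, Set.indicator_of_notMem hmem, zero_add]
      calc greenQ s (T γ w) ≤ 4 ^ s / s * (T γ w ^ s)⁻¹ := greenQ_le_of_two_le h2.le hs1
        _ ≤ 4 ^ s / s * (Real.exp 1 ^ s * (T γ w₀ ^ s)⁻¹) :=
            mul_le_mul_of_nonneg_left hinv (by positivity)
        _ = 4 ^ s / s * Real.exp 1 ^ s * (T γ w₀ ^ s)⁻¹ := by ring
  have hterm : ∀ γ, ContinuousOn (fun w => greenQ s (T γ w)) U := by
    intro γ
    refine (continuousOn_greenQ hs1).comp (hTcont γ).continuousOn fun w hw => ?_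
    rw [Set.mem_Ioi]
    by_cases hγ : γ ∈ S₀
    · exact lt_trans (hτ1 γ) (hw.2 γ hγ)
    · linarith [(hfar γ hγ w hw).1]
  have hcont : ContinuousOn (fun w => ∑' γ, greenQ s (T γ w)) U :=
    continuousOn_tsum hterm hv hbound
  have hat : ContinuousAt (fun w => ∑' γ, greenQ s (T γ w)) w₀ := hcont.continuousAt hUmem
  exact continuousAt_const.mul hat

/-- **`G_{r+1,f}(z₁, ·)` is continuous off `Z_f`** (`r ≥ 1`, `f` with finite principal part):
a finite sum (`principalHigherGreen_eq_sum`) of the continuous `G_{r+1}^{Γ₀(N), m}(z₁, ·)`,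
`c(-m) ≠ 0` (`continuousAt_higherGreen`). [cite: BruinierLiYang2025, (1.3)] -/
theorem continuousAt_principalHigherGreen {N r M : ℕ} (hr : 1 ≤ r) {c : ℤ → ℚ}
    (hc : ∀ m : ℤ, m < -(M : ℤ) → c m = 0) (z₁ : ℍ) {w₀ : ℍ}
    (h : ∀ m : ℕ+, c (-(m : ℤ)) ≠ 0 → ¬ OnHeckeCorrespondence N (m : ℤ) z₁ w₀) :
    ContinuousAt (fun w : ℍ => principalHigherGreen N r c z₁ w) w₀ := by
  have hfun : (fun w : ℍ => principalHigherGreen N r c z₁ w) = fun w =>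
      ∑ m ∈ Finset.Icc 1 M,
        (c (-(m : ℤ)) : ℝ) * (m : ℝ) ^ r * higherGreen N (r + 1) (m : ℤ) z₁ w :=
    funext fun w => principalHigherGreen_eq_sum hc z₁ w
  rw [hfun]
  refine tendsto_finsetSum _ fun m hm => ?_
  have hm1 : 1 ≤ m := (Finset.mem_Icc.mp hm).1
  by_cases hcm : c (-(m : ℤ)) = 0
  · simp only [hcm, Rat.cast_zero, zero_mul]
    exact tendsto_const_nhds
  · have hm0 : (0 : ℤ) < (m : ℤ) := by exact_mod_cast hm1
    have hoff : ¬ OnHeckeCorrespondence N (m : ℤ) z₁ w₀ := by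
      have := h ⟨m, hm1⟩ (by simpa using hcm)
      simpa using this
    exact (continuousAt_const.mul (continuousAt_higherGreen hm0 (by omega) z₁ hoff)).tendsto

open scoped _root_.Topology in
/-- Continuity of `G_s^{Γ₀(N), m}(·, z₂)` in the FIRST variable off `T_m` (by the symmetry
`higherGreen_symm`). [cite: BruinierLiYang2025, (1.1)–(1.2)] -/
theorem continuousAt_higherGreen_left {N : ℕ} {m : ℤ} (hm : 0 < m) {s : ℕ} (hs : 2 ≤ s)
    {z₀ : ℍ} (z₂ : ℍ) (h : ¬ OnHeckeCorrespondence N m z₀ z₂) :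
    ContinuousAt (fun z : ℍ => higherGreen N s m z z₂) z₀ := by
  have h' : ¬ OnHeckeCorrespondence N m z₂ z₀ := fun hh =>
    h ((onHeckeCorrespondence_comm hm z₂ z₀).mp hh)
  have hc := continuousAt_higherGreen hm hs z₂ h'
  have hfun : (fun z : ℍ => higherGreen N s m z z₂) = fun z => higherGreen N s m z₂ z :=
    funext fun z => higherGreen_symm hm s z z₂
  rw [hfun]
  exact hc

open scoped _root_.Topology in
/-- Vanishing of `G_s^{Γ₀(N)}(·, z₂)` at every cusp in the FIRST variable (by symmetry).
[cite: BruinierLiYang2025, (1.1)] -/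
theorem tendsto_higherGreen_one_sl_smul_atImInfty_left (N : ℕ) {s : ℕ} (hs : 2 ≤ s) (z₂ : ℍ)
    (σ : SL(2, ℤ)) :
    Tendsto (fun z : ℍ => higherGreen N s 1 (σ • z) z₂) UpperHalfPlane.atImInfty (𝓝 0) := by
  have hfun : (fun z : ℍ => higherGreen N s 1 (σ • z) z₂) = fun z => higherGreen N s 1 z₂ (σ • z) :=
    funext fun z => higherGreen_symm one_pos s (σ • z) z₂
  rw [hfun]
  exact tendsto_higherGreen_one_sl_smul_atImInfty N hs z₂ σ

/-! ## `T_m = Z(m, 0)`: the incidence relation of Corollary 2.4 -/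

/-- **`T_m = Z(m, 0)` pointwise** (Bruinier–Li–Yang 2025, proof of Corollary 2.4, (2.16)): with
`X(z₁, z₂) = (z₁ -z₁z₂; 1 -z₂) ∈ M₂(ℂ)` and the bilinear form `(X, Y) = det(X+Y) - det X - det Y`
of the quadratic space `(M₂(ℚ), det)`, one has `(X(z₁, z₂), x) = c z₁ z₂ + d z₁ - a z₂ - b` for
`x = (a b; c d)`, and this vanishes iff `x z₂ = z₁`. Hence `(z₁, z₂) ∈ T_m` iff
`(X(z₁, z₂), x) = 0` for some `x ∈ L_{m,0} = R_N^{(m)}` (`m ≠ 0`). [cite: BruinierLiYang2025, Cor. 2.4 (proof)] -/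
theorem onHeckeCorrespondence_iff_exists_incidence {N : ℕ} {m : ℤ} (hm : 0 < m) (z₁ z₂ : ℍ) :
    OnHeckeCorrespondence N m z₁ z₂ ↔ ∃ x ∈ heckeMatrices N m,
      (x 1 0 : ℂ) * z₁ * z₂ + (x 1 1 : ℂ) * z₁ - (x 0 0 : ℂ) * z₂ - (x 0 1 : ℂ) = 0 := by
  constructor
  · rintro ⟨x, hx, hxz⟩
    refine ⟨x, hx, ?_⟩
    have hden := linear_ne_zero_of_det_ne_zero (det_ne_zero_of_mem_heckeMatrices hm.ne' hx) z₂
    have h := congrArg UpperHalfPlane.coe hxz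
    rw [coe_intGL_smul hm hx, div_eq_iff hden] at h
    linear_combination -h
  · rintro ⟨x, hx, h⟩
    refine ⟨x, hx, UpperHalfPlane.ext ?_⟩
    have hden := linear_ne_zero_of_det_ne_zero (det_ne_zero_of_mem_heckeMatrices hm.ne' hx) z₂
    rw [coe_intGL_smul hm hx, div_eq_iff hden]
    linear_combination -h

/-! ## The hypothesis class: trivial members and the degenerate case of Conjecture 1.1 -/

/-- The zero form lies in `M^{!,∞}_k(Γ₀(N))` with rational (zero) coefficients: the hypothesis
class `IsRatWeaklyHolomorphicForm` of `GKZAlgebraicity` is inhabited. [folklore] -/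
theorem isRatWeaklyHolomorphicForm_zero (N : ℕ) (k : ℤ) :
    IsRatWeaklyHolomorphicForm N k 0 0 where
  mdifferentiable := mdifferentiable_const
  slash_eq γ _ := SlashAction.zero_slash k _
  finite_principalPart := ⟨0, fun _ _ => rfl⟩
  hasSum_fourier z := by simp
  isBoundedAtImInfty_slash γ _ := by
    rw [SlashAction.zero_slash]
    exact UpperHalfPlane.zero_form_isBoundedAtImInfty

/-- With zero principal coefficients the principal higher Green function vanishes. [folklore] -/
theorem principalHigherGreen_eq_zero_of_coeff {N r : ℕ} {c : ℤ → ℚ}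
    (hc : ∀ m : ℕ+, c (-(m : ℤ)) = 0) (z₁ z₂ : ℍ) : principalHigherGreen N r c z₁ z₂ = 0 := by
  unfold principalHigherGreen
  simp [hc]

/-- **The degenerate case of Conjecture 1.1**: if `f` has no principal part (`c(-m) = 0` for all
`m ≥ 1`; for weight `-2r < 0` this forces `f = 0`), then `G_{r+1,f} = 0 = |d₁d₂|^{-r/2} log|1|`,
so the conclusion of `GKZAlgebraicity` holds with `α = 1`. [cite: BruinierLiYang2025, Conj. 1.1] -/
theorem gkz_conclusion_of_coeff_eq_zero {N r : ℕ} {c : ℤ → ℚ} (hc : ∀ m : ℕ+, c (-(m : ℤ)) = 0)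
    (z₁ z₂ : ℍ) (d₁ d₂ : ℤ) :
    ∃ α : ℂ, IsAlgebraic ℚ α ∧ α ≠ 0 ∧
      principalHigherGreen N r c z₁ z₂ = |((d₁ * d₂ : ℤ) : ℝ)| ^ (-(r : ℝ) / 2) * Real.log ‖α‖ :=
  ⟨1, isAlgebraic_one, one_ne_zero, by
    rw [principalHigherGreen_eq_zero_of_coeff hc, norm_one, Real.log_one, mul_zero]⟩

/-! ## Joint continuity of `G_s^{Γ₀(N), m}` on `(ℍ × ℍ) ∖ T_m` -/

/-- Joint comparison: `cosh d(z₁, γ w₀) ≤ e^{d(z, z₁) + d(w, w₀)} cosh d(z, γ w)` for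
`γ ∈ R_N^{(m)}`, `m > 0` (triangle inequality and the isometry `d(γw, γw₀) = d(w, w₀)`). [folklore] -/
theorem coshDistArg_le_exp_mul₂ {N : ℕ} {m : ℤ} (hm : 0 < m) {γ : Matrix (Fin 2) (Fin 2) ℤ}
    (hγ : γ ∈ heckeMatrices N m) (z z₁ w w₀ : ℍ) :
    1 + dist (z₁ : ℂ) ((intGL γ • w₀ : ℍ) : ℂ) ^ 2 / (2 * z₁.im * (intGL γ • w₀).im) ≤
      Real.exp (dist z z₁ + dist w w₀) *
        (1 + dist (z : ℂ) ((intGL γ • w : ℍ) : ℂ) ^ 2 / (2 * z.im * (intGL γ • w).im)) := by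
  rw [one_add_dist_sq_div_eq_cosh_dist, one_add_dist_sq_div_eq_cosh_dist]
  apply cosh_le_exp_mul_cosh
  have hpos : 0 < ((intGL γ).det : ℝ) := by
    rw [val_det_intGL (det_ne_zero_of_mem_heckeMatrices hm.ne' hγ), (mem_heckeMatrices.mp hγ).1]
    exact_mod_cast hm
  have h1 : |dist z₁ (intGL γ • w₀) - dist z (intGL γ • w₀)| ≤ dist z₁ z := abs_dist_sub_le _ _ _
  have h2 : |dist z (intGL γ • w₀) - dist z (intGL γ • w)| ≤ dist (intGL γ • w₀) (intGL γ • w) := by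
    rw [dist_comm z, dist_comm z]
    exact abs_dist_sub_le _ _ _
  rw [dist_smul_smul_of_det_pos hpos w₀ w] at h2
  calc |dist z₁ (intGL γ • w₀) - dist z (intGL γ • w)|
      ≤ |dist z₁ (intGL γ • w₀) - dist z (intGL γ • w₀)| +
          |dist z (intGL γ • w₀) - dist z (intGL γ • w)| := abs_sub_le _ _ _
    _ ≤ dist z₁ z + dist w₀ w := add_le_add h1 h2
    _ = dist z z₁ + dist w w₀ := by rw [dist_comm z₁, dist_comm w₀]

/-- The argument `1 + |z - g w|²/(2 Im z Im gw)` is jointly continuous in `(z, w)`. [folklore] -/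
theorem continuous_coshDistArg₂ (g : GL (Fin 2) ℝ) :
    Continuous fun p : ℍ × ℍ =>
      1 + dist (p.1 : ℂ) ((g • p.2 : ℍ) : ℂ) ^ 2 / (2 * p.1.im * (g • p.2).im) := by
  have hsm : Continuous fun p : ℍ × ℍ => g • p.2 := (continuous_const_smul g).comp continuous_snd
  refine continuous_const.add (Continuous.div ?_ ?_ fun p => ?_)
  · exact ((UpperHalfPlane.continuous_coe.comp continuous_fst).dist
      (UpperHalfPlane.continuous_coe.comp hsm)).pow 2
  · exact (continuous_const.mul (UpperHalfPlane.continuous_im.comp continuous_fst)).mul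
      (UpperHalfPlane.continuous_im.comp hsm)
  · have := (g • p.2).im_pos
    have := p.1.im_pos
    positivity

open scoped _root_.Topology in
/-- **`G_s^{Γ₀(N), m}` is jointly continuous off `T_m`**: for `m ≥ 1`, `s ≥ 2` and
`(z₁, w₀) ∉ T_m`, `(z, w) ↦ G_s^{Γ₀(N), m}(z, w)` is continuous at `(z₁, w₀)` (so `G_s^{Γ₀(N), m}`
is a continuous function on `(X₀(N) × X₀(N)) ∖ T_m`). Same Weierstrass `M`-test as
`continuousAt_higherGreen`, with the joint comparison `coshDistArg_le_exp_mul₂` (constant `e²` on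
the product of the two hyperbolic unit balls). [cite: BruinierLiYang2025, (1.1)–(1.2)] -/
theorem continuousAt_higherGreen₂ {N : ℕ} {m : ℤ} (hm : 0 < m) {s : ℕ} (hs : 2 ≤ s)
    {z₁ w₀ : ℍ} (h : ¬ OnHeckeCorrespondence N m z₁ w₀) :
    ContinuousAt (fun p : ℍ × ℍ => higherGreen N s m p.1 p.2) (z₁, w₀) := by
  have hs1 : 1 ≤ s := by omega
  set T : heckeMatrices N m → ℍ × ℍ → ℝ := fun γ p =>
    1 + dist (p.1 : ℂ) ((intGL (γ : Matrix (Fin 2) (Fin 2) ℤ) • p.2 : ℍ) : ℂ) ^ 2 /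
      (2 * p.1.im * (intGL (γ : Matrix (Fin 2) (Fin 2) ℤ) • p.2).im) with hT_def
  set p₀ : ℍ × ℍ := (z₁, w₀) with hp₀
  have hT1 : ∀ γ p, 1 ≤ T γ p := fun γ p => one_le_coshDistArg p.1 _
  have hTcont : ∀ γ, Continuous (T γ) := fun γ => continuous_coshDistArg₂ _
  have hT0 : ∀ γ, 1 < T γ p₀ := by
    intro γ
    have hne : (z₁ : ℂ) ≠ ((intGL (γ : Matrix (Fin 2) (Fin 2) ℤ) • w₀ : ℍ) : ℂ) := fun heq =>
      h ⟨γ, γ.2, (UpperHalfPlane.ext heq).symm⟩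
    have hd := dist_pos.mpr hne
    have hv := (intGL (γ : Matrix (Fin 2) (Fin 2) ℤ) • w₀).im_pos
    have hy := z₁.im_pos
    have : 0 < dist (z₁ : ℂ) ((intGL (γ : Matrix (Fin 2) (Fin 2) ℤ) • w₀ : ℍ) : ℂ) ^ 2 /
        (2 * z₁.im * (intGL (γ : Matrix (Fin 2) (Fin 2) ℤ) • w₀).im) := by positivity
    show 1 < 1 + _
    linarith
  -- joint comparison on the product of unit balls (`dist` on `ℍ × ℍ` is the sup distance)
  have hcmp : ∀ γ (p : ℍ × ℍ), dist p p₀ < 1 → T γ p₀ ≤ Real.exp 2 * T γ p := by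
    intro γ p hp
    rw [Prod.dist_eq, max_lt_iff] at hp
    have h1 : dist p.1 z₁ < 1 := hp.1
    have h2 : dist p.2 w₀ < 1 := hp.2
    calc T γ p₀ ≤ Real.exp (dist p.1 z₁ + dist p.2 w₀) * T γ p :=
          coshDistArg_le_exp_mul₂ hm γ.2 p.1 z₁ p.2 w₀
      _ ≤ Real.exp 2 * T γ p :=
          mul_le_mul_of_nonneg_right (Real.exp_le_exp.mpr (by linarith)) (by linarith [hT1 γ p])
  have hsum0 : Summable fun γ => (T γ p₀ ^ s)⁻¹ := summable_inv_pow_coshDistArg hm hs z₁ w₀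
  have hfin : {γ : heckeMatrices N m | T γ p₀ ≤ 2 * Real.exp 2}.Finite := by
    have hpos : (0 : ℝ) < ((2 * Real.exp 2) ^ s)⁻¹ := by positivity
    have hev := hsum0.tendsto_cofinite_zero.eventually (gt_mem_nhds hpos)
    refine (Filter.eventually_cofinite.mp hev).subset fun γ hγ => ?_
    simp only [Set.mem_setOf_eq, not_lt] at hγ ⊢
    exact inv_anti₀ (by have := hT1 γ p₀; positivity)
      (pow_le_pow_left₀ (by linarith [hT1 γ p₀]) hγ s)
  set S₀ := hfin.toFinset with hS₀
  have hmemS₀ : ∀ γ, γ ∈ S₀ ↔ T γ p₀ ≤ 2 * Real.exp 2 := fun γ => by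
    rw [hS₀, Set.Finite.mem_toFinset, Set.mem_setOf_eq]
  let τ : heckeMatrices N m → ℝ := fun γ => (1 + T γ p₀) / 2
  have hτ1 : ∀ γ, 1 < τ γ := fun γ => by simp only [τ]; linarith [hT0 γ]
  have hτT : ∀ γ, τ γ < T γ p₀ := fun γ => by simp only [τ]; linarith [hT0 γ]
  set U : Set (ℍ × ℍ) := {p | dist p p₀ < 1 ∧ ∀ γ ∈ S₀, τ γ < T γ p} with hU
  have hUmem : U ∈ 𝓝 p₀ := by
    have h2 : ∀ᶠ p in 𝓝 p₀, ∀ γ ∈ S₀, τ γ < T γ p :=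
      (Filter.eventually_all_finset S₀).mpr fun γ _ =>
        continuousAt_const.eventually_lt (hTcont γ).continuousAt (hτT γ)
    filter_upwards [Metric.ball_mem_nhds p₀ one_pos, h2] with p hp1 hp2
    exact ⟨Metric.mem_ball.mp hp1, hp2⟩
  have hfar : ∀ γ, γ ∉ S₀ → ∀ p ∈ U,
      2 < T γ p ∧ (T γ p ^ s)⁻¹ ≤ Real.exp 2 ^ s * (T γ p₀ ^ s)⁻¹ := by
    intro γ hγ p hp
    rw [hmemS₀, not_le] at hγ
    have hc := hcmp γ p hp.1
    have he : 0 < Real.exp 2 := Real.exp_pos 2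
    refine ⟨?_, ?_⟩
    · by_contra hle
      simp only [not_lt] at hle
      nlinarith
    · have h1 : T γ p₀ ^ s ≤ Real.exp 2 ^ s * T γ p ^ s := by
        rw [← mul_pow]
        exact pow_le_pow_left₀ (by linarith [hT1 γ p₀]) hc s
      have hes : 0 < Real.exp 2 ^ s := pow_pos he s
      have hTp : 0 < T γ p := by linarith [hT1 γ p]
      calc (T γ p ^ s)⁻¹ = Real.exp 2 ^ s * (Real.exp 2 ^ s * T γ p ^ s)⁻¹ := by
            field_simp
        _ ≤ Real.exp 2 ^ s * (T γ p₀ ^ s)⁻¹ :=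
            mul_le_mul_of_nonneg_left (inv_anti₀ (by have := hT1 γ p₀; positivity) h1) hes.le
  let v : heckeMatrices N m → ℝ := fun γ =>
    (S₀ : Set (heckeMatrices N m)).indicator (fun γ => greenQ s (τ γ)) γ +
      4 ^ s / s * Real.exp 2 ^ s * (T γ p₀ ^ s)⁻¹
  have hv : Summable v := by
    refine Summable.add ?_ ?_
    · refine summable_of_ne_finset_zero (s := S₀) fun γ hγ => ?_
      exact Set.indicator_of_notMem (by simpa using hγ) _
    · simpa only [mul_assoc] using (hsum0.mul_left (4 ^ s / s * Real.exp 2 ^ s))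
  have hbound : ∀ γ (p : ℍ × ℍ), p ∈ U → ‖greenQ s (T γ p)‖ ≤ v γ := by
    intro γ p hp
    rw [Real.norm_of_nonneg (greenQ_nonneg (by linarith [hT1 γ p]) s)]
    by_cases hγ : γ ∈ S₀
    · have hmem : γ ∈ (S₀ : Set (heckeMatrices N m)) := hγ
      have hτp : τ γ < T γ p := hp.2 γ hγ
      have hQ : greenQ s (T γ p) ≤ greenQ s (τ γ) :=
        greenQ_antitoneOn hs1 (Set.mem_Ioi.mpr (hτ1 γ)) (Set.mem_Ioi.mpr (lt_trans (hτ1 γ) hτp))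
          hτp.le
      simp only [v, Set.indicator_of_mem hmem]
      have : 0 ≤ 4 ^ s / s * Real.exp 2 ^ s * (T γ p₀ ^ s)⁻¹ := by
        have := hT1 γ p₀
        positivity
      linarith
    · obtain ⟨h2, hinv⟩ := hfar γ hγ p hp
      have hmem : γ ∉ (S₀ : Set (heckeMatrices N m)) := hγ
      simp only [v, Set.indicator_of_notMem hmem, zero_add]
      calc greenQ s (T γ p) ≤ 4 ^ s / s * (T γ p ^ s)⁻¹ := greenQ_le_of_two_le h2.le hs1
        _ ≤ 4 ^ s / s * (Real.exp 2 ^ s * (T γ p₀ ^ s)⁻¹) :=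
            mul_le_mul_of_nonneg_left hinv (by positivity)
        _ = 4 ^ s / s * Real.exp 2 ^ s * (T γ p₀ ^ s)⁻¹ := by ring
  have hterm : ∀ γ, ContinuousOn (fun p => greenQ s (T γ p)) U := by
    intro γ
    refine (continuousOn_greenQ hs1).comp (hTcont γ).continuousOn fun p hp => ?_
    rw [Set.mem_Ioi]
    by_cases hγ : γ ∈ S₀
    · exact lt_trans (hτ1 γ) (hp.2 γ hγ)
    · linarith [(hfar γ hγ p hp).1]
  have hcont : ContinuousOn (fun p => ∑' γ, greenQ s (T γ p)) U :=
    continuousOn_tsum hterm hv hbound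
  have hat : ContinuousAt (fun p => ∑' γ, greenQ s (T γ p)) p₀ := hcont.continuousAt hUmem
  exact continuousAt_const.mul hat

/-- **`G_{r+1,f}` is jointly continuous off `Z_f`** (`r ≥ 1`, finite principal part): a finite sum
of the jointly continuous `G_{r+1}^{Γ₀(N), m}`, `c(-m) ≠ 0` (`continuousAt_higherGreen₂`).
[cite: BruinierLiYang2025, (1.3)] -/
theorem continuousAt_principalHigherGreen₂ {N r M : ℕ} (hr : 1 ≤ r) {c : ℤ → ℚ}
    (hc : ∀ m : ℤ, m < -(M : ℤ) → c m = 0) {z₁ w₀ : ℍ}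
    (h : ∀ m : ℕ+, c (-(m : ℤ)) ≠ 0 → ¬ OnHeckeCorrespondence N (m : ℤ) z₁ w₀) :
    ContinuousAt (fun p : ℍ × ℍ => principalHigherGreen N r c p.1 p.2) (z₁, w₀) := by
  have hfun : (fun p : ℍ × ℍ => principalHigherGreen N r c p.1 p.2) = fun p =>
      ∑ m ∈ Finset.Icc 1 M,
        (c (-(m : ℤ)) : ℝ) * (m : ℝ) ^ r * higherGreen N (r + 1) (m : ℤ) p.1 p.2 :=
    funext fun p => principalHigherGreen_eq_sum hc p.1 p.2
  rw [hfun]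
  refine tendsto_finsetSum _ fun m hm => ?_
  have hm1 : 1 ≤ m := (Finset.mem_Icc.mp hm).1
  by_cases hcm : c (-(m : ℤ)) = 0
  · simp only [hcm, Rat.cast_zero, zero_mul]
    exact tendsto_const_nhds
  · have hm0 : (0 : ℤ) < (m : ℤ) := by exact_mod_cast hm1
    have hoff : ¬ OnHeckeCorrespondence N (m : ℤ) z₁ w₀ := by
      have := h ⟨m, hm1⟩ (by simpa using hcm)
      simpa using this
    exact (continuousAt_const.mul (continuousAt_higherGreen₂ hm0 (by omega) hoff)).tendsto

/-! ## Changing the level: `G_s^{SL(2,ℤ)}` as a sum of `G_s^{Γ₀(N)}` over `Γ₀(N) \ SL(2, ℤ)` -/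

open Literature.NumberTheory.EllipticCurves.ModularForms (matrix_mul_right_cancel_of_det_ne_zero) in
/-- **Level `1` versus level `N`.** For `s ≥ 2` and any system of representatives `(σᵢ)_{i ∈ ι}` of
`Γ₀(N) \ SL(2, ℤ)` (every `δ ∈ SL(2, ℤ)` is `γ σᵢ`, `γ ∈ Γ₀(N)`, for exactly one `i`),
`G_s^{SL(2, ℤ)}(z₁, z₂) = Σᵢ G_s^{Γ₀(N)}(z₁, σᵢ z₂)`: the sum (1.1) over `SL(2, ℤ) = R_1^{(1)}`
(level `N = 1`) fibres over the cosets `Γ₀(N) σᵢ`, and may be summed fibrewise because it converges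
absolutely (`summable_greenQ_heckeMatrices`). [cite: BruinierLiYang2025, (1.1)] -/
theorem higherGreen_level_one_eq_tsum {N : ℕ} {s : ℕ} (hs : 2 ≤ s) {ι : Type*} (σ : ι → SL(2, ℤ))
    (hT : ∀ δ : SL(2, ℤ), ∃! i, ∃ γ : SL(2, ℤ), γ ∈ Gamma0 N ∧ γ * σ i = δ) (z₁ z₂ : ℍ) :
    higherGreen 1 s 1 z₁ z₂ = ∑' i, higherGreen N s 1 z₁ (σ i • z₂) := by
  have hm : (0 : ℤ) < 1 := one_pos
  -- `R_1^{(1)}` is the set of matrices of `SL(2, ℤ)`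
  have hmem1 : ∀ δ : SL(2, ℤ), (δ : Matrix (Fin 2) (Fin 2) ℤ) ∈ heckeMatrices 1 1 := fun δ =>
    mem_heckeMatrices.mpr ⟨δ.det_coe, by simp⟩
  -- the bijection `ι × R_N^{(1)} → R_1^{(1)}`, `(i, γ) ↦ γ σᵢ`
  let toSL : heckeMatrices N 1 → SL(2, ℤ) := fun γ =>
    ⟨(γ : Matrix (Fin 2) (Fin 2) ℤ), (mem_heckeMatrices.mp γ.2).1⟩
  have htoSL : ∀ γ : heckeMatrices N 1, toSL γ ∈ Gamma0 N := fun γ =>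
    (coe_mem_heckeMatrices_one_iff _).mp γ.2
  let Φ : ι × heckeMatrices N 1 → heckeMatrices 1 1 := fun p =>
    ⟨(p.2 : Matrix (Fin 2) (Fin 2) ℤ) * (σ p.1 : Matrix (Fin 2) (Fin 2) ℤ), by
      simpa only [Matrix.SpecialLinearGroup.coe_mul] using hmem1 (toSL p.2 * σ p.1)⟩
  have hΦ : Function.Bijective Φ := by
    constructor
    · rintro ⟨i, γ⟩ ⟨i', γ'⟩ h
      have hmat : (γ : Matrix (Fin 2) (Fin 2) ℤ) * (σ i : Matrix (Fin 2) (Fin 2) ℤ) =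
          (γ' : Matrix (Fin 2) (Fin 2) ℤ) * (σ i' : Matrix (Fin 2) (Fin 2) ℤ) :=
        congrArg Subtype.val h
      have hSL : toSL γ * σ i = toSL γ' * σ i' := Subtype.ext (by
        simpa only [Matrix.SpecialLinearGroup.coe_mul] using hmat)
      have hi : i = i' := by
        obtain ⟨i₀, -, huniq⟩ := hT (toSL γ * σ i)
        exact (huniq i ⟨toSL γ, htoSL γ, rfl⟩).trans (huniq i' ⟨toSL γ', htoSL γ', hSL.symm⟩).symm
      subst hi
      have hσdet : ((σ i : SL(2, ℤ)) : Matrix (Fin 2) (Fin 2) ℤ).det ≠ 0 := by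
        rw [Matrix.SpecialLinearGroup.det_coe]
        exact one_ne_zero
      have hγ : (γ : Matrix (Fin 2) (Fin 2) ℤ) = (γ' : Matrix (Fin 2) (Fin 2) ℤ) :=
        matrix_mul_right_cancel_of_det_ne_zero hσdet hmat
      rw [Subtype.ext hγ]
    · rintro ⟨δ, hδ⟩
      obtain ⟨i, ⟨γ, hγ, h⟩, -⟩ := hT ⟨δ, (mem_heckeMatrices.mp hδ).1⟩
      refine ⟨(i, ⟨(γ : Matrix (Fin 2) (Fin 2) ℤ), (coe_mem_heckeMatrices_one_iff γ).mpr hγ⟩),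
        Subtype.ext ?_⟩
      have := congrArg (fun g : SL(2, ℤ) => (g : Matrix (Fin 2) (Fin 2) ℤ)) h
      simpa only [Matrix.SpecialLinearGroup.coe_mul] using this
  let e : ι × heckeMatrices N 1 ≃ heckeMatrices 1 1 := Equiv.ofBijective Φ hΦ
  -- the summand in `cosh` form, summable over `R_1^{(1)}`
  set F : heckeMatrices 1 1 → ℝ := fun δ =>
    greenQ s (Real.cosh (dist z₁ (intGL (δ : Matrix (Fin 2) (Fin 2) ℤ) • z₂))) with hF
  have hsum : Summable F := by
    refine (summable_greenQ_heckeMatrices (N := 1) hm hs z₁ z₂).congr fun δ => ?_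
    simp only [hF, one_add_dist_sq_div_eq_cosh_dist]
  have hsum' : Summable fun q : ι × heckeMatrices N 1 => F (e q) := (Equiv.summable_iff e).mpr hsum
  -- fibres
  have hfib : ∀ i, ∑' γ : heckeMatrices N 1, F (e (i, γ)) =
      ∑' γ : heckeMatrices N 1,
        greenQ s (Real.cosh (dist z₁ (intGL (γ : Matrix (Fin 2) (Fin 2) ℤ) • σ i • z₂))) := by
    intro i
    refine tsum_congr fun γ => ?_
    have hσdet : ((σ i : SL(2, ℤ)) : Matrix (Fin 2) (Fin 2) ℤ).det ≠ 0 := by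
      rw [Matrix.SpecialLinearGroup.det_coe]
      exact one_ne_zero
    simp only [hF, e, Equiv.ofBijective_apply, Φ]
    rw [intGL_mul (det_ne_zero_of_mem_heckeMatrices one_ne_zero γ.2) hσdet, mul_smul,
      sl_smul_eq_intGL_smul]
  calc higherGreen 1 s 1 z₁ z₂ = -2 * ∑' δ, F δ := higherGreen_eq_tsum_cosh_dist 1 s 1 z₁ z₂
    _ = -2 * ∑' q : ι × heckeMatrices N 1, F (e q) := by rw [e.tsum_eq]
    _ = -2 * ∑' i, ∑' γ : heckeMatrices N 1, F (e (i, γ)) := by rw [hsum'.tsum_prod]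
    _ = ∑' i, -2 * ∑' γ : heckeMatrices N 1, F (e (i, γ)) := by rw [tsum_mul_left]
    _ = ∑' i, higherGreen N s 1 z₁ (σ i • z₂) :=
        tsum_congr fun i => by rw [hfib i, higherGreen_eq_tsum_cosh_dist]

/-! ## The hypothesis class `M^{!,∞}_k(Γ₀(N))` with rational coefficients: `ℚ`-linearity, periodicity -/

/-- `M^{!,∞}_k(Γ₀(N))` with rational Fourier coefficients is closed under addition (coefficients
add). [folklore] -/
theorem IsRatWeaklyHolomorphicForm.add {N : ℕ} {k : ℤ} {f g : ℍ → ℂ} {c d : ℤ → ℚ}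
    (hf : IsRatWeaklyHolomorphicForm N k f c) (hg : IsRatWeaklyHolomorphicForm N k g d) :
    IsRatWeaklyHolomorphicForm N k (f + g) (c + d) where
  mdifferentiable := hf.mdifferentiable.add hg.mdifferentiable
  slash_eq γ hγ := by rw [SlashAction.add_slash, hf.slash_eq γ hγ, hg.slash_eq γ hγ]
  finite_principalPart := by
    obtain ⟨M, hM⟩ := hf.finite_principalPart
    obtain ⟨M', hM'⟩ := hg.finite_principalPart
    refine ⟨max M M', fun m hm => ?_⟩
    have h1 : m < -(M : ℤ) := lt_of_lt_of_le hm (by simp)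
    have h2 : m < -(M' : ℤ) := lt_of_lt_of_le hm (by simp)
    simp [hM m h1, hM' m h2]
  hasSum_fourier z := by
    have h := (hf.hasSum_fourier z).add (hg.hasSum_fourier z)
    simp only [Pi.add_apply, Rat.cast_add, add_mul]
    exact h
  isBoundedAtImInfty_slash γ hγ := by
    rw [SlashAction.add_slash]
    exact (hf.isBoundedAtImInfty_slash γ hγ).add (hg.isBoundedAtImInfty_slash γ hγ)

/-- `M^{!,∞}_k(Γ₀(N))` with rational Fourier coefficients is closed under rational scalars.
[folklore] -/
theorem IsRatWeaklyHolomorphicForm.smul {N : ℕ} {k : ℤ} {f : ℍ → ℂ} {c : ℤ → ℚ}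
    (hf : IsRatWeaklyHolomorphicForm N k f c) (q : ℚ) :
    IsRatWeaklyHolomorphicForm N k ((q : ℂ) • f) (q • c) where
  mdifferentiable := hf.mdifferentiable.const_smul (q : ℂ)
  slash_eq γ hγ := by
    rw [ModularForm.smul_slash, hf.slash_eq γ hγ]
    congr 1
    rw [show ((q : ℂ)) = ((q : ℝ) : ℂ) by norm_cast, UpperHalfPlane.σ_ofReal]
  finite_principalPart := by
    obtain ⟨M, hM⟩ := hf.finite_principalPart
    exact ⟨M, fun m hm => by simp [hM m hm]⟩
  hasSum_fourier z := by
    have h := (hf.hasSum_fourier z).mul_left (q : ℂ)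
    simp only [Pi.smul_apply, smul_eq_mul, Rat.cast_mul, mul_assoc]
    simpa only [mul_assoc] using h
  isBoundedAtImInfty_slash γ hγ := by
    rw [ModularForm.smul_slash]
    exact (hf.isBoundedAtImInfty_slash γ hγ).smul _

/-- `1`-periodicity `f(z + 1) = f(z)` of a form with a Fourier expansion `Σ c(m) e^{2πimz}` at `∞`.
[folklore] -/
theorem IsRatWeaklyHolomorphicForm.periodic {N : ℕ} {k : ℤ} {f : ℍ → ℂ} {c : ℤ → ℚ}
    (hf : IsRatWeaklyHolomorphicForm N k f c) (z : ℍ) : f ((1 : ℝ) +ᵥ z) = f z := by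
  have h1 := hf.hasSum_fourier ((1 : ℝ) +ᵥ z)
  have h2 := hf.hasSum_fourier z
  have heq : (fun m : ℤ => (c m : ℂ) * Complex.exp (2 * π * Complex.I * m * (((1 : ℝ) +ᵥ z : ℍ) : ℂ)))
      = fun m : ℤ => (c m : ℂ) * Complex.exp (2 * π * Complex.I * m * (z : ℂ)) := by
    funext m
    rw [UpperHalfPlane.coe_vadd, Complex.ofReal_one,
      show 2 * (π : ℂ) * Complex.I * m * (1 + (z : ℂ)) =
        2 * π * Complex.I * m * z + m * (2 * π * Complex.I) by ring,
      Complex.exp_add, Complex.exp_int_mul_two_pi_mul_I, mul_one]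
  rw [heq] at h1
  exact h1.unique h2


end Literature.NumberTheory.Automorphic
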